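import Literature.Barriers.AtomisticToContinuum.DisorderedHarmonicChainApproxKernelsFourier
import Literature.Barriers.AtomisticToContinuum.DisorderedHarmonicChainApproxKernelsToolkit
import Literature.Barriers.AtomisticToContinuum.DisorderedHarmonicChainApproxKernelsDecay
import Literature.Barriers.AtomisticToContinuum.DisorderedHarmonicChainApproxKernelsLaw
import HarnessLib

/-!
# Ajanki–Huveneers 2011, Lemma 5.2 (approximate kernels), eqs. (5.9)–(5.10) — proved

This file discharges the named fact `AjankiHuveneers2011_approxKernels`
(`DisorderedHarmonicChainPotential.lean`; O. Ajanki, F. Huveneers, *Rigorous scaling law for the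
heat current in disordered harmonic chain*, CMP **301** (2011) 841–883, arXiv:1003.1076, Lemma 5.2)
as `AjankiHuveneers2011_approxKernels_holds`, following the paper's Appendix 7.3 ("Proof of
Lemma 5.2") with one systematic change: the paper estimates `ξ`-DERIVATIVES of the multiplier
`Λ_n(ξ) = ∏_k λ_k(wξ)` and integrates by parts in `ξ` to place the weights `sinᵏπ(x+wn-y)`; here we
use first and second DIFFERENCES in `ξ ∈ ℤ` (the weight `sin πθ` is the half-shift
`(e^{iπθ} - e^{-iπθ})/2i`, `DisorderedHarmonicChainApproxKernelsFourier.sin_mul_trigSeries`), which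
avoids differentiating parameter integrals and keeps every estimate elementary.

Architecture (the support files are imported):
* `…ApproxKernelsLaw`: `S_{y,n}u(x) = 𝔼u(x + Z_n)` and `𝔼e^{2πiξZ_n} = e^{2πiξnw}Λ_n(ξ)`
  (the paper's (qn fourier), (Pn)); at least `n/2 ≥ 8… ` good frozen points (the paper's `m ≥ n/2`).
* `…ApproxKernelsFourier`: the everywhere-valid representation `S_{y,n}u(x) = Re ∑_ξ Λ_n v̂ e_ξ`
  for bounded Borel `u` (measure-theoretic Fourier uniqueness on `𝕋`), `C²` trigonometric sums,
  the `sin`-weight identities, `|v̂| ≤ ‖u‖₁`, `|Δv̂| ≤ 2πw²‖u‖₁`, `|Δ²v̂| ≤ (2πw²)²‖u‖₁`.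
* `…ApproxKernelsFactors`, `…ApproxKernelsDecay`: the paper's Lemma `lambda` on one multiplier
  `λ(y', ξ)`: `|λ| ≤ 1`, Gaussian bound for `|ξ|w ≤ ε₀` (λ-loc1), difference bounds (λ-loc2/3),
  decay `C₃/(|ξ|w)` and strict bound `A' < 1` for good `y'`.
* `…ApproxKernelsToolkit`: product rule for differences (`seqProd_bounds`), Gaussian and tail
  lattice sums.
* this file: (a) the representation for `S_{y,n}`; (b) bounds on `Λ_n, ΔΛ_n, Δ²Λ_n` in the two
  regimes `|ξ| ≤ N = ⌊ε₀/2w⌋` / `|ξ| > N` (`seqProd_bounds_small/large`, the difference form of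
  (Pn gauche droite)–(Pn grand)); (c) explicit majorants `B₀, B₁, B₂`; (d) their seven lattice sums
  `≲ (w√n)^{-1,-2,-3}`; (e) the coefficient sums; (f) the main lemma and the theorem.

No named facts are introduced; the only definitions are the concrete bookkeeping functions `ahF`
(the factor sequence), `gaussK`, `tailK` (explicit constants).
-/

noncomputable section

open MeasureTheory Real Complex Set

namespace Literature.Barriers.AtomisticToContinuum.HeatConduction

/-! ### Assembly, stage (a): `S_{y,n}u` is the real part of an absolutely convergent trigonometric series -/

section AssemblyA

variable {τ : ℝ → ℝ} {bm bp : ℝ} {w : ℝ} {h : ℝ → ℝ} {H : ℝ}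

/-- A continuous `1`-periodic function is bounded. [folklore] -/
theorem exists_bound_of_periodic_continuous {h : ℝ → ℝ} (hp : Function.Periodic h 1)
    (hc : Continuous h) : ∃ H : ℝ, ∀ z, |h z| ≤ H := by
  obtain ⟨C, hC⟩ := isCompact_Icc.exists_bound_of_continuousOn (s := Icc (0 : ℝ) 1) hc.continuousOn
  refine ⟨C, fun z => ?_⟩
  have hz : h z = h (Int.fract z) := by
    have := hp.int_mul (Int.floor z) (Int.fract z)
    rw [mul_one, Int.fract_add_floor] at this
    exact this
  rw [hz, ← Real.norm_eq_abs]
  exact hC _ ⟨Int.fract_nonneg z, (Int.fract_lt_one z).le⟩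

/-- `‖u‖₁ = ∫₀¹ |u|` as an interval integral. [folklore] -/
theorem ahL1_eq_intervalIntegral (u : ℝ → ℝ) : ahL1 u = ∫ s in (0 : ℝ)..1, |u s| := by
  unfold ahL1
  rw [intervalIntegral.integral_of_le zero_le_one, integral_Ico_eq_integral_Ioc]

/-- Translating a `1`-periodic function does not change `∫₀¹ |·|`. [folklore] -/
theorem intervalIntegral_abs_comp_add {u : ℝ → ℝ} (hu : Function.Periodic u 1) (y : ℝ) :
    ∫ s in (0 : ℝ)..1, |u (s + y)| = ∫ s in (0 : ℝ)..1, |u s| := by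
  have hp : Function.Periodic (fun s => |u s|) 1 := fun s => by simp [hu s]
  rw [intervalIntegral.integral_comp_add_right (fun s => |u s|) y, zero_add, add_comm 1 y]
  have := hp.intervalIntegral_add_eq y 0
  rw [zero_add] at this
  exact this

/-- `|(2πiξ) a(ξ)| = 2π|ξ| |a(ξ)|`. [folklore] -/
theorem norm_derivCoeff (a : ℤ → ℂ) (ξ : ℤ) : ‖derivCoeff a ξ‖ = 2 * π * |(ξ : ℝ)| * ‖a ξ‖ := by
  unfold derivCoeff
  rw [norm_mul, norm_mul, norm_mul, norm_mul, Complex.norm_two, Complex.norm_real, Real.norm_eq_abs,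
    abs_of_pos Real.pi_pos, Complex.norm_I, mul_one, Complex.norm_intCast]

/-- The bounded Borel representative: `|u| ≤ M`. [folklore] -/
theorem AHBallFn.exists_abs_le {u : ℝ → ℝ} {y r : ℝ} (hu : AHBallFn u y r) : ∃ M : ℝ, ∀ x, |u x| ≤ M := by
  obtain ⟨M, hM⟩ := hu.bounded
  exact ⟨M, fun x => by rw [abs_of_nonneg (hu.nonneg x)]; exact hM x⟩

/-- **Representation.** For `w‖h‖_∞b_* ≤ 1/2` and `∑_ξ |Π_j λ(y_j, ξ)| < ∞`,
`S_{y,n}u(x) = Re ∑_ξ (Π_j λ(y_j,ξ)) v̂(ξ) e^{2πiξ(x + nw - y)}` for EVERY `x`, `v = u(· + y)` — the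
paper's (qn fourier) "`S_{y,n}u(x) = T_{y_n}⋯T_{y_1}v(x-y) = ∑_ξ e^{i2πξ(x+nw-y)}Λ_n(ξ)v̂(ξ)`", here
for a bounded Borel representative and pointwise. [cite: AjankiHuveneers2011, App. 7.3 (eq. (qn fourier))] -/
theorem ahSy_eq_re_trigSeries (hτ : ReducedLawHyp τ bm bp) (hw : 0 < w) (hH : ∀ z, |h z| ≤ H)
    (hsmall : w * H * max |bm| |bp| ≤ 1 / 2) {u : ℝ → ℝ} {y r : ℝ} (hu : AHBallFn u y r) (n : ℕ)
    (hsum : Summable fun ξ : ℤ => ‖∏ j : Fin n, ahLam τ w h (ahPt y w j) ξ‖) (x : ℝ) :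
    ahSy τ w h y n u x =
      (trigSeries (fun ξ => (∏ j : Fin n, ahLam τ w h (ahPt y w j) ξ) * circleCoeff (fun t => u (t + y)) ξ)
        (x + (n * w - y))).re := by
  obtain ⟨M, hM⟩ := hu.exists_abs_le
  haveI hP : ∀ y', IsProbabilityMeasure (ahMu τ w h y') := fun y' =>
    isProbabilityMeasure_ahMu hτ hw.le hH hsmall y'
  haveI : IsProbabilityMeasure (ahPiN τ w h y n) := by unfold ahPiN; infer_instance
  rw [ahSy_eq_integral_pi hτ hw.le hH hsmall hu.measurable hM y n x]
  have hd : ∀ ξ : ℤ, ∫ B, cexp (2 * π * I * ξ * ahZ w y n B) ∂(ahPiN τ w h y n) =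
      cexp (2 * π * I * ξ * (n * w)) * ∏ j : Fin n, ahLam τ w h (ahPt y w j) ξ :=
    integral_cexp_ahZ hτ hw.le hH hsmall y n
  have hs : Summable fun ξ : ℤ => ‖cexp (2 * π * I * ξ * (n * w)) * ∏ j : Fin n, ahLam τ w h (ahPt y w j) ξ‖ := by
    refine hsum.congr fun ξ => ?_
    rw [norm_mul, show (2 * π * I * ξ * (n * w) : ℂ) = 2 * π * I * ξ * ((n * w : ℝ) : ℂ) by push_cast; ring,
      norm_cexp_phase, one_mul]
  rw [integral_comp_add_eq_re_tsum (measurable_ahZ w y n) hd hs hu.periodic hu.measurable hM x]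
  unfold trigSeries
  congr 1
  refine tsum_congr fun ξ => ?_
  have hcc : circleCoeff u ξ = cexp (-(2 * π * I * ξ * y)) * circleCoeff (fun t => u (t + y)) ξ := by
    rw [circleCoeff_comp_add hu.periodic y ξ, ← mul_assoc, ← Complex.exp_add, neg_add_cancel, Complex.exp_zero,
      one_mul]
  rw [hcc]
  have : cexp (2 * π * I * ξ * (n * w)) * cexp (-(2 * π * I * ξ * y)) * cexp (2 * π * I * ξ * x) =
      cexp (2 * π * I * ξ * ((x + (n * w - y) : ℝ) : ℂ)) := by
    rw [← Complex.exp_add, ← Complex.exp_add]; congr 1; push_cast; ring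
  calc cexp (2 * π * I * ξ * (n * w)) * (∏ j : Fin n, ahLam τ w h (ahPt y w j) ξ) *
        (cexp (-(2 * π * I * ξ * y)) * circleCoeff (fun t => u (t + y)) ξ) * cexp (2 * π * I * ξ * x)
      = (∏ j : Fin n, ahLam τ w h (ahPt y w j) ξ) * circleCoeff (fun t => u (t + y)) ξ *
        (cexp (2 * π * I * ξ * (n * w)) * cexp (-(2 * π * I * ξ * y)) * cexp (2 * π * I * ξ * x)) := by ring
    _ = _ := by rw [this]

end AssemblyA

/-! ### Assembly, stage (b): bounds on `Λ_n = ∏_j λ_j` and its differences, in the two regimes -/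

section AssemblyB

variable {τ : ℝ → ℝ} {bm bp : ℝ} {w : ℝ} {h : ℝ → ℝ}

/-- The sequence of factors `j ↦ λ(y - (j+1)w, ·)` of `Λ_n`. [cite: AjankiHuveneers2011, App. 7.3 (Pn)] -/
def ahF (τ : ℝ → ℝ) (w : ℝ) (h : ℝ → ℝ) (y : ℝ) : ℕ → ℤ → ℂ :=
  fun j ξ => ahLam τ w h (y - ((j : ℝ) + 1) * w) ξ

/-- `Λ_n(ξ) = ∏_{j<n} λ(y_j, ξ)` as a `seqProd`. [cite: AjankiHuveneers2011, App. 7.3 (Pn)] -/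
theorem seqProd_ahF (τ : ℝ → ℝ) (w : ℝ) (h : ℝ → ℝ) (y : ℝ) (n : ℕ) (ξ : ℤ) :
    seqProd (ahF τ w h y) n ξ = ∏ j : Fin n, ahLam τ w h (ahPt y w j) ξ := by
  unfold seqProd ahF ahPt
  rw [← Fin.prod_univ_eq_prod_range]

/-- `√(eˣ) = e^{x/2}`. [folklore] -/
theorem sqrt_exp_eq (x : ℝ) : Real.sqrt (rexp x) = rexp (x / 2) := by
  rw [Real.sqrt_eq_rpow, ← Real.exp_mul]
  congr 1
  ring

/-- `(x + d)² ≥ x²/2 - d²` and `(x + d)² ≤ 2x² + 2d²`. [folklore] -/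
theorem sq_add_bounds (x d : ℝ) : x ^ 2 / 2 - d ^ 2 ≤ (x + d) ^ 2 ∧ (x + d) ^ 2 ≤ 2 * x ^ 2 + 2 * d ^ 2 := by
  constructor <;> nlinarith [sq_nonneg (x + 2 * d), sq_nonneg (x - d)]

/-- **Small frequencies (`(|ξ|+2)w ≤ ε₀`): Gaussian bounds on `Λ_n` and its differences.** Every
factor obeys the Gaussian bound on the window `{ξ, ξ+1, ξ+2}`; the good half of the factors gives
`∑_j sin⁴(πy_j) ≥ (n/2)α₀²`, whence `|Λ_n| ≤ K_R e^{-c' n w² ξ²}`, `|ΔΛ_n| ≤ d₁ K_R e^{…} K_S n`,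
`|Δ²Λ_n| ≤ K_R e^{…}(d₂K_Sn + d₁²K_S²n²)` with `d₁ = C₁w²(3+|ξ|)`, `d₂ = C₂w²` — the difference form of
(Pn gauche droite), (Pn dérivée), (Pn 2 dérivée). [cite: AjankiHuveneers2011, App. 7.3, Lemma `lambda`] -/
theorem seqProd_bounds_small (hw0 : 0 < w) (hw1 : w ≤ 1) {y : ℝ} {n : ℕ} (hn : (n : ℝ) * w ^ 2 ≤ 1)
    {ε₀ CE C₁ C₂ α₀ σ2 : ℝ} (hCE : 0 ≤ CE) (hC₁ : 0 ≤ C₁) (hC₂ : 0 ≤ C₂) (hε₀1 : ε₀ ≤ 1) (hσ2 : 0 ≤ σ2)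
    (hα₀ : 0 ≤ α₀)
    (hgauss : ∀ (y' : ℝ) (ξ : ℤ), |(ξ : ℝ)| * w ≤ ε₀ →
      ‖ahLam τ w h y' ξ‖ ^ 2 ≤ 1 - 3 / 2 * π ^ 2 * σ2 * (Real.sin (π * y') ^ 2) ^ 2 * ((ξ : ℝ) * w) ^ 2 +
        CE * w * ((ξ : ℝ) * w) ^ 2)
    (hd1 : ∀ (y' : ℝ) (ξ : ℤ), ‖ahLam τ w h y' (ξ + 1) - ahLam τ w h y' ξ‖ ≤ C₁ * w ^ 2 * (1 + |(ξ : ℝ)|))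
    (hd2 : ∀ (y' : ℝ) (ξ : ℤ),
      ‖ahLam τ w h y' (ξ + 2) - 2 * ahLam τ w h y' (ξ + 1) + ahLam τ w h y' ξ‖ ≤ C₂ * w ^ 2)
    (hsmallCE : 2 * CE * w ≤ 3 / 16 * π ^ 2 * σ2 * α₀ ^ 2)
    (hgood : (n : ℝ) / 2 ≤ (((Finset.range n).filter fun j : ℕ =>
      α₀ ≤ Real.sin (π * (y - ((j : ℝ) + 1) * w)) ^ 2).card : ℕ))
    {ξ : ℤ} (hξ : (|(ξ : ℝ)| + 2) * w ≤ ε₀) {Rs Ss d₁ : ℝ}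
    (hRs : Rs = rexp (3 * π ^ 2 * σ2 + 4 * CE) *
      rexp (-(min 1 (3 / 32 * π ^ 2 * σ2 * α₀ ^ 2) * n * w ^ 2 * (ξ : ℝ) ^ 2)))
    (hSs : Ss = rexp (3 / 8 * π ^ 2 * σ2) * n) (hd₁ : d₁ = C₁ * w ^ 2 * (3 + |(ξ : ℝ)|)) :
    ‖seqProd (ahF τ w h y) n ξ‖ ≤ Rs ∧ ‖seqProd (ahF τ w h y) n (ξ + 1)‖ ≤ Rs ∧
    ‖seqProd (ahF τ w h y) n (ξ + 2)‖ ≤ Rs ∧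
    ‖seqProd (ahF τ w h y) n (ξ + 1) - seqProd (ahF τ w h y) n ξ‖ ≤ d₁ * Rs * Ss ∧
    ‖seqProd (ahF τ w h y) n (ξ + 2) - seqProd (ahF τ w h y) n (ξ + 1)‖ ≤ d₁ * Rs * Ss ∧
    ‖seqProd (ahF τ w h y) n (ξ + 2) - 2 * seqProd (ahF τ w h y) n (ξ + 1) + seqProd (ahF τ w h y) n ξ‖ ≤
      Rs * (C₂ * w ^ 2 * Ss + d₁ ^ 2 * Ss ^ 2) := by
  -- the Gaussian majorant of each factor on the window
  obtain ⟨αf, hαf⟩ : ∃ αf : ℕ → ℝ, αf = fun j : ℕ => Real.sin (π * (y - ((j : ℝ) + 1) * w)) ^ 2 := ⟨_, rfl⟩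
  have hαf0 : ∀ j, 0 ≤ αf j := fun j => by rw [hαf]; positivity
  have hαf1 : ∀ j, αf j ≤ 1 := fun j => by rw [hαf]; exact Real.sin_sq_le_one _
  obtain ⟨E, hE⟩ : ∃ E : ℕ → ℝ, E = fun j => -((ξ : ℝ) * w) ^ 2 * (3 / 4 * π ^ 2 * σ2 * αf j ^ 2 - 2 * CE * w) +
      w ^ 2 * (6 * π ^ 2 * σ2 + 8 * CE) := ⟨_, rfl⟩
  obtain ⟨r, hr⟩ : ∃ r : ℕ → ℝ, r = fun j => rexp (E j / 2) := ⟨_, rfl⟩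
  have hrpos : ∀ j, 0 < r j := fun j => by rw [hr]; exact Real.exp_pos _
  -- window control
  have hηw : ∀ a : ℝ, 0 ≤ a → a ≤ 2 → |((ξ : ℝ) + a)| * w ≤ ε₀ := fun a ha0 ha2 => by
    calc |((ξ : ℝ) + a)| * w ≤ (|(ξ : ℝ)| + |a|) * w := mul_le_mul_of_nonneg_right (abs_add_le _ _) hw0.le
      _ ≤ (|(ξ : ℝ)| + 2) * w := by rw [abs_of_nonneg ha0]; gcongr
      _ ≤ ε₀ := hξ
  have hfac : ∀ (j : ℕ) (a : ℝ), 0 ≤ a → a ≤ 2 → ∀ η : ℤ, (η : ℝ) = ξ + a → ‖ahF τ w h y j η‖ ≤ r j := by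
    intro j a ha0 ha2 η hη
    have hg := hgauss (y - ((j : ℝ) + 1) * w) η (by rw [hη]; exact hηw a ha0 ha2)
    rw [show Real.sin (π * (y - ((j : ℝ) + 1) * w)) ^ 2 = αf j by rw [hαf]] at hg
    have hsq := sq_add_bounds ((ξ : ℝ) * w) (a * w)
    have hηw2 : ((η : ℝ) * w) ^ 2 = ((ξ : ℝ) * w + a * w) ^ 2 := by rw [hη]; ring
    rw [hηw2] at hg
    have haw : (a * w) ^ 2 ≤ 4 * w ^ 2 := by
      rw [mul_pow]
      have : a ^ 2 ≤ 2 ^ 2 := pow_le_pow_left₀ ha0 ha2 2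
      nlinarith [sq_nonneg w]
    -- `-X ≤ E j`, with `K = (3/2)π²σ2 αf²`, `P = (ξw + aw)²`
    obtain ⟨K, hK⟩ : ∃ K : ℝ, K = 3 / 2 * π ^ 2 * σ2 * αf j ^ 2 := ⟨_, rfl⟩
    have hK0 : 0 ≤ K := by rw [hK]; positivity
    obtain ⟨P, hP⟩ : ∃ P : ℝ, P = ((ξ : ℝ) * w + a * w) ^ 2 := ⟨_, rfl⟩
    rw [← hP] at hg hsq
    have hα2 : αf j ^ 2 ≤ 1 := pow_le_one₀ (hαf0 j) (hαf1 j)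
    have i1 : K * (((ξ : ℝ) * w) ^ 2 / 2 - 4 * w ^ 2) ≤ K * P :=
      mul_le_mul_of_nonneg_left (by linarith only [hsq.1, haw]) hK0
    have i2 : CE * w * P ≤ CE * w * (2 * ((ξ : ℝ) * w) ^ 2 + 8 * w ^ 2) :=
      mul_le_mul_of_nonneg_left (by linarith only [hsq.2, haw]) (by positivity)
    have i3 : π ^ 2 * σ2 * αf j ^ 2 * w ^ 2 ≤ π ^ 2 * σ2 * 1 * w ^ 2 :=
      mul_le_mul_of_nonneg_right (mul_le_mul_of_nonneg_left hα2 (by positivity)) (sq_nonneg w)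
    have i4 : CE * w ^ 3 ≤ CE * w ^ 2 :=
      mul_le_mul_of_nonneg_left (pow_le_pow_of_le_one hw0.le hw1 (by norm_num)) hCE
    have hX : -(3 / 2 * π ^ 2 * σ2 * αf j ^ 2 * P) + CE * w * P ≤ E j := by
      rw [hE]; dsimp only
      have eK : 3 / 2 * π ^ 2 * σ2 * αf j ^ 2 * P = K * P := by rw [hK]
      have e1 : K * (((ξ : ℝ) * w) ^ 2 / 2 - 4 * w ^ 2) =
          ((ξ : ℝ) * w) ^ 2 * (3 / 4 * π ^ 2 * σ2 * αf j ^ 2) - 6 * (π ^ 2 * σ2 * αf j ^ 2 * w ^ 2) := by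
        rw [hK]; ring
      have e2 : CE * w * (2 * ((ξ : ℝ) * w) ^ 2 + 8 * w ^ 2) = ((ξ : ℝ) * w) ^ 2 * (2 * CE * w) + 8 * (CE * w ^ 3) := by
        ring
      rw [eK]
      rw [e1] at i1; rw [e2] at i2
      linarith only [i1, i2, i3, i4]
    have hsqn : ‖ahF τ w h y j η‖ ^ 2 ≤ rexp (E j) := by
      unfold ahF
      refine hg.trans ?_
      have := Real.add_one_le_exp (-(3 / 2 * π ^ 2 * σ2 * αf j ^ 2 * P) + CE * w * P)
      linarith only [this, Real.exp_le_exp.mpr hX]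
    rw [hr]; dsimp only
    have h0 : 0 ≤ ‖ahF τ w h y j η‖ := norm_nonneg _
    rw [← sqrt_exp_eq]
    calc ‖ahF τ w h y j η‖ = Real.sqrt (‖ahF τ w h y j η‖ ^ 2) := (Real.sqrt_sq h0).symm
      _ ≤ Real.sqrt (rexp (E j)) := Real.sqrt_le_sqrt hsqn
  -- the product of the majorants
  obtain ⟨G, hG⟩ : ∃ G : Finset ℕ, G = (Finset.range n).filter fun j : ℕ => α₀ ≤ αf j := ⟨_, rfl⟩
  have hgood' : (n : ℝ) / 2 ≤ (G.card : ℕ) := by rw [hG, hαf]; exact hgood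
  have hsumα : (n : ℝ) / 2 * α₀ ^ 2 ≤ ∑ j ∈ Finset.range n, αf j ^ 2 := by
    calc (n : ℝ) / 2 * α₀ ^ 2 ≤ (G.card : ℕ) * α₀ ^ 2 := mul_le_mul_of_nonneg_right hgood' (sq_nonneg _)
      _ = ∑ _j ∈ G, α₀ ^ 2 := by rw [Finset.sum_const, nsmul_eq_mul]
      _ ≤ ∑ j ∈ G, αf j ^ 2 := Finset.sum_le_sum fun j hj => by
          rw [hG, Finset.mem_filter] at hj
          exact pow_le_pow_left₀ hα₀ hj.2 2
      _ ≤ ∑ j ∈ Finset.range n, αf j ^ 2 :=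
          Finset.sum_le_sum_of_subset_of_nonneg (by rw [hG]; exact Finset.filter_subset _ _)
            fun j _ _ => sq_nonneg _
  have hc' : min 1 (3 / 32 * π ^ 2 * σ2 * α₀ ^ 2) ≤ 3 / 32 * π ^ 2 * σ2 * α₀ ^ 2 := min_le_right _ _
  -- `E j = A αf_j² + B`
  obtain ⟨A, hA⟩ : ∃ A : ℝ, A = -((ξ : ℝ) * w) ^ 2 * (3 / 4 * π ^ 2 * σ2) := ⟨_, rfl⟩
  obtain ⟨B, hB⟩ : ∃ B : ℝ, B = ((ξ : ℝ) * w) ^ 2 * (2 * CE * w) + w ^ 2 * (6 * π ^ 2 * σ2 + 8 * CE) := ⟨_, rfl⟩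
  have hEj : ∀ j, E j = A * αf j ^ 2 + B := fun j => by rw [hE, hA, hB]; dsimp only; ring
  have hz2 : 0 ≤ ((ξ : ℝ) * w) ^ 2 := sq_nonneg _
  have hz1 : ((ξ : ℝ) * w) ^ 2 ≤ 1 := by
    have h1 : |(ξ : ℝ)| * w ≤ 1 := by nlinarith only [hξ, hε₀1, hw0, abs_nonneg (ξ : ℝ)]
    have h2 : ((ξ : ℝ) * w) ^ 2 = (|(ξ : ℝ)| * w) ^ 2 := by rw [mul_pow, mul_pow, sq_abs]
    rw [h2]; exact pow_le_one₀ (by positivity) h1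
  have hA0 : A ≤ 0 := by
    rw [hA]
    have := mul_nonneg hz2 (by positivity : (0:ℝ) ≤ 3 / 4 * π ^ 2 * σ2)
    linarith only [this]
  have hAlow : -(3 / 4 * π ^ 2 * σ2) ≤ A := by
    rw [hA]
    have := mul_le_mul_of_nonneg_right hz1 (by positivity : (0:ℝ) ≤ 3 / 4 * π ^ 2 * σ2)
    linarith only [this]
  have hB0 : 0 ≤ B := by rw [hB]; positivity
  have hRprod : ∏ j ∈ Finset.range n, r j ≤ Rs := by
    have hprod : ∏ j ∈ Finset.range n, r j = rexp ((∑ j ∈ Finset.range n, E j) / 2) := by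
      rw [hr]; dsimp only
      rw [← Real.exp_sum, Finset.sum_div]
    rw [hprod, hRs, ← Real.exp_add, Real.exp_le_exp]
    have hEsum : ∑ j ∈ Finset.range n, E j = A * ∑ j ∈ Finset.range n, αf j ^ 2 + n * B := by
      rw [Finset.sum_congr rfl fun j _ => hEj j, Finset.sum_add_distrib, Finset.sum_const, Finset.card_range,
        nsmul_eq_mul, Finset.mul_sum]
    rw [hEsum]
    have t1 : A * ∑ j ∈ Finset.range n, αf j ^ 2 ≤ A * ((n : ℝ) / 2 * α₀ ^ 2) :=
      mul_le_mul_of_nonpos_left hsumα hA0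
    have t2 : (n : ℝ) * (w ^ 2 * (6 * π ^ 2 * σ2 + 8 * CE)) ≤ 6 * π ^ 2 * σ2 + 8 * CE := by
      have : (n : ℝ) * (w ^ 2 * (6 * π ^ 2 * σ2 + 8 * CE)) = ((n : ℝ) * w ^ 2) * (6 * π ^ 2 * σ2 + 8 * CE) := by ring
      rw [this]
      exact mul_le_of_le_one_left (by positivity) hn
    have t3 : (n : ℝ) * (((ξ : ℝ) * w) ^ 2 * (2 * CE * w)) ≤ (n : ℝ) * (((ξ : ℝ) * w) ^ 2 * (3 / 16 * π ^ 2 * σ2 * α₀ ^ 2)) :=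
      mul_le_mul_of_nonneg_left (mul_le_mul_of_nonneg_left hsmallCE hz2) (Nat.cast_nonneg n)
    have t4 : (min 1 (3 / 32 * π ^ 2 * σ2 * α₀ ^ 2)) * ((n : ℝ) * w ^ 2 * (ξ : ℝ) ^ 2) ≤
        (3 / 32 * π ^ 2 * σ2 * α₀ ^ 2) * ((n : ℝ) * w ^ 2 * (ξ : ℝ) ^ 2) :=
      mul_le_mul_of_nonneg_right hc' (by positivity)
    have eB : (n : ℝ) * B = (n : ℝ) * (((ξ : ℝ) * w) ^ 2 * (2 * CE * w)) + (n : ℝ) * (w ^ 2 * (6 * π ^ 2 * σ2 + 8 * CE)) := by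
      rw [hB]; ring
    have eA : A * ((n : ℝ) / 2 * α₀ ^ 2) = -(3 / 8 * π ^ 2 * σ2 * α₀ ^ 2) * ((n : ℝ) * w ^ 2 * (ξ : ℝ) ^ 2) := by
      rw [hA]; ring
    have e3 : (n : ℝ) * (((ξ : ℝ) * w) ^ 2 * (3 / 16 * π ^ 2 * σ2 * α₀ ^ 2)) =
        (3 / 16 * π ^ 2 * σ2 * α₀ ^ 2) * ((n : ℝ) * w ^ 2 * (ξ : ℝ) ^ 2) := by ring
    have e4 : -(min 1 (3 / 32 * π ^ 2 * σ2 * α₀ ^ 2) * n * w ^ 2 * (ξ : ℝ) ^ 2) =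
        -((min 1 (3 / 32 * π ^ 2 * σ2 * α₀ ^ 2)) * ((n : ℝ) * w ^ 2 * (ξ : ℝ) ^ 2)) := by ring
    rw [eA] at t1
    rw [e3] at t3
    rw [eB, e4]
    linarith only [t1, t2, t3, t4]
  have hSsum : ∑ j ∈ Finset.range n, (r j)⁻¹ ≤ Ss := by
    have hKS : ∀ j, (r j)⁻¹ ≤ rexp (3 / 8 * π ^ 2 * σ2) := fun j => by
      have : (r j)⁻¹ = rexp (-(E j / 2)) := by rw [hr]; dsimp only; rw [Real.exp_neg]
      rw [this, Real.exp_le_exp, hEj]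
      have hα2 : αf j ^ 2 ≤ 1 := pow_le_one₀ (hαf0 j) (hαf1 j)
      have q1 : A * αf j ^ 2 ≥ A * 1 := mul_le_mul_of_nonpos_left hα2 hA0
      linarith only [q1, hAlow, hB0]
    calc ∑ j ∈ Finset.range n, (r j)⁻¹ ≤ ∑ _j ∈ Finset.range n, rexp (3 / 8 * π ^ 2 * σ2) :=
          Finset.sum_le_sum fun j _ => hKS j
      _ = Ss := by rw [Finset.sum_const, Finset.card_range, nsmul_eq_mul, mul_comm, hSs]
  -- differences of the factors on the window
  have hΔ0 : ∀ j, ‖ahF τ w h y j (ξ + 1) - ahF τ w h y j ξ‖ ≤ d₁ := fun j => by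
    unfold ahF
    refine (hd1 _ ξ).trans ?_
    rw [hd₁]
    gcongr; norm_num
  have hΔ1 : ∀ j, ‖ahF τ w h y j (ξ + 2) - ahF τ w h y j (ξ + 1)‖ ≤ d₁ := fun j => by
    unfold ahF
    have := hd1 (y - ((j : ℝ) + 1) * w) (ξ + 1)
    rw [show ξ + 1 + 1 = ξ + 2 by ring] at this
    refine this.trans ?_
    rw [hd₁]
    refine mul_le_mul_of_nonneg_left ?_ (by positivity)
    push_cast
    linarith only [abs_add_le (ξ : ℝ) 1, abs_one (α := ℝ)]
  have hΔ₂ : ∀ j, ‖ahF τ w h y j (ξ + 2) - 2 * ahF τ w h y j (ξ + 1) + ahF τ w h y j ξ‖ ≤ C₂ * w ^ 2 :=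
    fun j => hd2 _ ξ
  have hd₁0 : 0 ≤ d₁ := by rw [hd₁]; positivity
  -- apply the product lemma
  have hmain := seqProd_bounds (f := ahF τ w h y) (ξ := ξ) hrpos hd₁0 (by positivity : 0 ≤ C₂ * w ^ 2)
    (fun j => hfac j 0 le_rfl (by norm_num) ξ (by simp))
    (fun j => hfac j 1 zero_le_one (by norm_num) (ξ + 1) (by push_cast; ring))
    (fun j => hfac j 2 (by norm_num) le_rfl (ξ + 2) (by push_cast; ring)) hΔ0 hΔ1 hΔ₂ n
  obtain ⟨m0, m1, m2, mΔ0, mΔ1, mΔ₂⟩ := hmain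
  have hR0 : 0 ≤ ∏ j ∈ Finset.range n, r j := Finset.prod_nonneg fun j _ => (hrpos j).le
  have hS0 : 0 ≤ ∑ j ∈ Finset.range n, (r j)⁻¹ := Finset.sum_nonneg fun j _ => (inv_pos.mpr (hrpos j)).le
  have hRs0 : 0 ≤ Rs := by rw [hRs]; positivity
  have hSs0 : 0 ≤ Ss := by rw [hSs]; positivity
  refine ⟨m0.trans hRprod, m1.trans hRprod, m2.trans hRprod, mΔ0.trans ?_, mΔ1.trans ?_, mΔ₂.trans ?_⟩
  · exact mul_le_mul (mul_le_mul_of_nonneg_left hRprod hd₁0) hSsum hS0 (by positivity)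
  · exact mul_le_mul (mul_le_mul_of_nonneg_left hRprod hd₁0) hSsum hS0 (by positivity)
  · refine mul_le_mul hRprod ?_ (by positivity) hRs0
    exact add_le_add (mul_le_mul_of_nonneg_left hSsum (by positivity))
      (mul_le_mul_of_nonneg_left (pow_le_pow_left₀ hS0 hSsum 2) (sq_nonneg _))

end AssemblyB


section AssemblyB2

variable {τ : ℝ → ℝ} {bm bp : ℝ} {w : ℝ} {h : ℝ → ℝ}

/-- **Large frequencies (`(|ξ| - 2)w ≥ ε₀/4`, `|ξ| ≥ 4`): power decay of `Λ_n` and its differences.**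
Eight good factors are bounded by the oscillatory estimate `2C₃/(|ξ|w)` on the window, the other good
factors by the strict bound `A' < 1`, the rest by `1`; whence `|Λ_n| ≤ (2C₃)⁸A'^{g-8}/(|ξ|w)⁸`,
`S ≤ (1/A' + 4/C₃)(n + |ξ|w)` in the product lemma — the difference form of (Pn grand).
[cite: AjankiHuveneers2011, App. 7.3, Lemma `lambda` (Pn grand)] -/
theorem seqProd_bounds_large (hw0 : 0 < w) {y : ℝ} {n : ℕ} {ε₀ C₁ C₂ C₃ A' α₀ : ℝ}
    (hC₁ : 0 ≤ C₁) (hC₂ : 0 ≤ C₂) (hC₃ : 0 < C₃) (hA'0 : 0 < A') (hA'1 : A' ≤ 1)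
    (hunit : ∀ (y' : ℝ) (ξ : ℤ), ‖ahLam τ w h y' ξ‖ ≤ 1)
    (hdec : ∀ (y' : ℝ), α₀ ≤ Real.sin (π * y') ^ 2 → ∀ ξ : ℤ, ξ ≠ 0 →
      ‖ahLam τ w h y' ξ‖ ≤ C₃ / (|(ξ : ℝ)| * w))
    (hstrict : ∀ (y' : ℝ), α₀ ≤ Real.sin (π * y') ^ 2 → ∀ ξ : ℤ, ε₀ / 4 ≤ |(ξ : ℝ)| * w →
      ‖ahLam τ w h y' ξ‖ ≤ A')
    (hd1 : ∀ (y' : ℝ) (ξ : ℤ), ‖ahLam τ w h y' (ξ + 1) - ahLam τ w h y' ξ‖ ≤ C₁ * w ^ 2 * (1 + |(ξ : ℝ)|))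
    (hd2 : ∀ (y' : ℝ) (ξ : ℤ),
      ‖ahLam τ w h y' (ξ + 2) - 2 * ahLam τ w h y' (ξ + 1) + ahLam τ w h y' ξ‖ ≤ C₂ * w ^ 2)
    (hgood8 : 8 ≤ ((Finset.range n).filter fun j : ℕ =>
      α₀ ≤ Real.sin (π * (y - ((j : ℝ) + 1) * w)) ^ 2).card)
    {ξ : ℤ} (hξ4 : 4 ≤ |(ξ : ℝ)|) (hξε : ε₀ / 4 ≤ (|(ξ : ℝ)| - 2) * w) {RL SL d₁ : ℝ}
    (hRL : RL = (2 * C₃) ^ 8 * A' ^ (((Finset.range n).filter fun j : ℕ =>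
      α₀ ≤ Real.sin (π * (y - ((j : ℝ) + 1) * w)) ^ 2).card - 8) / (|(ξ : ℝ)| * w) ^ 8)
    (hSL : SL = (1 / A' + 4 / C₃) * (n + |(ξ : ℝ)| * w)) (hd₁ : d₁ = C₁ * w ^ 2 * (3 + |(ξ : ℝ)|)) :
    ‖seqProd (ahF τ w h y) n ξ‖ ≤ RL ∧ ‖seqProd (ahF τ w h y) n (ξ + 1)‖ ≤ RL ∧
    ‖seqProd (ahF τ w h y) n (ξ + 2)‖ ≤ RL ∧
    ‖seqProd (ahF τ w h y) n (ξ + 1) - seqProd (ahF τ w h y) n ξ‖ ≤ d₁ * RL * SL ∧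
    ‖seqProd (ahF τ w h y) n (ξ + 2) - seqProd (ahF τ w h y) n (ξ + 1)‖ ≤ d₁ * RL * SL ∧
    ‖seqProd (ahF τ w h y) n (ξ + 2) - 2 * seqProd (ahF τ w h y) n (ξ + 1) + seqProd (ahF τ w h y) n ξ‖ ≤
      RL * (C₂ * w ^ 2 * SL + d₁ ^ 2 * SL ^ 2) := by
  classical
  obtain ⟨G, hG⟩ : ∃ G : Finset ℕ, G = (Finset.range n).filter fun j : ℕ =>
    α₀ ≤ Real.sin (π * (y - ((j : ℝ) + 1) * w)) ^ 2 := ⟨_, rfl⟩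
  rw [← hG] at hgood8 hRL
  obtain ⟨D, hDG, hD8⟩ := Finset.exists_subset_card_eq hgood8
  have hGn : G ⊆ Finset.range n := by rw [hG]; exact Finset.filter_subset _ _
  have hDn : D ⊆ Finset.range n := hDG.trans hGn
  have hGgood : ∀ j ∈ G, α₀ ≤ Real.sin (π * (y - ((j : ℝ) + 1) * w)) ^ 2 := fun j hj => by
    rw [hG, Finset.mem_filter] at hj; exact hj.2
  have hξ0 : 0 < |(ξ : ℝ)| := by linarith
  have hξw : 0 < |(ξ : ℝ)| * w := mul_pos hξ0 hw0
  obtain ⟨c, hc⟩ : ∃ c : ℝ, c = 2 * C₃ / (|(ξ : ℝ)| * w) := ⟨_, rfl⟩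
  have hcpos : 0 < c := by rw [hc]; positivity
  obtain ⟨r, hr⟩ : ∃ r : ℕ → ℝ, r = fun j => if j ∈ D then c else if j ∈ G then A' else 1 := ⟨_, rfl⟩
  have hrpos : ∀ j, 0 < r j := fun j => by
    rw [hr]; dsimp only; split_ifs <;> first | exact hcpos | exact hA'0 | exact one_pos
  -- window facts
  have hwin : ∀ (a : ℝ), 0 ≤ a → a ≤ 2 → ∀ η : ℤ, (η : ℝ) = ξ + a →
      η ≠ 0 ∧ ε₀ / 4 ≤ |(η : ℝ)| * w ∧ C₃ / (|(η : ℝ)| * w) ≤ c := by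
    intro a ha0 ha2 η hη
    have hηge : |(ξ : ℝ)| - 2 ≤ |(η : ℝ)| := by
      have : |(ξ : ℝ)| ≤ |(η : ℝ)| + a := by
        calc |(ξ : ℝ)| = |(η : ℝ) - a| := by rw [hη]; ring_nf
          _ ≤ |(η : ℝ)| + |a| := abs_sub _ _
          _ = |(η : ℝ)| + a := by rw [abs_of_nonneg ha0]
      linarith
    have hηpos : 0 < |(η : ℝ)| := by linarith
    refine ⟨?_, ?_, ?_⟩
    · intro h0; rw [h0] at hηpos; simp at hηpos
    · exact hξε.trans (mul_le_mul_of_nonneg_right hηge hw0.le)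
    · rw [hc, div_le_div_iff₀ (mul_pos hηpos hw0) hξw]
      have : |(ξ : ℝ)| ≤ 2 * |(η : ℝ)| := by linarith
      have h2 := mul_le_mul_of_nonneg_left this (le_of_lt (mul_pos hC₃ hw0))
      linarith only [h2]
  have hfac : ∀ (j : ℕ) (a : ℝ), 0 ≤ a → a ≤ 2 → ∀ η : ℤ, (η : ℝ) = ξ + a → ‖ahF τ w h y j η‖ ≤ r j := by
    intro j a ha0 ha2 η hη
    obtain ⟨hη0, hηε, hηc⟩ := hwin a ha0 ha2 η hη
    unfold ahF
    rw [hr]; dsimp only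
    split_ifs with hjD hjG
    · exact (hdec _ (hGgood j (hDG hjD)) η hη0).trans hηc
    · exact hstrict _ (hGgood j hjG) η hηε
    · exact hunit _ η
  -- the product `R = c⁸ A'^{g-8}` and the sum `S ≤ SL`
  obtain ⟨r₁, hr₁⟩ : ∃ r₁ : ℕ → ℝ, r₁ = fun j => if j ∈ D then c else 1 := ⟨_, rfl⟩
  obtain ⟨r₂, hr₂⟩ : ∃ r₂ : ℕ → ℝ, r₂ = fun j => if j ∈ G \ D then A' else 1 := ⟨_, rfl⟩
  have hr12 : ∀ j, r j = r₁ j * r₂ j := fun j => by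
    rw [hr, hr₁, hr₂]; dsimp only
    by_cases hjD : j ∈ D
    · have : j ∉ G \ D := fun h' => (Finset.mem_sdiff.mp h').2 hjD
      simp [hjD, this]
    · by_cases hjG : j ∈ G
      · have : j ∈ G \ D := Finset.mem_sdiff.mpr ⟨hjG, hjD⟩
        simp [hjD, hjG, this]
      · have : j ∉ G \ D := fun h' => hjG (Finset.mem_sdiff.mp h').1
        simp [hjD, hjG, this]
  have hRprod : ∏ j ∈ Finset.range n, r j = RL := by
    rw [Finset.prod_congr rfl fun j _ => hr12 j, Finset.prod_mul_distrib]
    have h1 : ∏ j ∈ Finset.range n, r₁ j = c ^ 8 := by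
      rw [hr₁]; dsimp only
      rw [Finset.prod_ite_mem, Finset.inter_eq_right.mpr hDn, Finset.prod_const, hD8]
    have h2 : ∏ j ∈ Finset.range n, r₂ j = A' ^ (G.card - 8) := by
      rw [hr₂]; dsimp only
      rw [Finset.prod_ite_mem, Finset.inter_eq_right.mpr (Finset.sdiff_subset.trans hGn), Finset.prod_const,
        Finset.card_sdiff_of_subset hDG, hD8]
    rw [h1, h2, hRL, hc, div_pow, mul_pow]
    ring
  have hSsum : ∑ j ∈ Finset.range n, (r j)⁻¹ ≤ SL := by
    have hterm : ∀ j, (r j)⁻¹ ≤ (if j ∈ D then |(ξ : ℝ)| * w / (2 * C₃) else 0) + 1 / A' := by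
      intro j
      rw [hr]; dsimp only
      have hA'inv : (1 : ℝ) ≤ 1 / A' := by rw [le_div_iff₀ hA'0]; linarith
      split_ifs with hjD hjG
      · rw [hc, inv_div]; linarith [show (0:ℝ) ≤ 1 / A' by positivity]
      · rw [zero_add, one_div]
      · rw [inv_one, zero_add]; exact hA'inv
    calc ∑ j ∈ Finset.range n, (r j)⁻¹
        ≤ ∑ j ∈ Finset.range n, ((if j ∈ D then |(ξ : ℝ)| * w / (2 * C₃) else 0) + 1 / A') :=
          Finset.sum_le_sum fun j _ => hterm j
      _ = 8 * (|(ξ : ℝ)| * w / (2 * C₃)) + n * (1 / A') := by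
          rw [Finset.sum_add_distrib, Finset.sum_ite_mem, Finset.inter_eq_right.mpr hDn, Finset.sum_const, hD8,
            Finset.sum_const, Finset.card_range, nsmul_eq_mul, nsmul_eq_mul]
          push_cast; ring
      _ ≤ SL := by
          rw [hSL]
          have h1 : 0 ≤ (n : ℝ) * (4 / C₃) := by positivity
          have h2 : 0 ≤ |(ξ : ℝ)| * w * (1 / A') := by positivity
          have e : (1 / A' + 4 / C₃) * (n + |(ξ : ℝ)| * w) = n * (1 / A') + 8 * (|(ξ : ℝ)| * w / (2 * C₃)) +
              ((n : ℝ) * (4 / C₃) + |(ξ : ℝ)| * w * (1 / A')) := by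
            field_simp; ring
          rw [e]; linarith only [h1, h2]
  -- differences of the factors on the window
  have hΔ0 : ∀ j, ‖ahF τ w h y j (ξ + 1) - ahF τ w h y j ξ‖ ≤ d₁ := fun j => by
    unfold ahF
    refine (hd1 _ ξ).trans ?_
    rw [hd₁]
    gcongr; norm_num
  have hΔ1 : ∀ j, ‖ahF τ w h y j (ξ + 2) - ahF τ w h y j (ξ + 1)‖ ≤ d₁ := fun j => by
    unfold ahF
    have := hd1 (y - ((j : ℝ) + 1) * w) (ξ + 1)
    rw [show ξ + 1 + 1 = ξ + 2 by ring] at this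
    refine this.trans ?_
    rw [hd₁]
    refine mul_le_mul_of_nonneg_left ?_ (by positivity)
    push_cast
    linarith only [abs_add_le (ξ : ℝ) 1, abs_one (α := ℝ)]
  have hΔ₂ : ∀ j, ‖ahF τ w h y j (ξ + 2) - 2 * ahF τ w h y j (ξ + 1) + ahF τ w h y j ξ‖ ≤ C₂ * w ^ 2 :=
    fun j => hd2 _ ξ
  have hd₁0 : 0 ≤ d₁ := by rw [hd₁]; positivity
  have hmain := seqProd_bounds (f := ahF τ w h y) (ξ := ξ) hrpos hd₁0 (by positivity : 0 ≤ C₂ * w ^ 2)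
    (fun j => hfac j 0 le_rfl (by norm_num) ξ (by simp))
    (fun j => hfac j 1 zero_le_one (by norm_num) (ξ + 1) (by push_cast; ring))
    (fun j => hfac j 2 (by norm_num) le_rfl (ξ + 2) (by push_cast; ring)) hΔ0 hΔ1 hΔ₂ n
  obtain ⟨m0, m1, m2, mΔ0, mΔ1, mΔ₂⟩ := hmain
  rw [hRprod] at m0 m1 m2 mΔ0 mΔ1 mΔ₂
  have hS0 : 0 ≤ ∑ j ∈ Finset.range n, (r j)⁻¹ := Finset.sum_nonneg fun j _ => (inv_pos.mpr (hrpos j)).le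
  have hRL0 : 0 ≤ RL := by rw [← hRprod]; exact Finset.prod_nonneg fun j _ => (hrpos j).le
  refine ⟨m0, m1, m2, mΔ0.trans ?_, mΔ1.trans ?_, mΔ₂.trans ?_⟩
  · exact mul_le_mul_of_nonneg_left hSsum (by positivity)
  · exact mul_le_mul_of_nonneg_left hSsum (by positivity)
  · refine mul_le_mul_of_nonneg_left ?_ hRL0
    exact add_le_add (mul_le_mul_of_nonneg_left hSsum (by positivity))
      (mul_le_mul_of_nonneg_left (pow_le_pow_left₀ hS0 hSsum 2) (sq_nonneg _))

end AssemblyB2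


/-! ### Assembly, stage (c): the majorants `B₀, B₁, B₂` of `Λ_n, ΔΛ_n, Δ²Λ_n` on all of `ℤ` -/

section AssemblyC

variable {τ : ℝ → ℝ} {bm bp : ℝ} {w : ℝ} {h : ℝ → ℝ}

/-- The frequency threshold `N = ⌊ε₀/(2w)⌋` separating the Gaussian and the decaying regime:
`4 ≤ N`, `ε₀/(4w) ≤ N ≤ ε₀/(2w)` for `w ≤ ε₀/10`. [folklore] -/
theorem threshold_bounds {ε₀ : ℝ} (hw0 : 0 < w) (hε₀ : 0 < ε₀) (hwε : w ≤ ε₀ / 10) {N : ℕ}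
    (hN : N = ⌊ε₀ / (2 * w)⌋₊) :
    (4 : ℝ) ≤ N ∧ (N : ℝ) ≤ ε₀ / (2 * w) ∧ ε₀ / (4 * w) ≤ N := by
  have h5 : (5 : ℝ) ≤ ε₀ / (2 * w) := by rw [le_div_iff₀ (by positivity)]; linarith
  have hle : (N : ℝ) ≤ ε₀ / (2 * w) := by rw [hN]; exact Nat.floor_le (by positivity)
  have hlt : ε₀ / (2 * w) < N + 1 := by rw [hN]; exact Nat.lt_floor_add_one _
  refine ⟨by linarith, hle, ?_⟩
  have : ε₀ / (4 * w) = ε₀ / (2 * w) / 2 := by field_simp; ring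
  rw [this]; linarith

/-- **The majorants.** For `w ≤ ε₀/10` (and the smallness conditions of the two regimes) and every
`ξ ∈ ℤ`: `|Λ_n(η)| ≤ B₀(ξ)` (`η = ξ, ξ+1, ξ+2`), `|ΔΛ_n(η)| ≤ B₁(ξ)` (`η = ξ, ξ+1`),
`|Δ²Λ_n(ξ)| ≤ B₂(ξ)`, with the explicit Gaussian-plus-tail majorants
`B₀ = K_R e^{-c'nw²ξ²} + Θ·1_{|ξ|>N}|ξ|⁻⁸`, `B₁ = C₁w²(3+|ξ|)K_R e^{…}K_S n + 2C₁σ'Θnw³·1_{|ξ|>N}|ξ|⁻⁶`,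
`B₂ = K_R e^{…}(C₂K_Snw² + C₁²w⁴(3+|ξ|)²K_S²n²) + Θ(C₂σ'nw³·1|ξ|⁻⁷ + 4C₁²σ'²n²w⁶·1|ξ|⁻⁴)`,
`Θ = (2C₃)⁸A'^{g-8}w⁻⁸`, `σ' = 5(1/A' + 4/C₃)/ε₀` — (Pn gauche droite)–(Pn grand) of Lemma `lambda` in
difference form. [cite: AjankiHuveneers2011, App. 7.3, Lemma `lambda`] -/
theorem majorant_bounds (hw0 : 0 < w) (hw1 : w ≤ 1) {y : ℝ} {n : ℕ} (hn1 : 1 ≤ n)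
    (hn : (n : ℝ) * w ^ 2 ≤ 1) {ε₀ CE C₁ C₂ C₃ A' α₀ σ2 : ℝ} (hCE : 0 ≤ CE) (hC₁ : 0 ≤ C₁)
    (hC₂ : 0 ≤ C₂) (hC₃ : 0 < C₃) (hA'0 : 0 < A') (hA'1 : A' ≤ 1) (hε₀0 : 0 < ε₀) (hε₀1 : ε₀ ≤ 1)
    (hσ2 : 0 ≤ σ2) (hα₀ : 0 ≤ α₀) (hwε : w ≤ ε₀ / 10)
    (hgauss : ∀ (y' : ℝ) (ξ : ℤ), |(ξ : ℝ)| * w ≤ ε₀ →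
      ‖ahLam τ w h y' ξ‖ ^ 2 ≤ 1 - 3 / 2 * π ^ 2 * σ2 * (Real.sin (π * y') ^ 2) ^ 2 * ((ξ : ℝ) * w) ^ 2 +
        CE * w * ((ξ : ℝ) * w) ^ 2)
    (hd1 : ∀ (y' : ℝ) (ξ : ℤ), ‖ahLam τ w h y' (ξ + 1) - ahLam τ w h y' ξ‖ ≤ C₁ * w ^ 2 * (1 + |(ξ : ℝ)|))
    (hd2 : ∀ (y' : ℝ) (ξ : ℤ),
      ‖ahLam τ w h y' (ξ + 2) - 2 * ahLam τ w h y' (ξ + 1) + ahLam τ w h y' ξ‖ ≤ C₂ * w ^ 2)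
    (hunit : ∀ (y' : ℝ) (ξ : ℤ), ‖ahLam τ w h y' ξ‖ ≤ 1)
    (hdec : ∀ (y' : ℝ), α₀ ≤ Real.sin (π * y') ^ 2 → ∀ ξ : ℤ, ξ ≠ 0 →
      ‖ahLam τ w h y' ξ‖ ≤ C₃ / (|(ξ : ℝ)| * w))
    (hstrict : ∀ (y' : ℝ), α₀ ≤ Real.sin (π * y') ^ 2 → ∀ ξ : ℤ, ε₀ / 4 ≤ |(ξ : ℝ)| * w →
      ‖ahLam τ w h y' ξ‖ ≤ A')
    (hsmallCE : 2 * CE * w ≤ 3 / 16 * π ^ 2 * σ2 * α₀ ^ 2)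
    (hgood : (n : ℝ) / 2 ≤ (((Finset.range n).filter fun j : ℕ =>
      α₀ ≤ Real.sin (π * (y - ((j : ℝ) + 1) * w)) ^ 2).card : ℕ))
    (hgood8 : 8 ≤ ((Finset.range n).filter fun j : ℕ =>
      α₀ ≤ Real.sin (π * (y - ((j : ℝ) + 1) * w)) ^ 2).card)
    {N : ℕ} (hN : N = ⌊ε₀ / (2 * w)⌋₊) {KR c' KS Θ σ' : ℝ} (hKR : KR = rexp (3 * π ^ 2 * σ2 + 4 * CE))
    (hc' : c' = min 1 (3 / 32 * π ^ 2 * σ2 * α₀ ^ 2)) (hKS : KS = rexp (3 / 8 * π ^ 2 * σ2))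
    (hΘ : Θ = (2 * C₃) ^ 8 * A' ^ (((Finset.range n).filter fun j : ℕ =>
      α₀ ≤ Real.sin (π * (y - ((j : ℝ) + 1) * w)) ^ 2).card - 8) / w ^ 8)
    (hσ' : σ' = 5 * (1 / A' + 4 / C₃) / ε₀) (ξ : ℤ) {B0 B1 B2 : ℝ}
    (hB0 : B0 = KR * rexp (-(c' * n * w ^ 2 * (ξ : ℝ) ^ 2)) + Θ * tailWeight N 6 ξ)
    (hB1 : B1 = C₁ * w ^ 2 * (3 + |(ξ : ℝ)|) * (KR * rexp (-(c' * n * w ^ 2 * (ξ : ℝ) ^ 2))) * (KS * n) +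
      2 * C₁ * σ' * Θ * n * w ^ 3 * tailWeight N 4 ξ)
    (hB2 : B2 = KR * rexp (-(c' * n * w ^ 2 * (ξ : ℝ) ^ 2)) *
        (C₂ * w ^ 2 * (KS * n) + (C₁ * w ^ 2 * (3 + |(ξ : ℝ)|)) ^ 2 * (KS * n) ^ 2) +
      Θ * (C₂ * σ' * n * w ^ 3 * tailWeight N 5 ξ + 4 * C₁ ^ 2 * σ' ^ 2 * n ^ 2 * w ^ 6 * tailWeight N 2 ξ)) :
    ‖seqProd (ahF τ w h y) n ξ‖ ≤ B0 ∧ ‖seqProd (ahF τ w h y) n (ξ + 1)‖ ≤ B0 ∧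
    ‖seqProd (ahF τ w h y) n (ξ + 2)‖ ≤ B0 ∧
    ‖seqProd (ahF τ w h y) n (ξ + 1) - seqProd (ahF τ w h y) n ξ‖ ≤ B1 ∧
    ‖seqProd (ahF τ w h y) n (ξ + 2) - seqProd (ahF τ w h y) n (ξ + 1)‖ ≤ B1 ∧
    ‖seqProd (ahF τ w h y) n (ξ + 2) - 2 * seqProd (ahF τ w h y) n (ξ + 1) + seqProd (ahF τ w h y) n ξ‖ ≤
      B2 := by
  obtain ⟨hN4, hNle, hNge⟩ := threshold_bounds hw0 hε₀0 hwε hN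
  obtain ⟨θ, hθ⟩ : ∃ θ : ℝ, θ = A' ^ (((Finset.range n).filter fun j : ℕ =>
      α₀ ≤ Real.sin (π * (y - ((j : ℝ) + 1) * w)) ^ 2).card - 8) := ⟨_, rfl⟩
  have hθ0 : 0 ≤ θ := by rw [hθ]; positivity
  rw [← hθ] at hΘ
  have hKR0 : 0 < KR := by rw [hKR]; exact Real.exp_pos _
  have hKS0 : 0 < KS := by rw [hKS]; exact Real.exp_pos _
  have hΘ0 : 0 ≤ Θ := by rw [hΘ]; positivity
  have hsb0 : 0 < 1 / A' + 4 / C₃ := by positivity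
  have hσ'0 : 0 < σ' := by rw [hσ']; positivity
  have hgs0 : 0 ≤ KR * rexp (-(c' * n * w ^ 2 * (ξ : ℝ) ^ 2)) := by positivity
  have hn0 : (1 : ℝ) ≤ n := by exact_mod_cast hn1
  by_cases hlarge : (N : ℤ) < |ξ|
  · -- the decaying regime
    have hξN : (N : ℝ) + 1 ≤ |(ξ : ℝ)| := by
      have h1 : (N : ℤ) + 1 ≤ |ξ| := Int.add_one_le_iff.mpr hlarge
      have h2 : (((N : ℤ) + 1 : ℤ) : ℝ) ≤ ((|ξ| : ℤ) : ℝ) := Int.cast_le.mpr h1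
      push_cast at h2; exact h2
    have hξ4 : (4 : ℝ) ≤ |(ξ : ℝ)| := by linarith
    have hX0 : 0 < |(ξ : ℝ)| := by linarith
    have hξw : ε₀ / 2 < |(ξ : ℝ)| * w := by
      have hlt : ε₀ / (2 * w) < N + 1 := by rw [hN]; exact Nat.lt_floor_add_one _
      have h1 : ε₀ / (2 * w) < |(ξ : ℝ)| := hlt.trans_le hξN
      rw [div_lt_iff₀ (by positivity)] at h1
      linarith only [h1]
    have hξε : ε₀ / 4 ≤ (|(ξ : ℝ)| - 2) * w := by linarith only [hξw, hwε, hε₀0]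
    have hXw4 : ε₀ / 4 ≤ |(ξ : ℝ)| * w := by
      calc ε₀ / 4 ≤ (N : ℝ) * w := by
            rw [div_le_iff₀ (by norm_num : (0:ℝ) < 4)]
            have := mul_le_mul_of_nonneg_right hNge (by positivity : (0:ℝ) ≤ 4 * w)
            rwa [div_mul_cancel₀ _ (by positivity : (4:ℝ) * w ≠ 0), show (N : ℝ) * (4 * w) = N * w * 4 by ring]
              at this
        _ ≤ |(ξ : ℝ)| * w := mul_le_mul_of_nonneg_right (by linarith) hw0.le
    obtain ⟨RL, hRL⟩ : ∃ RL : ℝ, RL = (2 * C₃) ^ 8 * A' ^ (((Finset.range n).filter fun j : ℕ =>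
      α₀ ≤ Real.sin (π * (y - ((j : ℝ) + 1) * w)) ^ 2).card - 8) / (|(ξ : ℝ)| * w) ^ 8 := ⟨_, rfl⟩
    obtain ⟨SL, hSL⟩ : ∃ SL : ℝ, SL = (1 / A' + 4 / C₃) * (n + |(ξ : ℝ)| * w) := ⟨_, rfl⟩
    obtain ⟨d₁, hd₁⟩ : ∃ d₁ : ℝ, d₁ = C₁ * w ^ 2 * (3 + |(ξ : ℝ)|) := ⟨_, rfl⟩
    obtain ⟨m0, m1, m2, mΔ0, mΔ1, mΔ₂⟩ := seqProd_bounds_large (τ := τ) (h := h) (y := y) hw0 hC₁ hC₂ hC₃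
      hA'0 hA'1 hunit hdec hstrict hd1 hd2 hgood8 hξ4 hξε hRL hSL hd₁
    rw [← hθ] at hRL
    -- identify `RL` with the tail weight, bound `SL` and `d₁`
    have htw : ∀ q : ℕ, tailWeight N q ξ = 1 / |(ξ : ℝ)| ^ (q + 2) := fun q => tailWeight_of_lt hlarge q
    have hRLΘ : RL = Θ * tailWeight N 6 ξ := by
      rw [htw, hRL, hΘ, mul_pow]
      field_simp
    have hRL0 : 0 ≤ RL := by rw [hRL]; positivity
    have hSLle : SL ≤ σ' * n * |(ξ : ℝ)| * w := by
      obtain ⟨Mq, hMq⟩ : ∃ Mq : ℝ, Mq = n * (|(ξ : ℝ)| * w) / ε₀ := ⟨_, rfl⟩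
      have h1 : (n : ℝ) ≤ 4 * Mq := by
        have : (1 : ℝ) ≤ 4 * (|(ξ : ℝ)| * w) / ε₀ := by
          rw [le_div_iff₀ hε₀0]; linarith
        have h' := mul_le_mul_of_nonneg_left this (le_trans zero_le_one hn0)
        rw [mul_one] at h'
        have e : (n : ℝ) * (4 * (|(ξ : ℝ)| * w) / ε₀) = 4 * Mq := by rw [hMq]; ring
        linarith only [h', e]
      have h2 : |(ξ : ℝ)| * w ≤ Mq := by
        rw [hMq, le_div_iff₀ hε₀0]
        have hXw0 : 0 ≤ |(ξ : ℝ)| * w := by positivity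
        nlinarith only [hXw0, hn0, hε₀1, hε₀0]
      have h3 : (n : ℝ) + |(ξ : ℝ)| * w ≤ 5 * Mq := by linarith only [h1, h2]
      calc SL = (1 / A' + 4 / C₃) * (n + |(ξ : ℝ)| * w) := hSL
        _ ≤ (1 / A' + 4 / C₃) * (5 * Mq) := mul_le_mul_of_nonneg_left h3 hsb0.le
        _ = σ' * n * |(ξ : ℝ)| * w := by rw [hMq, hσ']; field_simp
    have hSL0 : 0 ≤ SL := by rw [hSL]; positivity
    have hd₁le : d₁ ≤ 2 * C₁ * w ^ 2 * |(ξ : ℝ)| := by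
      rw [hd₁]; nlinarith only [hξ4, hC₁, sq_nonneg w, mul_nonneg hC₁ (sq_nonneg w)]
    have hd₁0 : 0 ≤ d₁ := by rw [hd₁]; positivity
    -- the three majorants dominate the decaying-regime bounds
    have e0 : RL ≤ B0 := by rw [hB0, ← hRLΘ]; linarith only [hgs0]
    have e1 : d₁ * RL * SL ≤ B1 := by
      have step : d₁ * RL * SL ≤ (2 * C₁ * w ^ 2 * |(ξ : ℝ)|) * RL * (σ' * n * |(ξ : ℝ)| * w) :=
        mul_le_mul (mul_le_mul_of_nonneg_right hd₁le hRL0) hSLle hSL0 (by positivity)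
      have eq : (2 * C₁ * w ^ 2 * |(ξ : ℝ)|) * RL * (σ' * n * |(ξ : ℝ)| * w) =
          2 * C₁ * σ' * Θ * n * w ^ 3 * tailWeight N 4 ξ := by
        rw [hRLΘ, htw, htw]; field_simp; ring
      have hfirst : 0 ≤ C₁ * w ^ 2 * (3 + |(ξ : ℝ)|) * (KR * rexp (-(c' * n * w ^ 2 * (ξ : ℝ) ^ 2))) * (KS * n) := by
        positivity
      rw [hB1]; linarith only [step, eq, hfirst]
    have e2 : RL * (C₂ * w ^ 2 * SL + d₁ ^ 2 * SL ^ 2) ≤ B2 := by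
      have s1 : C₂ * w ^ 2 * SL ≤ C₂ * w ^ 2 * (σ' * n * |(ξ : ℝ)| * w) :=
        mul_le_mul_of_nonneg_left hSLle (by positivity)
      have s2 : d₁ ^ 2 * SL ^ 2 ≤ (2 * C₁ * w ^ 2 * |(ξ : ℝ)|) ^ 2 * (σ' * n * |(ξ : ℝ)| * w) ^ 2 :=
        mul_le_mul (pow_le_pow_left₀ hd₁0 hd₁le 2) (pow_le_pow_left₀ hSL0 hSLle 2) (sq_nonneg _) (sq_nonneg _)
      have step : RL * (C₂ * w ^ 2 * SL + d₁ ^ 2 * SL ^ 2) ≤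
          RL * (C₂ * w ^ 2 * (σ' * n * |(ξ : ℝ)| * w) + (2 * C₁ * w ^ 2 * |(ξ : ℝ)|) ^ 2 * (σ' * n * |(ξ : ℝ)| * w) ^ 2) :=
        mul_le_mul_of_nonneg_left (add_le_add s1 s2) hRL0
      have eq : RL * (C₂ * w ^ 2 * (σ' * n * |(ξ : ℝ)| * w) + (2 * C₁ * w ^ 2 * |(ξ : ℝ)|) ^ 2 * (σ' * n * |(ξ : ℝ)| * w) ^ 2) =
          Θ * (C₂ * σ' * n * w ^ 3 * tailWeight N 5 ξ + 4 * C₁ ^ 2 * σ' ^ 2 * n ^ 2 * w ^ 6 * tailWeight N 2 ξ) := by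
        rw [hRLΘ, htw, htw, htw]; field_simp; ring
      have hfirst : 0 ≤ KR * rexp (-(c' * n * w ^ 2 * (ξ : ℝ) ^ 2)) *
          (C₂ * w ^ 2 * (KS * n) + (C₁ * w ^ 2 * (3 + |(ξ : ℝ)|)) ^ 2 * (KS * n) ^ 2) := by positivity
      rw [hB2]; linarith only [step, eq, hfirst]
    exact ⟨m0.trans e0, m1.trans e0, m2.trans e0, mΔ0.trans e1, mΔ1.trans e1, mΔ₂.trans e2⟩
  · -- the Gaussian regime
    have hξN : |(ξ : ℝ)| ≤ N := by
      have h1 : |ξ| ≤ (N : ℤ) := not_lt.mp hlarge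
      have h2 : ((|ξ| : ℤ) : ℝ) ≤ ((N : ℤ) : ℝ) := Int.cast_le.mpr h1
      rwa [Int.cast_abs, Int.cast_natCast] at h2
    have hξ : (|(ξ : ℝ)| + 2) * w ≤ ε₀ := by
      have h1 : |(ξ : ℝ)| * w ≤ ε₀ / 2 := by
        calc |(ξ : ℝ)| * w ≤ N * w := mul_le_mul_of_nonneg_right hξN hw0.le
          _ ≤ ε₀ / (2 * w) * w := mul_le_mul_of_nonneg_right hNle hw0.le
          _ = ε₀ / 2 := by field_simp
      nlinarith only [h1, hwε, hε₀0]
    obtain ⟨Rs, hRs⟩ : ∃ Rs : ℝ, Rs = rexp (3 * π ^ 2 * σ2 + 4 * CE) *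
      rexp (-(min 1 (3 / 32 * π ^ 2 * σ2 * α₀ ^ 2) * n * w ^ 2 * (ξ : ℝ) ^ 2)) := ⟨_, rfl⟩
    obtain ⟨Ss, hSs⟩ : ∃ Ss : ℝ, Ss = rexp (3 / 8 * π ^ 2 * σ2) * n := ⟨_, rfl⟩
    obtain ⟨d₁, hd₁⟩ : ∃ d₁ : ℝ, d₁ = C₁ * w ^ 2 * (3 + |(ξ : ℝ)|) := ⟨_, rfl⟩
    obtain ⟨m0, m1, m2, mΔ0, mΔ1, mΔ₂⟩ := seqProd_bounds_small (τ := τ) (h := h) (y := y) hw0 hw1 hn hCE hC₁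
      hC₂ hε₀1 hσ2 hα₀ hgauss hd1 hd2 hsmallCE hgood hξ hRs hSs hd₁
    have hRs' : Rs = KR * rexp (-(c' * n * w ^ 2 * (ξ : ℝ) ^ 2)) := by rw [hRs, hKR, hc']
    have hSs' : Ss = KS * n := by rw [hSs, hKS]
    have ht0 : 0 ≤ Θ * tailWeight N 6 ξ := mul_nonneg hΘ0 (tailWeight_nonneg _ _ _)
    have e0 : Rs ≤ B0 := by rw [hB0, ← hRs']; linarith only [ht0]
    have e1 : d₁ * Rs * Ss ≤ B1 := by
      have ht : 0 ≤ 2 * C₁ * σ' * Θ * n * w ^ 3 * tailWeight N 4 ξ := by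
        have := tailWeight_nonneg N 4 ξ; positivity
      rw [hB1, hd₁, hRs', hSs']; linarith only [ht]
    have e2 : Rs * (C₂ * w ^ 2 * Ss + d₁ ^ 2 * Ss ^ 2) ≤ B2 := by
      have ht : 0 ≤ Θ * (C₂ * σ' * n * w ^ 3 * tailWeight N 5 ξ + 4 * C₁ ^ 2 * σ' ^ 2 * n ^ 2 * w ^ 6 * tailWeight N 2 ξ) := by
        have := tailWeight_nonneg N 5 ξ; have := tailWeight_nonneg N 2 ξ; positivity
      rw [hB2, hd₁, hRs', hSs']; linarith only [ht]
    exact ⟨m0.trans e0, m1.trans e0, m2.trans e0, mΔ0.trans e1, mΔ1.trans e1, mΔ₂.trans e2⟩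

end AssemblyC


/-! ### Assembly, stage (d): the seven lattice sums of the majorants -/

section AssemblyD

/-- The Gaussian lattice-sum constant `K_l/√c'^{l+1}`, `K_l = 3√(2π)(1 + 2ˡ l!)`. [folklore] -/
def gaussK (c' : ℝ) (l : ℕ) : ℝ := 3 * Real.sqrt (2 * π) * (1 + 2 ^ l * l.factorial) / Real.sqrt c' ^ (l + 1)

/-- The tail-sum constant `2(2C₃)⁸(4/ε₀)^{q+1}C_A`. [folklore] -/
def tailK (C₃ ε₀ CA : ℝ) (q : ℕ) : ℝ := 2 * (2 * C₃) ^ 8 * (4 / ε₀) ^ (q + 1) * CA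

/-- `gaussK ≥ 0`. [folklore] -/
theorem gaussK_nonneg {c' : ℝ} (l : ℕ) : 0 ≤ gaussK c' l := by
  unfold gaussK; positivity

/-- `tailK ≥ 0` for `C_A ≥ 0`, `ε₀ > 0`. [folklore] -/
theorem tailK_nonneg {C₃ ε₀ CA : ℝ} (hε₀ : 0 < ε₀) (hCA : 0 ≤ CA) (q : ℕ) : 0 ≤ tailK C₃ ε₀ CA q := by
  unfold tailK; positivity

/-- Linear combination of two summable families. [folklore] -/
theorem tsum_comb2 {f1 f2 : ℤ → ℝ} (h1 : Summable f1) (h2 : Summable f2) (a b : ℝ) :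
    Summable (fun ξ => a * f1 ξ + b * f2 ξ) ∧
      ∑' ξ, (a * f1 ξ + b * f2 ξ) = a * ∑' ξ, f1 ξ + b * ∑' ξ, f2 ξ := by
  refine ⟨(h1.mul_left a).add (h2.mul_left b), ?_⟩
  rw [(h1.mul_left a).tsum_add (h2.mul_left b), tsum_mul_left, tsum_mul_left]

/-- Linear combination of three summable families. [folklore] -/
theorem tsum_comb3 {f1 f2 f3 : ℤ → ℝ} (h1 : Summable f1) (h2 : Summable f2) (h3 : Summable f3)
    (a b c : ℝ) :
    Summable (fun ξ => a * f1 ξ + b * f2 ξ + c * f3 ξ) ∧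
      ∑' ξ, (a * f1 ξ + b * f2 ξ + c * f3 ξ) = a * ∑' ξ, f1 ξ + b * ∑' ξ, f2 ξ + c * ∑' ξ, f3 ξ := by
  obtain ⟨h12, e12⟩ := tsum_comb2 h1 h2 a b
  refine ⟨h12.add (h3.mul_left c), ?_⟩
  rw [h12.tsum_add (h3.mul_left c), e12, tsum_mul_left]

/-- Linear combination of four summable families. [folklore] -/
theorem tsum_comb4 {f1 f2 f3 f4 : ℤ → ℝ} (h1 : Summable f1) (h2 : Summable f2) (h3 : Summable f3)
    (h4 : Summable f4) (a b c d : ℝ) :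
    Summable (fun ξ => a * f1 ξ + b * f2 ξ + c * f3 ξ + d * f4 ξ) ∧
      ∑' ξ, (a * f1 ξ + b * f2 ξ + c * f3 ξ + d * f4 ξ) =
        a * ∑' ξ, f1 ξ + b * ∑' ξ, f2 ξ + c * ∑' ξ, f3 ξ + d * ∑' ξ, f4 ξ := by
  obtain ⟨h123, e123⟩ := tsum_comb3 h1 h2 h3 a b c
  refine ⟨h123.add (h4.mul_left d), ?_⟩
  rw [h123.tsum_add (h4.mul_left d), e123, tsum_mul_left]

/-- Domination: `0 ≤ t ≤ g` termwise with `g` summable gives `∑ t ≤ ∑ g`. [folklore] -/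
theorem tsum_dom {t g : ℤ → ℝ} (h0 : ∀ ξ, 0 ≤ t ξ) (hle : ∀ ξ, t ξ ≤ g ξ) (hg : Summable g) :
    Summable t ∧ ∑' ξ, t ξ ≤ ∑' ξ, g ξ :=
  ⟨.of_nonneg_of_le h0 hle hg, (Summable.of_nonneg_of_le h0 hle hg).tsum_le_tsum hle hg⟩

variable {w s : ℝ} {n : ℕ}

/-- Bookkeeping for the Gaussian pieces: `s^{2e} · G/s^{p+1} ≤ G/s^k` when `p+1 ≤ 2e+k`, `0 < s ≤ 1`.
[folklore] -/
theorem gauss_piece_le (hs0 : 0 < s) (hs1 : s ≤ 1) {G : ℝ} (hG : 0 ≤ G) {e p k : ℕ}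
    (h : p + 1 ≤ 2 * e + k) : s ^ (2 * e) * (G / s ^ (p + 1)) ≤ G / s ^ k := by
  rw [mul_div_assoc', div_le_div_iff₀ (by positivity) (by positivity)]
  calc s ^ (2 * e) * G * s ^ k = G * s ^ (2 * e + k) := by ring
    _ ≤ G * s ^ (p + 1) := mul_le_mul_of_nonneg_left (pow_le_pow_of_le_one hs0.le hs1 h) hG

/-- Bookkeeping for the tail pieces: `θ nᵉ/wᵐ ≤ C_A/sᵏ` when `θn³ ≤ C_A`, `m ≤ k`, `2e + k ≤ 6`
(`s = w√n ≤ 1`, `n ≥ 1`, `w ≤ 1`). [folklore] -/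
theorem theta_piece_le {θ CA : ℝ} (hθCA : θ * (n : ℝ) ^ 3 ≤ CA) (hθ : 0 ≤ θ) (hn : 1 ≤ (n : ℝ))
    (hw0 : 0 < w) (hw1 : w ≤ 1) (hs : s = w * Real.sqrt n) {e m k : ℕ} (hmk : m ≤ k)
    (hek : 2 * e + k ≤ 6) : θ * (n : ℝ) ^ e / w ^ m ≤ CA / s ^ k := by
  have hsn1 : 1 ≤ Real.sqrt n := by rw [← Real.sqrt_one]; exact Real.sqrt_le_sqrt hn
  have hs0 : 0 < s := by rw [hs]; positivity
  have hA : (n : ℝ) ^ e * Real.sqrt n ^ k ≤ (n : ℝ) ^ 3 := by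
    have h1 : (n : ℝ) ^ e = Real.sqrt n ^ (2 * e) := by rw [pow_mul, Real.sq_sqrt (by positivity)]
    have h2 : (n : ℝ) ^ 3 = Real.sqrt n ^ 6 := by
      rw [show 6 = 2 * 3 from rfl, pow_mul, Real.sq_sqrt (by positivity)]
    rw [h1, h2, ← pow_add]
    exact pow_le_pow_right₀ hsn1 hek
  have hB : w ^ k ≤ w ^ m := pow_le_pow_of_le_one hw0.le hw1 hmk
  rw [div_le_div_iff₀ (by positivity) (by positivity)]
  calc θ * (n : ℝ) ^ e * s ^ k = θ * ((n : ℝ) ^ e * Real.sqrt n ^ k) * w ^ k := by rw [hs, mul_pow]; ring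
    _ ≤ θ * (n : ℝ) ^ 3 * w ^ m := mul_le_mul (mul_le_mul_of_nonneg_left hA hθ) hB (by positivity) (by positivity)
    _ ≤ CA * w ^ m := mul_le_mul_of_nonneg_right hθCA (by positivity)

/-- The Gaussian lattice sums at `c = c'nw² = c's²`: `∑|ξ|ˡe^{-c'nw²ξ²} ≤ gaussK(l)/s^{l+1}`. [folklore] -/
theorem gauss_lattice_sum (hw0 : 0 < w) (hn1 : 1 ≤ (n : ℝ)) (hn : (n : ℝ) * w ^ 2 ≤ 1) (hs : s = w * Real.sqrt n)
    {c' : ℝ} (hc'0 : 0 < c') (hc'1 : c' ≤ 1) (l : ℕ) :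
    Summable (fun ξ : ℤ => |(ξ : ℝ)| ^ l * rexp (-(c' * n * w ^ 2 * (ξ : ℝ) ^ 2))) ∧
      ∑' ξ : ℤ, |(ξ : ℝ)| ^ l * rexp (-(c' * n * w ^ 2 * (ξ : ℝ) ^ 2)) ≤ gaussK c' l / s ^ (l + 1) := by
  have hc0 : 0 < c' * n * w ^ 2 := by positivity
  have hc1 : c' * n * w ^ 2 ≤ 1 := by
    calc c' * n * w ^ 2 = c' * (n * w ^ 2) := by ring
      _ ≤ 1 * 1 := mul_le_mul hc'1 hn (by positivity) zero_le_one
      _ = 1 := by ring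
  have hfun : (fun ξ : ℤ => |(ξ : ℝ)| ^ l * rexp (-(c' * n * w ^ 2 * (ξ : ℝ) ^ 2))) =
      fun ξ : ℤ => |(ξ : ℝ)| ^ l * rexp (-((c' * n * w ^ 2) * (ξ : ℝ) ^ 2)) := rfl
  refine ⟨hfun ▸ summable_abs_pow_mul_gauss l hc0, ?_⟩
  have hsq : Real.sqrt (c' * n * w ^ 2) = Real.sqrt c' * s := by
    rw [hs, show c' * n * w ^ 2 = c' * (n * w ^ 2) by ring, Real.sqrt_mul hc'0.le, Real.sqrt_mul (by positivity),
      Real.sqrt_sq hw0.le]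
    ring
  calc ∑' ξ : ℤ, |(ξ : ℝ)| ^ l * rexp (-(c' * n * w ^ 2 * (ξ : ℝ) ^ 2))
      ≤ 3 * Real.sqrt (2 * π) * (1 + 2 ^ l * l.factorial) / Real.sqrt (c' * n * w ^ 2) ^ (l + 1) :=
        tsum_abs_pow_mul_gauss_le l hc0 hc1
    _ = gaussK c' l / s ^ (l + 1) := by
        rw [hsq, gaussK, mul_pow, div_div]

/-- The tail lattice sums: `Θ nᵉ wᶠ ∑_{|ξ|>N}|ξ|^{-(q+2)} ≤ tailK(q)/sᵏ` when `f+q+1+m = 8`, `m ≤ k`,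
`2e+k ≤ 6` (`Θ = (2C₃)⁸θ/w⁸`, `θn³ ≤ C_A`, `1/N ≤ 4w/ε₀`). [folklore] -/
theorem tail_lattice_sum (hw0 : 0 < w) (hw1 : w ≤ 1) (hn1 : 1 ≤ (n : ℝ)) (hs : s = w * Real.sqrt n)
    {θ CA C₃ ε₀ Θ : ℝ} (hθCA : θ * (n : ℝ) ^ 3 ≤ CA) (hθ : 0 ≤ θ) (hε₀ : 0 < ε₀)
    (hΘ : Θ = (2 * C₃) ^ 8 * θ / w ^ 8) {N : ℕ} (hN1 : 1 ≤ N) (hNge : ε₀ / (4 * w) ≤ N)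
    {e f q m k : ℕ} (hfq : f + q + 1 + m = 8) (hmk : m ≤ k) (hek : 2 * e + k ≤ 6) :
    Summable (tailWeight N q) ∧
      Θ * (n : ℝ) ^ e * w ^ f * ∑' ξ : ℤ, tailWeight N q ξ ≤ tailK C₃ ε₀ CA q / s ^ k := by
  obtain ⟨hsum, hle⟩ := tsum_tailWeight_le N q hN1
  refine ⟨hsum, ?_⟩
  have hN0 : (0 : ℝ) < N := by exact_mod_cast hN1
  have hinv : 1 / (N : ℝ) ≤ 4 * w / ε₀ := by
    rw [div_le_div_iff₀ hN0 hε₀]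
    have := mul_le_mul_of_nonneg_left hNge (by positivity : (0:ℝ) ≤ 4 * w)
    rw [mul_div_assoc', show 4 * w * ε₀ / (4 * w) = ε₀ by field_simp] at this
    linarith
  have htail : ∑' ξ : ℤ, tailWeight N q ξ ≤ 2 * (4 * w / ε₀) ^ (q + 1) := by
    refine hle.trans ?_
    rw [div_eq_mul_one_div, ← one_div_pow]
    exact mul_le_mul_of_nonneg_left (pow_le_pow_left₀ (by positivity) hinv _) (by norm_num)
  have hΘ0 : 0 ≤ Θ := by rw [hΘ]; positivity
  have hpiece := theta_piece_le hθCA hθ hn1 hw0 hw1 hs hmk hek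
  calc Θ * (n : ℝ) ^ e * w ^ f * ∑' ξ : ℤ, tailWeight N q ξ
      ≤ Θ * (n : ℝ) ^ e * w ^ f * (2 * (4 * w / ε₀) ^ (q + 1)) :=
        mul_le_mul_of_nonneg_left htail (by positivity)
    _ = 2 * (2 * C₃) ^ 8 * (4 / ε₀) ^ (q + 1) * (θ * (n : ℝ) ^ e / w ^ m) := by
        have hw8 : w ^ 8 = w ^ f * w ^ (q + 1) * w ^ m := by
          rw [← pow_add, ← pow_add]; congr 1; omega
        have hwpow : w ^ f * w ^ (q + 1) / w ^ 8 = 1 / w ^ m := by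
          rw [hw8]; field_simp
        have hsplit : (4 * w / ε₀) ^ (q + 1) = (4 / ε₀) ^ (q + 1) * w ^ (q + 1) := by
          rw [← mul_pow]; congr 1; ring
        calc Θ * (n : ℝ) ^ e * w ^ f * (2 * (4 * w / ε₀) ^ (q + 1))
            = 2 * (2 * C₃) ^ 8 * (4 / ε₀) ^ (q + 1) * (θ * (n : ℝ) ^ e) * (w ^ f * w ^ (q + 1) / w ^ 8) := by
              rw [hΘ, hsplit]; ring
          _ = _ := by rw [hwpow]; ring
    _ ≤ 2 * (2 * C₃) ^ 8 * (4 / ε₀) ^ (q + 1) * (CA / s ^ k) :=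
        mul_le_mul_of_nonneg_left hpiece (by positivity)
    _ = tailK C₃ ε₀ CA q / s ^ k := by rw [tailK]; ring

end AssemblyD

section AssemblyD2

variable {w s : ℝ} {n : ℕ}

/-- `∑ B₀ ≤ K₀₀/s`, `K₀₀ = K_R gaussK(0) + tailK(6)`. [cite: AjankiHuveneers2011, App. 7.3 (estimee 1, l = 0)] -/
theorem sum_B0_le (hw0 : 0 < w) (hw1 : w ≤ 1) (hn1 : 1 ≤ (n : ℝ)) (hn : (n : ℝ) * w ^ 2 ≤ 1)
    (hs : s = w * Real.sqrt n) {KR c' C₃ θ Θ CA ε₀ : ℝ} (hKR : 0 ≤ KR) (hc'0 : 0 < c') (hc'1 : c' ≤ 1)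
    (hθ : 0 ≤ θ) (hθCA : θ * (n : ℝ) ^ 3 ≤ CA)
    (hΘ : Θ = (2 * C₃) ^ 8 * θ / w ^ 8) (hε₀ : 0 < ε₀) {N : ℕ} (hN1 : 1 ≤ N) (hNge : ε₀ / (4 * w) ≤ N) {B0f : ℤ → ℝ}
    (hB0f : B0f = fun ξ : ℤ => KR * rexp (-(c' * n * w ^ 2 * (ξ : ℝ) ^ 2)) + Θ * tailWeight N 6 ξ) :
    Summable B0f ∧ ∑' ξ : ℤ, B0f ξ ≤ (KR * gaussK c' 0 + tailK C₃ ε₀ CA 6) / s ^ 1 := by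
  have hsn1 : 1 ≤ Real.sqrt n := by rw [← Real.sqrt_one]; exact Real.sqrt_le_sqrt hn1
  have hs0 : 0 < s := by rw [hs]; positivity
  have hs2 : (n : ℝ) * w ^ 2 = s ^ (2 * 1) := by
    rw [hs, mul_pow, Real.sq_sqrt (by positivity)]; ring
  have hs1 : s ≤ 1 := by
    have : s ^ 2 ≤ 1 := by rw [show s ^ 2 = s ^ (2 * 1) by ring, ← hs2]; exact hn
    nlinarith only [this, hs0]
  have hg := fun l : ℕ => gauss_lattice_sum hw0 hn1 hn hs hc'0 hc'1 l
  have e : B0f = fun ξ : ℤ => KR * (|(ξ : ℝ)| ^ 0 * rexp (-(c' * n * w ^ 2 * (ξ : ℝ) ^ 2))) + (Θ * n ^ 0 * w ^ 0) * tailWeight N 6 ξ := by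
    rw [hB0f]; funext ξ; ring
  obtain ⟨hS, hE⟩ := tsum_comb2 (hg 0).1 (tsum_tailWeight_le N 6 hN1).1 KR (Θ * n ^ 0 * w ^ 0)
  rw [← e] at hS hE
  refine ⟨hS, ?_⟩
  rw [hE, add_div]
  have p1 : KR * ∑' ξ : ℤ, |(ξ : ℝ)| ^ 0 * rexp (-(c' * n * w ^ 2 * (ξ : ℝ) ^ 2)) ≤ KR * gaussK c' 0 / s ^ 1 := by
    rw [mul_div_assoc]; exact mul_le_mul_of_nonneg_left (hg 0).2 hKR
  have p2 : Θ * n ^ 0 * w ^ 0 * ∑' ξ : ℤ, tailWeight N 6 ξ ≤ tailK C₃ ε₀ CA 6 / s ^ 1 :=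
    (tail_lattice_sum hw0 hw1 hn1 hs hθCA hθ hε₀ hΘ hN1 hNge (e := 0) (f := 0) (q := 6) (m := 1) (k := 1)
      (by norm_num) (by norm_num) (by norm_num)).2
  linarith only [p1, p2]

/-- `∑ |ξ|B₀ ≤ K₀₁/s²`. [cite: AjankiHuveneers2011, App. 7.3 (estimee 1, l = 1)] -/
theorem sum_abs_mul_B0_le (hw0 : 0 < w) (hw1 : w ≤ 1) (hn1 : 1 ≤ (n : ℝ)) (hn : (n : ℝ) * w ^ 2 ≤ 1)
    (hs : s = w * Real.sqrt n) {KR c' C₃ θ Θ CA ε₀ : ℝ} (hKR : 0 ≤ KR) (hc'0 : 0 < c') (hc'1 : c' ≤ 1)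
    (hθ : 0 ≤ θ) (hθCA : θ * (n : ℝ) ^ 3 ≤ CA)
    (hΘ : Θ = (2 * C₃) ^ 8 * θ / w ^ 8) (hε₀ : 0 < ε₀) {N : ℕ} (hN1 : 1 ≤ N) (hNge : ε₀ / (4 * w) ≤ N) {B0f : ℤ → ℝ}
    (hB0f : B0f = fun ξ : ℤ => KR * rexp (-(c' * n * w ^ 2 * (ξ : ℝ) ^ 2)) + Θ * tailWeight N 6 ξ) :
    Summable (fun ξ : ℤ => |(ξ : ℝ)| * B0f ξ) ∧
      ∑' ξ : ℤ, |(ξ : ℝ)| * B0f ξ ≤ (KR * gaussK c' 1 + tailK C₃ ε₀ CA 5) / s ^ 2 := by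
  have hsn1 : 1 ≤ Real.sqrt n := by rw [← Real.sqrt_one]; exact Real.sqrt_le_sqrt hn1
  have hs0 : 0 < s := by rw [hs]; positivity
  have hs2 : (n : ℝ) * w ^ 2 = s ^ (2 * 1) := by
    rw [hs, mul_pow, Real.sq_sqrt (by positivity)]; ring
  have hs1 : s ≤ 1 := by
    have : s ^ 2 ≤ 1 := by rw [show s ^ 2 = s ^ (2 * 1) by ring, ← hs2]; exact hn
    nlinarith only [this, hs0]
  have hg := fun l : ℕ => gauss_lattice_sum hw0 hn1 hn hs hc'0 hc'1 l
  have ht : ∀ ξ : ℤ, |(ξ : ℝ)| * tailWeight N 6 ξ = tailWeight N 5 ξ := fun ξ => by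
    rw [← abs_pow_mul_tailWeight N 5 1 ξ, pow_one]
  have e : (fun ξ : ℤ => |(ξ : ℝ)| * B0f ξ) = fun ξ : ℤ => KR * (|(ξ : ℝ)| ^ 1 * rexp (-(c' * n * w ^ 2 * (ξ : ℝ) ^ 2))) + (Θ * n ^ 0 * w ^ 0) * tailWeight N 5 ξ := by
    rw [hB0f]; funext ξ; dsimp only; rw [← ht ξ]; ring
  obtain ⟨hS, hE⟩ := tsum_comb2 (hg 1).1 (tsum_tailWeight_le N 5 hN1).1 KR (Θ * n ^ 0 * w ^ 0)
  rw [← e] at hS hE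
  refine ⟨hS, ?_⟩
  rw [hE, add_div]
  have p1 : KR * ∑' ξ : ℤ, |(ξ : ℝ)| ^ 1 * rexp (-(c' * n * w ^ 2 * (ξ : ℝ) ^ 2)) ≤ KR * gaussK c' 1 / s ^ 2 := by
    rw [mul_div_assoc]; exact mul_le_mul_of_nonneg_left (hg 1).2 hKR
  have p2 : Θ * n ^ 0 * w ^ 0 * ∑' ξ : ℤ, tailWeight N 5 ξ ≤ tailK C₃ ε₀ CA 5 / s ^ 2 :=
    (tail_lattice_sum hw0 hw1 hn1 hs hθCA hθ hε₀ hΘ hN1 hNge (e := 0) (f := 0) (q := 5) (m := 2) (k := 2)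
      (by norm_num) (by norm_num) (by norm_num)).2
  linarith only [p1, p2]

/-- `∑ ξ²B₀ ≤ K₀₂/s³`. [cite: AjankiHuveneers2011, App. 7.3 (estimee 1, l = 2)] -/
theorem sum_sq_mul_B0_le (hw0 : 0 < w) (hw1 : w ≤ 1) (hn1 : 1 ≤ (n : ℝ)) (hn : (n : ℝ) * w ^ 2 ≤ 1)
    (hs : s = w * Real.sqrt n) {KR c' C₃ θ Θ CA ε₀ : ℝ} (hKR : 0 ≤ KR) (hc'0 : 0 < c') (hc'1 : c' ≤ 1)
    (hθ : 0 ≤ θ) (hθCA : θ * (n : ℝ) ^ 3 ≤ CA)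
    (hΘ : Θ = (2 * C₃) ^ 8 * θ / w ^ 8) (hε₀ : 0 < ε₀) {N : ℕ} (hN1 : 1 ≤ N) (hNge : ε₀ / (4 * w) ≤ N) {B0f : ℤ → ℝ}
    (hB0f : B0f = fun ξ : ℤ => KR * rexp (-(c' * n * w ^ 2 * (ξ : ℝ) ^ 2)) + Θ * tailWeight N 6 ξ) :
    Summable (fun ξ : ℤ => |(ξ : ℝ)| ^ 2 * B0f ξ) ∧
      ∑' ξ : ℤ, |(ξ : ℝ)| ^ 2 * B0f ξ ≤ (KR * gaussK c' 2 + tailK C₃ ε₀ CA 4) / s ^ 3 := by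
  have hsn1 : 1 ≤ Real.sqrt n := by rw [← Real.sqrt_one]; exact Real.sqrt_le_sqrt hn1
  have hs0 : 0 < s := by rw [hs]; positivity
  have hs2 : (n : ℝ) * w ^ 2 = s ^ (2 * 1) := by
    rw [hs, mul_pow, Real.sq_sqrt (by positivity)]; ring
  have hs1 : s ≤ 1 := by
    have : s ^ 2 ≤ 1 := by rw [show s ^ 2 = s ^ (2 * 1) by ring, ← hs2]; exact hn
    nlinarith only [this, hs0]
  have hg := fun l : ℕ => gauss_lattice_sum hw0 hn1 hn hs hc'0 hc'1 l
  have ht : ∀ ξ : ℤ, |(ξ : ℝ)| ^ 2 * tailWeight N 6 ξ = tailWeight N 4 ξ := fun ξ =>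
    abs_pow_mul_tailWeight N 4 2 ξ
  have e : (fun ξ : ℤ => |(ξ : ℝ)| ^ 2 * B0f ξ) = fun ξ : ℤ => KR * (|(ξ : ℝ)| ^ 2 * rexp (-(c' * n * w ^ 2 * (ξ : ℝ) ^ 2))) + (Θ * n ^ 0 * w ^ 0) * tailWeight N 4 ξ := by
    rw [hB0f]; funext ξ; dsimp only; rw [← ht ξ]; ring
  obtain ⟨hS, hE⟩ := tsum_comb2 (hg 2).1 (tsum_tailWeight_le N 4 hN1).1 KR (Θ * n ^ 0 * w ^ 0)
  rw [← e] at hS hE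
  refine ⟨hS, ?_⟩
  rw [hE, add_div]
  have p1 : KR * ∑' ξ : ℤ, |(ξ : ℝ)| ^ 2 * rexp (-(c' * n * w ^ 2 * (ξ : ℝ) ^ 2)) ≤ KR * gaussK c' 2 / s ^ 3 := by
    rw [mul_div_assoc]; exact mul_le_mul_of_nonneg_left (hg 2).2 hKR
  have p2 : Θ * n ^ 0 * w ^ 0 * ∑' ξ : ℤ, tailWeight N 4 ξ ≤ tailK C₃ ε₀ CA 4 / s ^ 3 :=
    (tail_lattice_sum hw0 hw1 hn1 hs hθCA hθ hε₀ hΘ hN1 hNge (e := 0) (f := 0) (q := 4) (m := 3) (k := 3)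
      (by norm_num) (by norm_num) (by norm_num)).2
  linarith only [p1, p2]

/-- `∑ B₁ ≤ K₁₀/s`. [cite: AjankiHuveneers2011, App. 7.3 (estimee 2, l = 1)] -/
theorem sum_B1_le (hw0 : 0 < w) (hw1 : w ≤ 1) (hn1 : 1 ≤ (n : ℝ)) (hn : (n : ℝ) * w ^ 2 ≤ 1)
    (hs : s = w * Real.sqrt n) {KR c' KS C₁ C₃ θ Θ σ' CA ε₀ : ℝ} (hKR : 0 ≤ KR) (hc'0 : 0 < c') (hc'1 : c' ≤ 1)
    (hKS : 0 ≤ KS) (hC₁ : 0 ≤ C₁) (hσ' : 0 ≤ σ')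
    (hθ : 0 ≤ θ) (hθCA : θ * (n : ℝ) ^ 3 ≤ CA)
    (hΘ : Θ = (2 * C₃) ^ 8 * θ / w ^ 8) (hε₀ : 0 < ε₀) {N : ℕ} (hN1 : 1 ≤ N) (hNge : ε₀ / (4 * w) ≤ N) {B1f : ℤ → ℝ}
    (hB1f : B1f = fun ξ : ℤ => C₁ * w ^ 2 * (3 + |(ξ : ℝ)|) * (KR * rexp (-(c' * n * w ^ 2 * (ξ : ℝ) ^ 2))) * (KS * n) +
      2 * C₁ * σ' * Θ * n * w ^ 3 * tailWeight N 4 ξ) :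
    Summable B1f ∧ ∑' ξ : ℤ, B1f ξ ≤
      (3 * C₁ * KR * KS * gaussK c' 0 + C₁ * KR * KS * gaussK c' 1 + 2 * C₁ * σ' * tailK C₃ ε₀ CA 4) / s ^ 1 := by
  have hsn1 : 1 ≤ Real.sqrt n := by rw [← Real.sqrt_one]; exact Real.sqrt_le_sqrt hn1
  have hs0 : 0 < s := by rw [hs]; positivity
  have hs2 : (n : ℝ) * w ^ 2 = s ^ (2 * 1) := by
    rw [hs, mul_pow, Real.sq_sqrt (by positivity)]; ring
  have hs1 : s ≤ 1 := by
    have : s ^ 2 ≤ 1 := by rw [show s ^ 2 = s ^ (2 * 1) by ring, ← hs2]; exact hn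
    nlinarith only [this, hs0]
  have hg := fun l : ℕ => gauss_lattice_sum hw0 hn1 hn hs hc'0 hc'1 l
  have hΘ0 : 0 ≤ Θ := by rw [hΘ]; positivity
  have hgK := fun l : ℕ => gaussK_nonneg (c' := c') l
  have e : B1f = fun ξ : ℤ => 3 * C₁ * KR * KS * (n * w ^ 2) * (|(ξ : ℝ)| ^ 0 * rexp (-(c' * n * w ^ 2 * (ξ : ℝ) ^ 2))) +
      C₁ * KR * KS * (n * w ^ 2) * (|(ξ : ℝ)| ^ 1 * rexp (-(c' * n * w ^ 2 * (ξ : ℝ) ^ 2))) + 2 * C₁ * σ' * (Θ * n ^ 1 * w ^ 3) * tailWeight N 4 ξ := by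
    rw [hB1f]; funext ξ; ring
  obtain ⟨hS, hE⟩ := tsum_comb3 (hg 0).1 (hg 1).1 (tsum_tailWeight_le N 4 hN1).1
    (3 * C₁ * KR * KS * (n * w ^ 2)) (C₁ * KR * KS * (n * w ^ 2)) (2 * C₁ * σ' * (Θ * n ^ 1 * w ^ 3))
  rw [← e] at hS hE
  refine ⟨hS, ?_⟩
  rw [hE, add_div, add_div]
  have p1 : (3 * C₁ * KR * KS) * (n * w ^ 2) * ∑' ξ : ℤ, |(ξ : ℝ)| ^ 0 * rexp (-(c' * n * w ^ 2 * (ξ : ℝ) ^ 2)) ≤ (3 * C₁ * KR * KS) * gaussK c' 0 / s ^ 1 := by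
    have h1 := mul_le_mul_of_nonneg_left (hg 0).2 (by positivity : (0:ℝ) ≤ (3 * C₁ * KR * KS) * (n * w ^ 2))
    have h2 := gauss_piece_le hs0 hs1 (hgK 0) (e := 1) (p := 0) (k := 1) (by norm_num)
    have h3 := mul_le_mul_of_nonneg_left h2 (by positivity : (0:ℝ) ≤ (3 * C₁ * KR * KS))
    have hconv : ((n * w ^ 2) : ℝ) = s ^ (2 * 1) := by rw [hs2]
    calc _ ≤ (3 * C₁ * KR * KS) * (n * w ^ 2) * (gaussK c' 0 / s ^ (0 + 1)) := h1
      _ = (3 * C₁ * KR * KS) * (s ^ (2 * 1) * (gaussK c' 0 / s ^ (0 + 1))) := by rw [hconv]; ring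
      _ ≤ (3 * C₁ * KR * KS) * (gaussK c' 0 / s ^ 1) := h3
      _ = _ := by ring
  have p2 : (C₁ * KR * KS) * (n * w ^ 2) * ∑' ξ : ℤ, |(ξ : ℝ)| ^ 1 * rexp (-(c' * n * w ^ 2 * (ξ : ℝ) ^ 2)) ≤ (C₁ * KR * KS) * gaussK c' 1 / s ^ 1 := by
    have h1 := mul_le_mul_of_nonneg_left (hg 1).2 (by positivity : (0:ℝ) ≤ (C₁ * KR * KS) * (n * w ^ 2))
    have h2 := gauss_piece_le hs0 hs1 (hgK 1) (e := 1) (p := 1) (k := 1) (by norm_num)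
    have h3 := mul_le_mul_of_nonneg_left h2 (by positivity : (0:ℝ) ≤ (C₁ * KR * KS))
    have hconv : ((n * w ^ 2) : ℝ) = s ^ (2 * 1) := by rw [hs2]
    calc _ ≤ (C₁ * KR * KS) * (n * w ^ 2) * (gaussK c' 1 / s ^ (1 + 1)) := h1
      _ = (C₁ * KR * KS) * (s ^ (2 * 1) * (gaussK c' 1 / s ^ (1 + 1))) := by rw [hconv]; ring
      _ ≤ (C₁ * KR * KS) * (gaussK c' 1 / s ^ 1) := h3
      _ = _ := by ring
  have p3 : (2 * C₁ * σ') * (Θ * n ^ 1 * w ^ 3) * ∑' ξ : ℤ, tailWeight N 4 ξ ≤ (2 * C₁ * σ') * tailK C₃ ε₀ CA 4 / s ^ 1 := by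
    have h1 := (tail_lattice_sum hw0 hw1 hn1 hs hθCA hθ hε₀ hΘ hN1 hNge (e := 1) (f := 3) (q := 4) (m := 0) (k := 1)
      (by norm_num) (by norm_num) (by norm_num)).2
    have h2 := mul_le_mul_of_nonneg_left h1 (by positivity : (0:ℝ) ≤ (2 * C₁ * σ'))
    calc _ = (2 * C₁ * σ') * (Θ * n ^ 1 * w ^ 3 * ∑' ξ : ℤ, tailWeight N 4 ξ) := by ring
      _ ≤ (2 * C₁ * σ') * (tailK C₃ ε₀ CA 4 / s ^ 1) := h2
      _ = _ := by ring
  have r1 : 3 * C₁ * KR * KS * (n * w ^ 2) * ∑' ξ : ℤ, |(ξ : ℝ)| ^ 0 * rexp (-(c' * n * w ^ 2 * (ξ : ℝ) ^ 2)) =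
      (3 * C₁ * KR * KS) * (n * w ^ 2) * ∑' ξ : ℤ, |(ξ : ℝ)| ^ 0 * rexp (-(c' * n * w ^ 2 * (ξ : ℝ) ^ 2)) := by ring
  have r2 : C₁ * KR * KS * (n * w ^ 2) * ∑' ξ : ℤ, |(ξ : ℝ)| ^ 1 * rexp (-(c' * n * w ^ 2 * (ξ : ℝ) ^ 2)) =
      (C₁ * KR * KS) * (n * w ^ 2) * ∑' ξ : ℤ, |(ξ : ℝ)| ^ 1 * rexp (-(c' * n * w ^ 2 * (ξ : ℝ) ^ 2)) := by ring
  have r3 : 2 * C₁ * σ' * (Θ * n ^ 1 * w ^ 3) * ∑' ξ : ℤ, tailWeight N 4 ξ =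
      (2 * C₁ * σ') * (Θ * n ^ 1 * w ^ 3) * ∑' ξ : ℤ, tailWeight N 4 ξ := by ring
  rw [r1, r2, r3]
  have f1 : (3 * C₁ * KR * KS) * gaussK c' 0 / s ^ 1 = 3 * C₁ * KR * KS * gaussK c' 0 / s ^ 1 := by ring
  have f2 : (C₁ * KR * KS) * gaussK c' 1 / s ^ 1 = C₁ * KR * KS * gaussK c' 1 / s ^ 1 := by ring
  have f3 : (2 * C₁ * σ') * tailK C₃ ε₀ CA 4 / s ^ 1 = 2 * C₁ * σ' * tailK C₃ ε₀ CA 4 / s ^ 1 := by ring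
  linarith only [p1, p2, p3, f1, f2, f3]

/-- `∑ |ξ|B₁ ≤ K₁₁/s`. [cite: AjankiHuveneers2011, App. 7.3 (estimee 2, l = 1)] -/
theorem sum_abs_mul_B1_le (hw0 : 0 < w) (hw1 : w ≤ 1) (hn1 : 1 ≤ (n : ℝ)) (hn : (n : ℝ) * w ^ 2 ≤ 1)
    (hs : s = w * Real.sqrt n) {KR c' KS C₁ C₃ θ Θ σ' CA ε₀ : ℝ} (hKR : 0 ≤ KR) (hc'0 : 0 < c') (hc'1 : c' ≤ 1)
    (hKS : 0 ≤ KS) (hC₁ : 0 ≤ C₁) (hσ' : 0 ≤ σ')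
    (hθ : 0 ≤ θ) (hθCA : θ * (n : ℝ) ^ 3 ≤ CA)
    (hΘ : Θ = (2 * C₃) ^ 8 * θ / w ^ 8) (hε₀ : 0 < ε₀) {N : ℕ} (hN1 : 1 ≤ N) (hNge : ε₀ / (4 * w) ≤ N) {B1f : ℤ → ℝ}
    (hB1f : B1f = fun ξ : ℤ => C₁ * w ^ 2 * (3 + |(ξ : ℝ)|) * (KR * rexp (-(c' * n * w ^ 2 * (ξ : ℝ) ^ 2))) * (KS * n) +
      2 * C₁ * σ' * Θ * n * w ^ 3 * tailWeight N 4 ξ) :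
    Summable (fun ξ : ℤ => |(ξ : ℝ)| * B1f ξ) ∧ ∑' ξ : ℤ, |(ξ : ℝ)| * B1f ξ ≤
      (3 * C₁ * KR * KS * gaussK c' 1 + C₁ * KR * KS * gaussK c' 2 + 2 * C₁ * σ' * tailK C₃ ε₀ CA 3) / s ^ 1 := by
  have hsn1 : 1 ≤ Real.sqrt n := by rw [← Real.sqrt_one]; exact Real.sqrt_le_sqrt hn1
  have hs0 : 0 < s := by rw [hs]; positivity
  have hs2 : (n : ℝ) * w ^ 2 = s ^ (2 * 1) := by
    rw [hs, mul_pow, Real.sq_sqrt (by positivity)]; ring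
  have hs1 : s ≤ 1 := by
    have : s ^ 2 ≤ 1 := by rw [show s ^ 2 = s ^ (2 * 1) by ring, ← hs2]; exact hn
    nlinarith only [this, hs0]
  have hg := fun l : ℕ => gauss_lattice_sum hw0 hn1 hn hs hc'0 hc'1 l
  have hΘ0 : 0 ≤ Θ := by rw [hΘ]; positivity
  have hgK := fun l : ℕ => gaussK_nonneg (c' := c') l
  have ht : ∀ ξ : ℤ, |(ξ : ℝ)| * tailWeight N 4 ξ = tailWeight N 3 ξ := fun ξ => by
    rw [← abs_pow_mul_tailWeight N 3 1 ξ, pow_one]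
  have e : (fun ξ : ℤ => |(ξ : ℝ)| * B1f ξ) = fun ξ : ℤ => 3 * C₁ * KR * KS * (n * w ^ 2) * (|(ξ : ℝ)| ^ 1 * rexp (-(c' * n * w ^ 2 * (ξ : ℝ) ^ 2))) +
      C₁ * KR * KS * (n * w ^ 2) * (|(ξ : ℝ)| ^ 2 * rexp (-(c' * n * w ^ 2 * (ξ : ℝ) ^ 2))) + 2 * C₁ * σ' * (Θ * n ^ 1 * w ^ 3) * tailWeight N 3 ξ := by
    rw [hB1f]; funext ξ; dsimp only; rw [← ht ξ]; ring
  obtain ⟨hS, hE⟩ := tsum_comb3 (hg 1).1 (hg 2).1 (tsum_tailWeight_le N 3 hN1).1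
    (3 * C₁ * KR * KS * (n * w ^ 2)) (C₁ * KR * KS * (n * w ^ 2)) (2 * C₁ * σ' * (Θ * n ^ 1 * w ^ 3))
  rw [← e] at hS hE
  refine ⟨hS, ?_⟩
  rw [hE, add_div, add_div]
  have p1 : (3 * C₁ * KR * KS) * (n * w ^ 2) * ∑' ξ : ℤ, |(ξ : ℝ)| ^ 1 * rexp (-(c' * n * w ^ 2 * (ξ : ℝ) ^ 2)) ≤ (3 * C₁ * KR * KS) * gaussK c' 1 / s ^ 1 := by
    have h1 := mul_le_mul_of_nonneg_left (hg 1).2 (by positivity : (0:ℝ) ≤ (3 * C₁ * KR * KS) * (n * w ^ 2))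
    have h2 := gauss_piece_le hs0 hs1 (hgK 1) (e := 1) (p := 1) (k := 1) (by norm_num)
    have h3 := mul_le_mul_of_nonneg_left h2 (by positivity : (0:ℝ) ≤ (3 * C₁ * KR * KS))
    have hconv : ((n * w ^ 2) : ℝ) = s ^ (2 * 1) := by rw [hs2]
    calc _ ≤ (3 * C₁ * KR * KS) * (n * w ^ 2) * (gaussK c' 1 / s ^ (1 + 1)) := h1
      _ = (3 * C₁ * KR * KS) * (s ^ (2 * 1) * (gaussK c' 1 / s ^ (1 + 1))) := by rw [hconv]; ring
      _ ≤ (3 * C₁ * KR * KS) * (gaussK c' 1 / s ^ 1) := h3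
      _ = _ := by ring
  have p2 : (C₁ * KR * KS) * (n * w ^ 2) * ∑' ξ : ℤ, |(ξ : ℝ)| ^ 2 * rexp (-(c' * n * w ^ 2 * (ξ : ℝ) ^ 2)) ≤ (C₁ * KR * KS) * gaussK c' 2 / s ^ 1 := by
    have h1 := mul_le_mul_of_nonneg_left (hg 2).2 (by positivity : (0:ℝ) ≤ (C₁ * KR * KS) * (n * w ^ 2))
    have h2 := gauss_piece_le hs0 hs1 (hgK 2) (e := 1) (p := 2) (k := 1) (by norm_num)
    have h3 := mul_le_mul_of_nonneg_left h2 (by positivity : (0:ℝ) ≤ (C₁ * KR * KS))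
    have hconv : ((n * w ^ 2) : ℝ) = s ^ (2 * 1) := by rw [hs2]
    calc _ ≤ (C₁ * KR * KS) * (n * w ^ 2) * (gaussK c' 2 / s ^ (2 + 1)) := h1
      _ = (C₁ * KR * KS) * (s ^ (2 * 1) * (gaussK c' 2 / s ^ (2 + 1))) := by rw [hconv]; ring
      _ ≤ (C₁ * KR * KS) * (gaussK c' 2 / s ^ 1) := h3
      _ = _ := by ring
  have p3 : (2 * C₁ * σ') * (Θ * n ^ 1 * w ^ 3) * ∑' ξ : ℤ, tailWeight N 3 ξ ≤ (2 * C₁ * σ') * tailK C₃ ε₀ CA 3 / s ^ 1 := by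
    have h1 := (tail_lattice_sum hw0 hw1 hn1 hs hθCA hθ hε₀ hΘ hN1 hNge (e := 1) (f := 3) (q := 3) (m := 1) (k := 1)
      (by norm_num) (by norm_num) (by norm_num)).2
    have h2 := mul_le_mul_of_nonneg_left h1 (by positivity : (0:ℝ) ≤ (2 * C₁ * σ'))
    calc _ = (2 * C₁ * σ') * (Θ * n ^ 1 * w ^ 3 * ∑' ξ : ℤ, tailWeight N 3 ξ) := by ring
      _ ≤ (2 * C₁ * σ') * (tailK C₃ ε₀ CA 3 / s ^ 1) := h2
      _ = _ := by ring
  have r1 : 3 * C₁ * KR * KS * (n * w ^ 2) * ∑' ξ : ℤ, |(ξ : ℝ)| ^ 1 * rexp (-(c' * n * w ^ 2 * (ξ : ℝ) ^ 2)) =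
      (3 * C₁ * KR * KS) * (n * w ^ 2) * ∑' ξ : ℤ, |(ξ : ℝ)| ^ 1 * rexp (-(c' * n * w ^ 2 * (ξ : ℝ) ^ 2)) := by ring
  have r2 : C₁ * KR * KS * (n * w ^ 2) * ∑' ξ : ℤ, |(ξ : ℝ)| ^ 2 * rexp (-(c' * n * w ^ 2 * (ξ : ℝ) ^ 2)) =
      (C₁ * KR * KS) * (n * w ^ 2) * ∑' ξ : ℤ, |(ξ : ℝ)| ^ 2 * rexp (-(c' * n * w ^ 2 * (ξ : ℝ) ^ 2)) := by ring
  have r3 : 2 * C₁ * σ' * (Θ * n ^ 1 * w ^ 3) * ∑' ξ : ℤ, tailWeight N 3 ξ =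
      (2 * C₁ * σ') * (Θ * n ^ 1 * w ^ 3) * ∑' ξ : ℤ, tailWeight N 3 ξ := by ring
  rw [r1, r2, r3]
  have f1 : (3 * C₁ * KR * KS) * gaussK c' 1 / s ^ 1 = 3 * C₁ * KR * KS * gaussK c' 1 / s ^ 1 := by ring
  have f2 : (C₁ * KR * KS) * gaussK c' 2 / s ^ 1 = C₁ * KR * KS * gaussK c' 2 / s ^ 1 := by ring
  have f3 : (2 * C₁ * σ') * tailK C₃ ε₀ CA 3 / s ^ 1 = 2 * C₁ * σ' * tailK C₃ ε₀ CA 3 / s ^ 1 := by ring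
  linarith only [p1, p2, p3, f1, f2, f3]

/-- `w²∑ ξ²B₁ ≤ K₁₂/s`. [cite: AjankiHuveneers2011, App. 7.3 (estimee 2, l = 2)] -/
theorem sum_sq_mul_B1_le (hw0 : 0 < w) (hw1 : w ≤ 1) (hn1 : 1 ≤ (n : ℝ)) (hn : (n : ℝ) * w ^ 2 ≤ 1)
    (hs : s = w * Real.sqrt n) {KR c' KS C₁ C₃ θ Θ σ' CA ε₀ : ℝ} (hKR : 0 ≤ KR) (hc'0 : 0 < c') (hc'1 : c' ≤ 1)
    (hKS : 0 ≤ KS) (hC₁ : 0 ≤ C₁) (hσ' : 0 ≤ σ')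
    (hθ : 0 ≤ θ) (hθCA : θ * (n : ℝ) ^ 3 ≤ CA)
    (hΘ : Θ = (2 * C₃) ^ 8 * θ / w ^ 8) (hε₀ : 0 < ε₀) {N : ℕ} (hN1 : 1 ≤ N) (hNge : ε₀ / (4 * w) ≤ N) {B1f : ℤ → ℝ}
    (hB1f : B1f = fun ξ : ℤ => C₁ * w ^ 2 * (3 + |(ξ : ℝ)|) * (KR * rexp (-(c' * n * w ^ 2 * (ξ : ℝ) ^ 2))) * (KS * n) +
      2 * C₁ * σ' * Θ * n * w ^ 3 * tailWeight N 4 ξ) :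
    Summable (fun ξ : ℤ => |(ξ : ℝ)| ^ 2 * B1f ξ) ∧ w ^ 2 * ∑' ξ : ℤ, |(ξ : ℝ)| ^ 2 * B1f ξ ≤
      (3 * C₁ * KR * KS * gaussK c' 2 + C₁ * KR * KS * gaussK c' 3 + 2 * C₁ * σ' * tailK C₃ ε₀ CA 2) / s ^ 1 := by
  have hsn1 : 1 ≤ Real.sqrt n := by rw [← Real.sqrt_one]; exact Real.sqrt_le_sqrt hn1
  have hs0 : 0 < s := by rw [hs]; positivity
  have hs2 : (n : ℝ) * w ^ 2 = s ^ (2 * 1) := by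
    rw [hs, mul_pow, Real.sq_sqrt (by positivity)]; ring
  have hs1 : s ≤ 1 := by
    have : s ^ 2 ≤ 1 := by rw [show s ^ 2 = s ^ (2 * 1) by ring, ← hs2]; exact hn
    nlinarith only [this, hs0]
  have hg := fun l : ℕ => gauss_lattice_sum hw0 hn1 hn hs hc'0 hc'1 l
  have hΘ0 : 0 ≤ Θ := by rw [hΘ]; positivity
  have hgK := fun l : ℕ => gaussK_nonneg (c' := c') l
  have hws : w ≤ s := by rw [hs]; nlinarith only [hsn1, hw0]
  have ht : ∀ ξ : ℤ, |(ξ : ℝ)| ^ 2 * tailWeight N 4 ξ = tailWeight N 2 ξ := fun ξ =>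
    abs_pow_mul_tailWeight N 2 2 ξ
  have e : (fun ξ : ℤ => |(ξ : ℝ)| ^ 2 * B1f ξ) = fun ξ : ℤ => 3 * C₁ * KR * KS * (n * w ^ 2) * (|(ξ : ℝ)| ^ 2 * rexp (-(c' * n * w ^ 2 * (ξ : ℝ) ^ 2))) +
      C₁ * KR * KS * (n * w ^ 2) * (|(ξ : ℝ)| ^ 3 * rexp (-(c' * n * w ^ 2 * (ξ : ℝ) ^ 2))) + 2 * C₁ * σ' * (Θ * n ^ 1 * w ^ 3) * tailWeight N 2 ξ := by
    rw [hB1f]; funext ξ; dsimp only; rw [← ht ξ]; ring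
  obtain ⟨hS, hE⟩ := tsum_comb3 (hg 2).1 (hg 3).1 (tsum_tailWeight_le N 2 hN1).1
    (3 * C₁ * KR * KS * (n * w ^ 2)) (C₁ * KR * KS * (n * w ^ 2)) (2 * C₁ * σ' * (Θ * n ^ 1 * w ^ 3))
  rw [← e] at hS hE
  refine ⟨hS, ?_⟩
  rw [hE, mul_add, mul_add, add_div, add_div]
  have hw2s : w ^ 2 * (n * w ^ 2) ≤ s ^ (2 * 2) := by
    rw [hs2, show s ^ (2 * 2) = s ^ 2 * s ^ (2 * 1) by ring]
    exact mul_le_mul_of_nonneg_right (pow_le_pow_left₀ hw0.le hws 2) (by positivity)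
  have p1 : w ^ 2 * (3 * C₁ * KR * KS * (n * w ^ 2) * ∑' ξ : ℤ, |(ξ : ℝ)| ^ 2 * rexp (-(c' * n * w ^ 2 * (ξ : ℝ) ^ 2))) ≤ 3 * C₁ * KR * KS * gaussK c' 2 / s ^ 1 := by
    have h0 : 0 ≤ ∑' ξ : ℤ, |(ξ : ℝ)| ^ 2 * rexp (-(c' * n * w ^ 2 * (ξ : ℝ) ^ 2)) := tsum_nonneg fun ξ => by positivity
    have h2 := gauss_piece_le hs0 hs1 (hgK 2) (e := 2) (p := 2) (k := 1) (by norm_num)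
    calc _ = 3 * C₁ * KR * KS * ((w ^ 2 * (n * w ^ 2)) * ∑' ξ : ℤ, |(ξ : ℝ)| ^ 2 * rexp (-(c' * n * w ^ 2 * (ξ : ℝ) ^ 2))) := by ring
      _ ≤ 3 * C₁ * KR * KS * (s ^ (2 * 2) * (gaussK c' 2 / s ^ (2 + 1))) :=
          mul_le_mul_of_nonneg_left (mul_le_mul hw2s (hg 2).2 h0 (by positivity)) (by positivity)
      _ ≤ 3 * C₁ * KR * KS * (gaussK c' 2 / s ^ 1) := mul_le_mul_of_nonneg_left h2 (by positivity)
      _ = _ := by ring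
  have p2 : w ^ 2 * (C₁ * KR * KS * (n * w ^ 2) * ∑' ξ : ℤ, |(ξ : ℝ)| ^ 3 * rexp (-(c' * n * w ^ 2 * (ξ : ℝ) ^ 2))) ≤ C₁ * KR * KS * gaussK c' 3 / s ^ 1 := by
    have h0 : 0 ≤ ∑' ξ : ℤ, |(ξ : ℝ)| ^ 3 * rexp (-(c' * n * w ^ 2 * (ξ : ℝ) ^ 2)) := tsum_nonneg fun ξ => by positivity
    have h2 := gauss_piece_le hs0 hs1 (hgK 3) (e := 2) (p := 3) (k := 1) (by norm_num)
    calc _ = C₁ * KR * KS * ((w ^ 2 * (n * w ^ 2)) * ∑' ξ : ℤ, |(ξ : ℝ)| ^ 3 * rexp (-(c' * n * w ^ 2 * (ξ : ℝ) ^ 2))) := by ring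
      _ ≤ C₁ * KR * KS * (s ^ (2 * 2) * (gaussK c' 3 / s ^ (3 + 1))) :=
          mul_le_mul_of_nonneg_left (mul_le_mul hw2s (hg 3).2 h0 (by positivity)) (by positivity)
      _ ≤ C₁ * KR * KS * (gaussK c' 3 / s ^ 1) := mul_le_mul_of_nonneg_left h2 (by positivity)
      _ = _ := by ring
  have p3' : (2 * C₁ * σ') * (Θ * n ^ 1 * w ^ 5) * ∑' ξ : ℤ, tailWeight N 2 ξ ≤ (2 * C₁ * σ') * tailK C₃ ε₀ CA 2 / s ^ 1 := by
    have h1 := (tail_lattice_sum hw0 hw1 hn1 hs hθCA hθ hε₀ hΘ hN1 hNge (e := 1) (f := 5) (q := 2) (m := 0) (k := 1)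
      (by norm_num) (by norm_num) (by norm_num)).2
    have h2 := mul_le_mul_of_nonneg_left h1 (by positivity : (0:ℝ) ≤ (2 * C₁ * σ'))
    calc _ = (2 * C₁ * σ') * (Θ * n ^ 1 * w ^ 5 * ∑' ξ : ℤ, tailWeight N 2 ξ) := by ring
      _ ≤ (2 * C₁ * σ') * (tailK C₃ ε₀ CA 2 / s ^ 1) := h2
      _ = _ := by ring
  have p3 : w ^ 2 * (2 * C₁ * σ' * (Θ * n ^ 1 * w ^ 3) * ∑' ξ : ℤ, tailWeight N 2 ξ) ≤ 2 * C₁ * σ' * tailK C₃ ε₀ CA 2 / s ^ 1 := by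
    calc _ = (2 * C₁ * σ') * (Θ * n ^ 1 * w ^ 5) * ∑' ξ : ℤ, tailWeight N 2 ξ := by ring
      _ ≤ _ := p3'
      _ = _ := by ring
  linarith only [p1, p2, p3]

/-- `(3 + x)² ≤ 18 + 2x²`. [folklore] -/
theorem three_add_sq_le (x : ℝ) : (3 + x) ^ 2 ≤ 18 + 2 * x ^ 2 := by nlinarith [sq_nonneg (x - 3)]

/-- `∑ ξ²B₂ ≤ K₂₂/s`. [cite: AjankiHuveneers2011, App. 7.3 (estimee 2, l = 2)] -/
theorem sum_sq_mul_B2_le (hw0 : 0 < w) (hw1 : w ≤ 1) (hn1 : 1 ≤ (n : ℝ)) (hn : (n : ℝ) * w ^ 2 ≤ 1)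
    (hs : s = w * Real.sqrt n) {KR c' KS C₁ C₂ C₃ θ Θ σ' CA ε₀ : ℝ} (hKR : 0 ≤ KR) (hc'0 : 0 < c') (hc'1 : c' ≤ 1)
    (hKS : 0 ≤ KS) (hC₂ : 0 ≤ C₂) (hσ' : 0 ≤ σ')
    (hθ : 0 ≤ θ) (hθCA : θ * (n : ℝ) ^ 3 ≤ CA)
    (hΘ : Θ = (2 * C₃) ^ 8 * θ / w ^ 8) (hε₀ : 0 < ε₀) {N : ℕ} (hN1 : 1 ≤ N) (hNge : ε₀ / (4 * w) ≤ N) {B2f : ℤ → ℝ}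
    (hB2f : B2f = fun ξ : ℤ => KR * rexp (-(c' * n * w ^ 2 * (ξ : ℝ) ^ 2)) *
        (C₂ * w ^ 2 * (KS * n) + (C₁ * w ^ 2 * (3 + |(ξ : ℝ)|)) ^ 2 * (KS * n) ^ 2) +
      Θ * (C₂ * σ' * n * w ^ 3 * tailWeight N 5 ξ + 4 * C₁ ^ 2 * σ' ^ 2 * n ^ 2 * w ^ 6 * tailWeight N 2 ξ)) :
    Summable (fun ξ : ℤ => |(ξ : ℝ)| ^ 2 * B2f ξ) ∧ ∑' ξ : ℤ, |(ξ : ℝ)| ^ 2 * B2f ξ ≤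
      (KR * C₂ * KS * gaussK c' 2 + 18 * KR * C₁ ^ 2 * KS ^ 2 * gaussK c' 2 + 2 * KR * C₁ ^ 2 * KS ^ 2 * gaussK c' 4 +
        C₂ * σ' * tailK C₃ ε₀ CA 3 + 4 * C₁ ^ 2 * σ' ^ 2 * tailK C₃ ε₀ CA 0) / s ^ 1 := by
  have hsn1 : 1 ≤ Real.sqrt n := by rw [← Real.sqrt_one]; exact Real.sqrt_le_sqrt hn1
  have hs0 : 0 < s := by rw [hs]; positivity
  have hs2 : (n : ℝ) * w ^ 2 = s ^ (2 * 1) := by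
    rw [hs, mul_pow, Real.sq_sqrt (by positivity)]; ring
  have hs1 : s ≤ 1 := by
    have : s ^ 2 ≤ 1 := by rw [show s ^ 2 = s ^ (2 * 1) by ring, ← hs2]; exact hn
    nlinarith only [this, hs0]
  have hg := fun l : ℕ => gauss_lattice_sum hw0 hn1 hn hs hc'0 hc'1 l
  have hΘ0 : 0 ≤ Θ := by rw [hΘ]; positivity
  have hgK := fun l : ℕ => gaussK_nonneg (c' := c') l
  have ht3 : ∀ ξ : ℤ, |(ξ : ℝ)| ^ 2 * tailWeight N 5 ξ = tailWeight N 3 ξ := fun ξ =>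
    abs_pow_mul_tailWeight N 3 2 ξ
  have ht0 : ∀ ξ : ℤ, |(ξ : ℝ)| ^ 2 * tailWeight N 2 ξ = tailWeight N 0 ξ := fun ξ =>
    abs_pow_mul_tailWeight N 0 2 ξ
  obtain ⟨hS, hE⟩ := tsum_comb4 (hg 2).1 (hg 4).1 (tsum_tailWeight_le N 3 hN1).1 (tsum_tailWeight_le N 0 hN1).1
    (KR * C₂ * KS * (n * w ^ 2) + 18 * KR * C₁ ^ 2 * KS ^ 2 * (n * w ^ 2) ^ 2) (2 * KR * C₁ ^ 2 * KS ^ 2 * (n * w ^ 2) ^ 2)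
    (C₂ * σ' * (Θ * n ^ 1 * w ^ 3)) (4 * C₁ ^ 2 * σ' ^ 2 * (Θ * n ^ 2 * w ^ 6))
  have hdom : ∀ ξ : ℤ, |(ξ : ℝ)| ^ 2 * B2f ξ ≤
      (KR * C₂ * KS * (n * w ^ 2) + 18 * KR * C₁ ^ 2 * KS ^ 2 * (n * w ^ 2) ^ 2) * (|(ξ : ℝ)| ^ 2 * rexp (-(c' * n * w ^ 2 * (ξ : ℝ) ^ 2))) +
      2 * KR * C₁ ^ 2 * KS ^ 2 * (n * w ^ 2) ^ 2 * (|(ξ : ℝ)| ^ 4 * rexp (-(c' * n * w ^ 2 * (ξ : ℝ) ^ 2))) +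
      C₂ * σ' * (Θ * n ^ 1 * w ^ 3) * tailWeight N 3 ξ + 4 * C₁ ^ 2 * σ' ^ 2 * (Θ * n ^ 2 * w ^ 6) * tailWeight N 0 ξ := by
    intro ξ
    rw [hB2f]; dsimp only
    rw [← ht3 ξ, ← ht0 ξ]
    have hsq := three_add_sq_le |(ξ : ℝ)|
    have hE0 : 0 ≤ KR * rexp (-(c' * n * w ^ 2 * (ξ : ℝ) ^ 2)) * (C₁ * w ^ 2) ^ 2 * (KS * n) ^ 2 * |(ξ : ℝ)| ^ 2 := by positivity
    have key := mul_le_mul_of_nonneg_left hsq hE0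
    have expand : |(ξ : ℝ)| ^ 2 * (KR * rexp (-(c' * n * w ^ 2 * (ξ : ℝ) ^ 2)) * (C₂ * w ^ 2 * (KS * n) + (C₁ * w ^ 2 * (3 + |(ξ : ℝ)|)) ^ 2 * (KS * n) ^ 2) +
        Θ * (C₂ * σ' * n * w ^ 3 * tailWeight N 5 ξ +
          4 * C₁ ^ 2 * σ' ^ 2 * n ^ 2 * w ^ 6 * tailWeight N 2 ξ)) =
        KR * C₂ * KS * (n * w ^ 2) * (|(ξ : ℝ)| ^ 2 * rexp (-(c' * n * w ^ 2 * (ξ : ℝ) ^ 2))) +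
        KR * rexp (-(c' * n * w ^ 2 * (ξ : ℝ) ^ 2)) * (C₁ * w ^ 2) ^ 2 * (KS * n) ^ 2 * |(ξ : ℝ)| ^ 2 * (3 + |(ξ : ℝ)|) ^ 2 +
        C₂ * σ' * (Θ * n ^ 1 * w ^ 3) * (|(ξ : ℝ)| ^ 2 * tailWeight N 5 ξ) +
        4 * C₁ ^ 2 * σ' ^ 2 * (Θ * n ^ 2 * w ^ 6) * (|(ξ : ℝ)| ^ 2 * tailWeight N 2 ξ) := by ring
    have expand2 : KR * rexp (-(c' * n * w ^ 2 * (ξ : ℝ) ^ 2)) * (C₁ * w ^ 2) ^ 2 * (KS * n) ^ 2 * |(ξ : ℝ)| ^ 2 * (18 + 2 * |(ξ : ℝ)| ^ 2) =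
        18 * KR * C₁ ^ 2 * KS ^ 2 * (n * w ^ 2) ^ 2 * (|(ξ : ℝ)| ^ 2 * rexp (-(c' * n * w ^ 2 * (ξ : ℝ) ^ 2))) +
        2 * KR * C₁ ^ 2 * KS ^ 2 * (n * w ^ 2) ^ 2 * (|(ξ : ℝ)| ^ 4 * rexp (-(c' * n * w ^ 2 * (ξ : ℝ) ^ 2))) := by ring
    rw [expand]
    rw [expand2] at key
    linarith only [key]
  have h0 : ∀ ξ : ℤ, 0 ≤ |(ξ : ℝ)| ^ 2 * B2f ξ := fun ξ => by
    rw [hB2f]; dsimp only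
    have := tailWeight_nonneg N 5 ξ; have := tailWeight_nonneg N 2 ξ; positivity
  obtain ⟨hSum, hle⟩ := tsum_dom h0 hdom hS
  refine ⟨hSum, hle.trans ?_⟩
  rw [hE, add_div, add_div, add_div]
  have p1a : (KR * C₂ * KS) * (n * w ^ 2) * ∑' ξ : ℤ, |(ξ : ℝ)| ^ 2 * rexp (-(c' * n * w ^ 2 * (ξ : ℝ) ^ 2)) ≤ (KR * C₂ * KS) * gaussK c' 2 / s ^ 1 := by
    have h1 := mul_le_mul_of_nonneg_left (hg 2).2 (by positivity : (0:ℝ) ≤ (KR * C₂ * KS) * (n * w ^ 2))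
    have h2 := gauss_piece_le hs0 hs1 (hgK 2) (e := 1) (p := 2) (k := 1) (by norm_num)
    have h3 := mul_le_mul_of_nonneg_left h2 (by positivity : (0:ℝ) ≤ (KR * C₂ * KS))
    have hconv : ((n * w ^ 2) : ℝ) = s ^ (2 * 1) := by rw [hs2]
    calc _ ≤ (KR * C₂ * KS) * (n * w ^ 2) * (gaussK c' 2 / s ^ (2 + 1)) := h1
      _ = (KR * C₂ * KS) * (s ^ (2 * 1) * (gaussK c' 2 / s ^ (2 + 1))) := by rw [hconv]; ring
      _ ≤ (KR * C₂ * KS) * (gaussK c' 2 / s ^ 1) := h3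
      _ = _ := by ring
  have p1b : (18 * KR * C₁ ^ 2 * KS ^ 2) * (n * w ^ 2) ^ 2 * ∑' ξ : ℤ, |(ξ : ℝ)| ^ 2 * rexp (-(c' * n * w ^ 2 * (ξ : ℝ) ^ 2)) ≤ (18 * KR * C₁ ^ 2 * KS ^ 2) * gaussK c' 2 / s ^ 1 := by
    have h1 := mul_le_mul_of_nonneg_left (hg 2).2 (by positivity : (0:ℝ) ≤ (18 * KR * C₁ ^ 2 * KS ^ 2) * (n * w ^ 2) ^ 2)
    have h2 := gauss_piece_le hs0 hs1 (hgK 2) (e := 2) (p := 2) (k := 1) (by norm_num)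
    have h3 := mul_le_mul_of_nonneg_left h2 (by positivity : (0:ℝ) ≤ (18 * KR * C₁ ^ 2 * KS ^ 2))
    have hconv : ((n * w ^ 2) ^ 2 : ℝ) = s ^ (2 * 2) := by rw [hs2]; ring
    calc _ ≤ (18 * KR * C₁ ^ 2 * KS ^ 2) * (n * w ^ 2) ^ 2 * (gaussK c' 2 / s ^ (2 + 1)) := h1
      _ = (18 * KR * C₁ ^ 2 * KS ^ 2) * (s ^ (2 * 2) * (gaussK c' 2 / s ^ (2 + 1))) := by rw [hconv]; ring
      _ ≤ (18 * KR * C₁ ^ 2 * KS ^ 2) * (gaussK c' 2 / s ^ 1) := h3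
      _ = _ := by ring
  have p2 : (2 * KR * C₁ ^ 2 * KS ^ 2) * (n * w ^ 2) ^ 2 * ∑' ξ : ℤ, |(ξ : ℝ)| ^ 4 * rexp (-(c' * n * w ^ 2 * (ξ : ℝ) ^ 2)) ≤ (2 * KR * C₁ ^ 2 * KS ^ 2) * gaussK c' 4 / s ^ 1 := by
    have h1 := mul_le_mul_of_nonneg_left (hg 4).2 (by positivity : (0:ℝ) ≤ (2 * KR * C₁ ^ 2 * KS ^ 2) * (n * w ^ 2) ^ 2)
    have h2 := gauss_piece_le hs0 hs1 (hgK 4) (e := 2) (p := 4) (k := 1) (by norm_num)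
    have h3 := mul_le_mul_of_nonneg_left h2 (by positivity : (0:ℝ) ≤ (2 * KR * C₁ ^ 2 * KS ^ 2))
    have hconv : ((n * w ^ 2) ^ 2 : ℝ) = s ^ (2 * 2) := by rw [hs2]; ring
    calc _ ≤ (2 * KR * C₁ ^ 2 * KS ^ 2) * (n * w ^ 2) ^ 2 * (gaussK c' 4 / s ^ (4 + 1)) := h1
      _ = (2 * KR * C₁ ^ 2 * KS ^ 2) * (s ^ (2 * 2) * (gaussK c' 4 / s ^ (4 + 1))) := by rw [hconv]; ring
      _ ≤ (2 * KR * C₁ ^ 2 * KS ^ 2) * (gaussK c' 4 / s ^ 1) := h3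
      _ = _ := by ring
  have p3 : (C₂ * σ') * (Θ * n ^ 1 * w ^ 3) * ∑' ξ : ℤ, tailWeight N 3 ξ ≤ (C₂ * σ') * tailK C₃ ε₀ CA 3 / s ^ 1 := by
    have h1 := (tail_lattice_sum hw0 hw1 hn1 hs hθCA hθ hε₀ hΘ hN1 hNge (e := 1) (f := 3) (q := 3) (m := 1) (k := 1)
      (by norm_num) (by norm_num) (by norm_num)).2
    have h2 := mul_le_mul_of_nonneg_left h1 (by positivity : (0:ℝ) ≤ (C₂ * σ'))
    calc _ = (C₂ * σ') * (Θ * n ^ 1 * w ^ 3 * ∑' ξ : ℤ, tailWeight N 3 ξ) := by ring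
      _ ≤ (C₂ * σ') * (tailK C₃ ε₀ CA 3 / s ^ 1) := h2
      _ = _ := by ring
  have p4 : (4 * C₁ ^ 2 * σ' ^ 2) * (Θ * n ^ 2 * w ^ 6) * ∑' ξ : ℤ, tailWeight N 0 ξ ≤ (4 * C₁ ^ 2 * σ' ^ 2) * tailK C₃ ε₀ CA 0 / s ^ 1 := by
    have h1 := (tail_lattice_sum hw0 hw1 hn1 hs hθCA hθ hε₀ hΘ hN1 hNge (e := 2) (f := 6) (q := 0) (m := 1) (k := 1)
      (by norm_num) (by norm_num) (by norm_num)).2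
    have h2 := mul_le_mul_of_nonneg_left h1 (by positivity : (0:ℝ) ≤ (4 * C₁ ^ 2 * σ' ^ 2))
    calc _ = (4 * C₁ ^ 2 * σ' ^ 2) * (Θ * n ^ 2 * w ^ 6 * ∑' ξ : ℤ, tailWeight N 0 ξ) := by ring
      _ ≤ (4 * C₁ ^ 2 * σ' ^ 2) * (tailK C₃ ε₀ CA 0 / s ^ 1) := h2
      _ = _ := by ring
  have esplit : (KR * C₂ * KS * (n * w ^ 2) + 18 * KR * C₁ ^ 2 * KS ^ 2 * (n * w ^ 2) ^ 2) *
      ∑' ξ : ℤ, |(ξ : ℝ)| ^ 2 * rexp (-(c' * n * w ^ 2 * (ξ : ℝ) ^ 2)) =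
      (KR * C₂ * KS) * (n * w ^ 2) * ∑' ξ : ℤ, |(ξ : ℝ)| ^ 2 * rexp (-(c' * n * w ^ 2 * (ξ : ℝ) ^ 2)) +
      (18 * KR * C₁ ^ 2 * KS ^ 2) * (n * w ^ 2) ^ 2 * ∑' ξ : ℤ, |(ξ : ℝ)| ^ 2 * rexp (-(c' * n * w ^ 2 * (ξ : ℝ) ^ 2)) := by
    ring
  have r2 : 2 * KR * C₁ ^ 2 * KS ^ 2 * (n * w ^ 2) ^ 2 * ∑' ξ : ℤ, |(ξ : ℝ)| ^ 4 * rexp (-(c' * n * w ^ 2 * (ξ : ℝ) ^ 2)) =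
      (2 * KR * C₁ ^ 2 * KS ^ 2) * (n * w ^ 2) ^ 2 * ∑' ξ : ℤ, |(ξ : ℝ)| ^ 4 * rexp (-(c' * n * w ^ 2 * (ξ : ℝ) ^ 2)) := by
    ring
  have r3 : C₂ * σ' * (Θ * n ^ 1 * w ^ 3) * ∑' ξ : ℤ, tailWeight N 3 ξ =
      (C₂ * σ') * (Θ * n ^ 1 * w ^ 3) * ∑' ξ : ℤ, tailWeight N 3 ξ := by ring
  have r4 : 4 * C₁ ^ 2 * σ' ^ 2 * (Θ * n ^ 2 * w ^ 6) * ∑' ξ : ℤ, tailWeight N 0 ξ =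
      (4 * C₁ ^ 2 * σ' ^ 2) * (Θ * n ^ 2 * w ^ 6) * ∑' ξ : ℤ, tailWeight N 0 ξ := by ring
  rw [esplit, r2, r3, r4, add_div]
  linarith only [p1a, p1b, p2, p3, p4]

end AssemblyD2


/-! ### Assembly, stage (e): from the majorants to the five coefficient sums -/

section AssemblyE

/-- Shifted absolute summability. [folklore] -/
theorem summable_norm_shift {b : ℤ → ℂ} (hb : Summable fun ξ => ‖b ξ‖) (k : ℤ) :
    Summable fun ξ => ‖b (ξ + k)‖ :=
  (Equiv.addRight k).summable_iff.mpr hb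

/-- `∑ |Δb| < ∞` when `∑ |b| < ∞`. [folklore] -/
theorem summable_norm_fwdDiff {b : ℤ → ℂ} (hb : Summable fun ξ => ‖b ξ‖) :
    Summable fun ξ => ‖fwdDiff b ξ‖ :=
  .of_nonneg_of_le (fun _ => norm_nonneg _) (fun _ => norm_sub_le _ _) ((summable_norm_shift hb 1).add hb)

/-- `‖2πi‖ = 2π`. [folklore] -/
theorem norm_two_pi_I : ‖(2 * π * I : ℂ)‖ = 2 * π := by
  rw [norm_mul, norm_mul, Complex.norm_I, mul_one, Complex.norm_real, Real.norm_eq_abs,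
    abs_of_pos Real.pi_pos, Complex.norm_two]

/-- **Coefficient sums.** With `a = Λ_n · v̂` and majorants `B₀, B₁, B₂` of `Λ_n` and its
differences (on the window `ξ, ξ+1, ξ+2`), `|v̂| ≤ U`, `|Δv̂| ≤ 2πw²U`, `|Δ²v̂| ≤ (2πw²)²U`:
`∑|a| ≤ U∑B₀`, `∑|(2πiξ)a| ≤ 2πU∑|ξ|B₀`, `∑|(2πiξ)²a| ≤ 4π²U∑ξ²B₀`,
`∑|Δ((2πiξ)a)| ≤ 2πU(2πw²∑|ξ|B₀ + ∑|ξ|B₁ + ∑B₀)` and the analogous bound for `∑|Δ²((2πiξ)²a)|`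
(discrete Leibniz). [cite: AjankiHuveneers2011, App. 7.3 (estimee 1)-(estimee 2)] -/
theorem coeff_bounds {P V a : ℤ → ℂ} (ha : a = fun ξ => P ξ * V ξ) {B0f B1f B2f : ℤ → ℝ} {U w : ℝ}
    (hV0 : ∀ ξ, ‖V ξ‖ ≤ U) (hV1 : ∀ ξ, ‖V (ξ + 1) - V ξ‖ ≤ 2 * π * w ^ 2 * U)
    (hV2 : ∀ ξ, ‖V (ξ + 2) - 2 * V (ξ + 1) + V ξ‖ ≤ (2 * π * w ^ 2) ^ 2 * U)
    (hP : ∀ ξ, ‖P ξ‖ ≤ B0f ξ ∧ ‖P (ξ + 1)‖ ≤ B0f ξ ∧ ‖P (ξ + 2)‖ ≤ B0f ξ ∧ ‖P (ξ + 1) - P ξ‖ ≤ B1f ξ ∧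
      ‖P (ξ + 2) - P (ξ + 1)‖ ≤ B1f ξ ∧ ‖P (ξ + 2) - 2 * P (ξ + 1) + P ξ‖ ≤ B2f ξ)
    (S00 : Summable B0f) (S01 : Summable fun ξ : ℤ => |(ξ : ℝ)| * B0f ξ)
    (S02 : Summable fun ξ : ℤ => |(ξ : ℝ)| ^ 2 * B0f ξ) (S10 : Summable B1f)
    (S11 : Summable fun ξ : ℤ => |(ξ : ℝ)| * B1f ξ) (S12 : Summable fun ξ : ℤ => |(ξ : ℝ)| ^ 2 * B1f ξ)
    (S22 : Summable fun ξ : ℤ => |(ξ : ℝ)| ^ 2 * B2f ξ) :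
    ((Summable fun ξ => ‖a ξ‖) ∧ ∑' ξ, ‖a ξ‖ ≤ U * ∑' ξ, B0f ξ) ∧
    ((Summable fun ξ => ‖derivCoeff a ξ‖) ∧
      ∑' ξ, ‖derivCoeff a ξ‖ ≤ 2 * π * U * ∑' ξ : ℤ, |(ξ : ℝ)| * B0f ξ) ∧
    ((Summable fun ξ => ‖derivCoeff (derivCoeff a) ξ‖) ∧
      ∑' ξ, ‖derivCoeff (derivCoeff a) ξ‖ ≤ 4 * π ^ 2 * U * ∑' ξ : ℤ, |(ξ : ℝ)| ^ 2 * B0f ξ) ∧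
    ((Summable fun ξ => ‖fwdDiff (derivCoeff a) ξ‖) ∧
      ∑' ξ, ‖fwdDiff (derivCoeff a) ξ‖ ≤ 2 * π * U * (2 * π * w ^ 2 * ∑' ξ : ℤ, |(ξ : ℝ)| * B0f ξ +
        ∑' ξ : ℤ, |(ξ : ℝ)| * B1f ξ + ∑' ξ, B0f ξ)) ∧
    ((Summable fun ξ => ‖fwdDiff (fwdDiff (derivCoeff (derivCoeff a))) ξ‖) ∧
      ∑' ξ, ‖fwdDiff (fwdDiff (derivCoeff (derivCoeff a))) ξ‖ ≤
        4 * π ^ 2 * U * ((2 * π * w ^ 2) ^ 2 * ∑' ξ : ℤ, |(ξ : ℝ)| ^ 2 * B0f ξ +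
          2 * (2 * π * w ^ 2) * ∑' ξ : ℤ, |(ξ : ℝ)| ^ 2 * B1f ξ + ∑' ξ : ℤ, |(ξ : ℝ)| ^ 2 * B2f ξ +
          4 * (2 * π * w ^ 2) * ∑' ξ : ℤ, |(ξ : ℝ)| * B0f ξ) +
        4 * π ^ 2 * U * (4 * (2 * π * w ^ 2) * ∑' ξ, B0f ξ + 4 * ∑' ξ : ℤ, |(ξ : ℝ)| * B1f ξ +
          4 * ∑' ξ, B1f ξ + 2 * ∑' ξ, B0f ξ)) := by
  obtain ⟨c, hc⟩ : ∃ c : ℝ, c = 2 * π * w ^ 2 := ⟨_, rfl⟩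
  have hc0 : 0 ≤ c := by rw [hc]; positivity
  rw [← hc] at hV1 hV2 ⊢
  have hB0 : ∀ ξ, 0 ≤ B0f ξ := fun ξ => (norm_nonneg _).trans (hP ξ).1
  have hB1 : ∀ ξ, 0 ≤ B1f ξ := fun ξ => (norm_nonneg _).trans (hP ξ).2.2.2.1
  have hB2 : ∀ ξ, 0 ≤ B2f ξ := fun ξ => (norm_nonneg _).trans (hP ξ).2.2.2.2.2
  -- pointwise bounds on `a` and its differences
  have ha0 : ∀ ξ, ‖a ξ‖ ≤ U * B0f ξ := fun ξ => by
    rw [ha]; dsimp only; rw [norm_mul]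
    calc ‖P ξ‖ * ‖V ξ‖ ≤ B0f ξ * U := mul_le_mul (hP ξ).1 (hV0 ξ) (norm_nonneg _) (hB0 ξ)
      _ = U * B0f ξ := mul_comm _ _
  have ha0' : ∀ ξ, ‖a (ξ + 1)‖ ≤ U * B0f ξ := fun ξ => by
    rw [ha]; dsimp only; rw [norm_mul]
    calc ‖P (ξ + 1)‖ * ‖V (ξ + 1)‖ ≤ B0f ξ * U := mul_le_mul (hP ξ).2.1 (hV0 _) (norm_nonneg _) (hB0 ξ)
      _ = U * B0f ξ := mul_comm _ _
  have hΔa : ∀ ξ, ‖a (ξ + 1) - a ξ‖ ≤ U * (c * B0f ξ + B1f ξ) := fun ξ => by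
    rw [ha]; dsimp only
    refine (norm_diff_mul_le P V ξ).trans ?_
    have t1 : ‖P (ξ + 1)‖ * ‖V (ξ + 1) - V ξ‖ ≤ B0f ξ * (c * U) :=
      mul_le_mul (hP ξ).2.1 (hV1 ξ) (norm_nonneg _) (hB0 ξ)
    have t2 : ‖P (ξ + 1) - P ξ‖ * ‖V ξ‖ ≤ B1f ξ * U := mul_le_mul (hP ξ).2.2.2.1 (hV0 ξ) (norm_nonneg _) (hB1 ξ)
    nlinarith only [t1, t2]
  have hΔa' : ∀ ξ, ‖a (ξ + 2) - a (ξ + 1)‖ ≤ U * (c * B0f ξ + B1f ξ) := fun ξ => by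
    rw [ha]; dsimp only
    have h := norm_diff_mul_le P V (ξ + 1)
    have hV := hV1 (ξ + 1)
    rw [show ξ + 1 + 1 = ξ + 2 by ring] at h hV
    refine h.trans ?_
    have t1 : ‖P (ξ + 2)‖ * ‖V (ξ + 2) - V (ξ + 1)‖ ≤ B0f ξ * (c * U) :=
      mul_le_mul (hP ξ).2.2.1 hV (norm_nonneg _) (hB0 ξ)
    have t2 : ‖P (ξ + 2) - P (ξ + 1)‖ * ‖V (ξ + 1)‖ ≤ B1f ξ * U :=
      mul_le_mul (hP ξ).2.2.2.2.1 (hV0 _) (norm_nonneg _) (hB1 ξ)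
    nlinarith only [t1, t2]
  have hΔ2a : ∀ ξ, ‖a (ξ + 2) - 2 * a (ξ + 1) + a ξ‖ ≤ U * (c ^ 2 * B0f ξ + 2 * c * B1f ξ + B2f ξ) := fun ξ => by
    rw [ha]; dsimp only
    refine (norm_second_diff_mul_le P V ξ).trans ?_
    have t1 : ‖P (ξ + 2)‖ * ‖V (ξ + 2) - 2 * V (ξ + 1) + V ξ‖ ≤ B0f ξ * (c ^ 2 * U) :=
      mul_le_mul (hP ξ).2.2.1 (hV2 ξ) (norm_nonneg _) (hB0 ξ)
    have t2 : ‖P (ξ + 2) - P (ξ + 1)‖ * ‖V (ξ + 1) - V ξ‖ ≤ B1f ξ * (c * U) :=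
      mul_le_mul (hP ξ).2.2.2.2.1 (hV1 ξ) (norm_nonneg _) (hB1 ξ)
    have t3 : ‖P (ξ + 2) - 2 * P (ξ + 1) + P ξ‖ * ‖V ξ‖ ≤ B2f ξ * U :=
      mul_le_mul (hP ξ).2.2.2.2.2 (hV0 ξ) (norm_nonneg _) (hB2 ξ)
    nlinarith only [t1, t2, t3]
  -- (1) `∑ |a|`
  have r1 := tsum_dom (fun ξ => norm_nonneg (a ξ)) ha0 (S00.mul_left U)
  rw [tsum_mul_left] at r1
  -- (2) `∑ |(2πiξ) a|`
  have hd : ∀ ξ, ‖derivCoeff a ξ‖ ≤ 2 * π * U * (|(ξ : ℝ)| * B0f ξ) := fun ξ => by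
    rw [norm_derivCoeff]
    have := mul_le_mul_of_nonneg_left (ha0 ξ) (by positivity : (0:ℝ) ≤ 2 * π * |(ξ : ℝ)|)
    nlinarith only [this]
  have r2 := tsum_dom (fun ξ => norm_nonneg _) hd (S01.mul_left (2 * π * U))
  rw [tsum_mul_left] at r2
  -- (3) `∑ |(2πiξ)² a|`
  have hdd : ∀ ξ, ‖derivCoeff (derivCoeff a) ξ‖ ≤ 4 * π ^ 2 * U * (|(ξ : ℝ)| ^ 2 * B0f ξ) := fun ξ => by
    rw [norm_derivCoeff, norm_derivCoeff]
    have := mul_le_mul_of_nonneg_left (ha0 ξ) (by positivity : (0:ℝ) ≤ (2 * π * |(ξ : ℝ)|) * (2 * π * |(ξ : ℝ)|))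
    nlinarith only [this]
  have r3 := tsum_dom (fun ξ => norm_nonneg _) hdd (S02.mul_left (4 * π ^ 2 * U))
  rw [tsum_mul_left] at r3
  -- (4) `∑ |Δ((2πiξ)a)|`
  have hfd : ∀ ξ, ‖fwdDiff (derivCoeff a) ξ‖ ≤
      (2 * π * U * c) * (|(ξ : ℝ)| * B0f ξ) + (2 * π * U) * (|(ξ : ℝ)| * B1f ξ) + (2 * π * U) * B0f ξ := fun ξ => by
    have hid : fwdDiff (derivCoeff a) ξ = (2 * π * I) * ((((ξ + 1 : ℤ) : ℂ)) * a (ξ + 1) - (ξ : ℂ) * a ξ) := by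
      simp only [fwdDiff, derivCoeff]; push_cast; ring
    rw [hid, norm_mul, norm_two_pi_I]
    have h1 := norm_diff_mul_id_le a ξ
    have h2 : |(ξ : ℝ)| * ‖a (ξ + 1) - a ξ‖ ≤ |(ξ : ℝ)| * (U * (c * B0f ξ + B1f ξ)) :=
      mul_le_mul_of_nonneg_left (hΔa ξ) (abs_nonneg _)
    have h3 := ha0' ξ
    have h4 : ‖(((ξ + 1 : ℤ) : ℂ)) * a (ξ + 1) - (ξ : ℂ) * a ξ‖ ≤
        |(ξ : ℝ)| * (U * (c * B0f ξ + B1f ξ)) + U * B0f ξ := by linarith only [h1, h2, h3]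
    have h5 := mul_le_mul_of_nonneg_left h4 (by positivity : (0:ℝ) ≤ 2 * π)
    have e : 2 * π * (|(ξ : ℝ)| * (U * (c * B0f ξ + B1f ξ)) + U * B0f ξ) =
        (2 * π * U * c) * (|(ξ : ℝ)| * B0f ξ) + (2 * π * U) * (|(ξ : ℝ)| * B1f ξ) + (2 * π * U) * B0f ξ := by ring
    linarith only [h5, e]
  obtain ⟨hS4, hE4⟩ := tsum_comb3 S01 S11 S00 (2 * π * U * c) (2 * π * U) (2 * π * U)
  have r4 := tsum_dom (fun ξ => norm_nonneg _) hfd hS4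
  rw [hE4] at r4
  -- (5) `∑ |Δ²((2πiξ)²a)|`
  have hfdd : ∀ ξ, ‖fwdDiff (fwdDiff (derivCoeff (derivCoeff a))) ξ‖ ≤
      ((4 * π ^ 2 * U * c ^ 2) * (|(ξ : ℝ)| ^ 2 * B0f ξ) + (4 * π ^ 2 * U * (2 * c)) * (|(ξ : ℝ)| ^ 2 * B1f ξ) +
        (4 * π ^ 2 * U) * (|(ξ : ℝ)| ^ 2 * B2f ξ) + (4 * π ^ 2 * U * (4 * c)) * (|(ξ : ℝ)| * B0f ξ)) +
      ((4 * π ^ 2 * U * (4 * c)) * B0f ξ + (4 * π ^ 2 * U * 4) * (|(ξ : ℝ)| * B1f ξ) +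
        (4 * π ^ 2 * U * 4) * B1f ξ + (4 * π ^ 2 * U * 2) * B0f ξ) := fun ξ => by
    have hid : fwdDiff (fwdDiff (derivCoeff (derivCoeff a))) ξ = (2 * π * I) * (2 * π * I) *
        (((ξ + 2 : ℤ) : ℂ) ^ 2 * a (ξ + 2) - 2 * (((ξ + 1 : ℤ) : ℂ) ^ 2 * a (ξ + 1)) + (ξ : ℂ) ^ 2 * a ξ) := by
      simp only [fwdDiff, derivCoeff]
      rw [show ξ + 1 + 1 = ξ + 2 by ring]
      push_cast; ring
    rw [hid, norm_mul, norm_mul, norm_two_pi_I]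
    have h1 := norm_second_diff_mul_sq_le a ξ
    have hξ1 : |((ξ + 1 : ℤ) : ℝ)| ≤ |(ξ : ℝ)| + 1 := by
      push_cast; exact (abs_add_le _ _).trans (by rw [abs_one])
    have h2 : (ξ : ℝ) ^ 2 * ‖a (ξ + 2) - 2 * a (ξ + 1) + a ξ‖ ≤
        |(ξ : ℝ)| ^ 2 * (U * (c ^ 2 * B0f ξ + 2 * c * B1f ξ + B2f ξ)) := by
      rw [← sq_abs]; exact mul_le_mul_of_nonneg_left (hΔ2a ξ) (sq_nonneg _)
    have h3 : 4 * |((ξ + 1 : ℤ) : ℝ)| * ‖a (ξ + 2) - a (ξ + 1)‖ ≤ 4 * (|(ξ : ℝ)| + 1) * (U * (c * B0f ξ + B1f ξ)) :=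
      mul_le_mul (mul_le_mul_of_nonneg_left hξ1 (by norm_num)) (hΔa' ξ) (norm_nonneg _) (by positivity)
    have h4 := ha0' ξ
    have h5 : ‖((ξ + 2 : ℤ) : ℂ) ^ 2 * a (ξ + 2) - 2 * (((ξ + 1 : ℤ) : ℂ) ^ 2 * a (ξ + 1)) + (ξ : ℂ) ^ 2 * a ξ‖ ≤
        |(ξ : ℝ)| ^ 2 * (U * (c ^ 2 * B0f ξ + 2 * c * B1f ξ + B2f ξ)) +
        4 * (|(ξ : ℝ)| + 1) * (U * (c * B0f ξ + B1f ξ)) + 2 * (U * B0f ξ) := by linarith only [h1, h2, h3, h4]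
    have h6 := mul_le_mul_of_nonneg_left h5 (by positivity : (0:ℝ) ≤ 2 * π * (2 * π))
    have e : 2 * π * (2 * π) * (|(ξ : ℝ)| ^ 2 * (U * (c ^ 2 * B0f ξ + 2 * c * B1f ξ + B2f ξ)) +
        4 * (|(ξ : ℝ)| + 1) * (U * (c * B0f ξ + B1f ξ)) + 2 * (U * B0f ξ)) =
        ((4 * π ^ 2 * U * c ^ 2) * (|(ξ : ℝ)| ^ 2 * B0f ξ) + (4 * π ^ 2 * U * (2 * c)) * (|(ξ : ℝ)| ^ 2 * B1f ξ) +
        (4 * π ^ 2 * U) * (|(ξ : ℝ)| ^ 2 * B2f ξ) + (4 * π ^ 2 * U * (4 * c)) * (|(ξ : ℝ)| * B0f ξ)) +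
      ((4 * π ^ 2 * U * (4 * c)) * B0f ξ + (4 * π ^ 2 * U * 4) * (|(ξ : ℝ)| * B1f ξ) +
        (4 * π ^ 2 * U * 4) * B1f ξ + (4 * π ^ 2 * U * 2) * B0f ξ) := by ring
    linarith only [h6, e]
  obtain ⟨hS5a, hE5a⟩ := tsum_comb4 S02 S12 S22 S01 (4 * π ^ 2 * U * c ^ 2) (4 * π ^ 2 * U * (2 * c))
    (4 * π ^ 2 * U) (4 * π ^ 2 * U * (4 * c))
  obtain ⟨hS5b, hE5b⟩ := tsum_comb4 S00 S11 S10 S00 (4 * π ^ 2 * U * (4 * c)) (4 * π ^ 2 * U * 4)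
    (4 * π ^ 2 * U * 4) (4 * π ^ 2 * U * 2)
  have r5 := tsum_dom (fun ξ => norm_nonneg _) hfdd (hS5a.add hS5b)
  rw [hS5a.tsum_add hS5b, hE5a, hE5b] at r5
  refine ⟨r1, r2, r3, ⟨r4.1, r4.2.trans (le_of_eq (by ring))⟩, ⟨r5.1, r5.2.trans (le_of_eq (by ring))⟩⟩

end AssemblyE


/-! ### Assembly, stage (f): the main lemma and Lemma 5.2 (5.9)–(5.10) -/

section AssemblyF

variable {τ : ℝ → ℝ} {bm bp : ℝ} {w : ℝ} {h : ℝ → ℝ} {H : ℝ}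

/-- `|r · Re z| ≤ |r z|`. [folklore] -/
theorem abs_mul_re_le (r : ℝ) (z : ℂ) : |r * z.re| ≤ ‖(r : ℂ) * z‖ := by
  rw [← Complex.re_ofReal_mul]; exact Complex.abs_re_le_norm _

/-- Bookkeeping: `f · X ≤ K/s` from `X ≤ K/sʲ` and `f sʲ⁻¹... `: the form used is
`f ≤ 1`, `0 ≤ f`, `X ≤ K / s ^ j`, `f * (K / s ^ j) ≤ K / s`. We only need the two instances below.
`w²·(K/s²) ≤ K/s` for `w² ≤ s`, `K ≥ 0`. [folklore] -/
theorem wsq_mul_div_sq_le {w s K : ℝ} (hs0 : 0 < s) (hw2s : w ^ 2 ≤ s) (hK : 0 ≤ K) :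
    w ^ 2 * (K / s ^ 2) ≤ K / s := by
  rw [show w ^ 2 * (K / s ^ 2) = (w ^ 2 / s) * (K / s) by field_simp]
  exact mul_le_of_le_one_left (by positivity) ((div_le_one hs0).mpr hw2s)

/-- `w⁴·(K/s³) ≤ K/s` for `w⁴ ≤ s²`, `K ≥ 0`. [folklore] -/
theorem wfour_mul_div_cube_le {w s K : ℝ} (hs0 : 0 < s) (hw4s : w ^ 4 ≤ s ^ 2) (hK : 0 ≤ K) :
    w ^ 4 * (K / s ^ 3) ≤ K / s := by
  rw [show w ^ 4 * (K / s ^ 3) = (w ^ 4 / s ^ 2) * (K / s) by field_simp]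
  exact mul_le_of_le_one_left (by positivity) ((div_le_one (by positivity)).mpr hw4s)

/-- **Main lemma.** Given majorants `B₀, B₁, B₂` of `Λ_n` (window form) whose seven lattice sums are
`≤ K../sᵏ` (`s = w√n`), the function `S_{y,n}u` is `C²` and satisfies (5.9)–(5.10) with the constant
`K_f(K₀₀,…,K₂₂)`. [cite: AjankiHuveneers2011, Lemma 5.2 eqs. (5.9)-(5.10); App. 7.3] -/
theorem approxKernels_main (hτ : ReducedLawHyp τ bm bp) (hw0 : 0 < w) (hw1 : w ≤ 1) (hH : ∀ z, |h z| ≤ H)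
    (hsmall : w * H * max |bm| |bp| ≤ 1 / 2) {n : ℕ} (hn1 : 1 ≤ (n : ℝ)) (hn : (n : ℝ) * w ^ 2 ≤ 1)
    {s : ℝ} (hs : s = w * Real.sqrt n) {y : ℝ} {u : ℝ → ℝ} (hu : AHBallFn u y (w ^ 2))
    {B0f B1f B2f : ℤ → ℝ}
    (hP : ∀ ξ, ‖seqProd (ahF τ w h y) n ξ‖ ≤ B0f ξ ∧ ‖seqProd (ahF τ w h y) n (ξ + 1)‖ ≤ B0f ξ ∧
      ‖seqProd (ahF τ w h y) n (ξ + 2)‖ ≤ B0f ξ ∧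
      ‖seqProd (ahF τ w h y) n (ξ + 1) - seqProd (ahF τ w h y) n ξ‖ ≤ B1f ξ ∧
      ‖seqProd (ahF τ w h y) n (ξ + 2) - seqProd (ahF τ w h y) n (ξ + 1)‖ ≤ B1f ξ ∧
      ‖seqProd (ahF τ w h y) n (ξ + 2) - 2 * seqProd (ahF τ w h y) n (ξ + 1) + seqProd (ahF τ w h y) n ξ‖ ≤
        B2f ξ)
    {K00 K01 K02 K10 K11 K12 K22 : ℝ}
    (h00 : Summable B0f ∧ ∑' ξ : ℤ, B0f ξ ≤ K00 / s ^ 1)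
    (h01 : Summable (fun ξ : ℤ => |(ξ : ℝ)| * B0f ξ) ∧ ∑' ξ : ℤ, |(ξ : ℝ)| * B0f ξ ≤ K01 / s ^ 2)
    (h02 : Summable (fun ξ : ℤ => |(ξ : ℝ)| ^ 2 * B0f ξ) ∧ ∑' ξ : ℤ, |(ξ : ℝ)| ^ 2 * B0f ξ ≤ K02 / s ^ 3)
    (h10 : Summable B1f ∧ ∑' ξ : ℤ, B1f ξ ≤ K10 / s ^ 1)
    (h11 : Summable (fun ξ : ℤ => |(ξ : ℝ)| * B1f ξ) ∧ ∑' ξ : ℤ, |(ξ : ℝ)| * B1f ξ ≤ K11 / s ^ 1)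
    (h12 : Summable (fun ξ : ℤ => |(ξ : ℝ)| ^ 2 * B1f ξ) ∧ w ^ 2 * ∑' ξ : ℤ, |(ξ : ℝ)| ^ 2 * B1f ξ ≤ K12 / s ^ 1)
    (h22 : Summable (fun ξ : ℤ => |(ξ : ℝ)| ^ 2 * B2f ξ) ∧ ∑' ξ : ℤ, |(ξ : ℝ)| ^ 2 * B2f ξ ≤ K22 / s ^ 1)
    {Kf : ℝ} (hKf : Kf = K00 + 2 * π * K01 + 4 * π ^ 2 * K02 + π * (2 * π * K01 + K11 + K00) +
      π ^ 2 * (4 * π ^ 2 * K02 + 4 * π * K12 + K22 + 8 * π * K01 + 8 * π * K00 + 4 * K11 + 4 * K10 + 2 * K00)) :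
    ContDiff ℝ 2 (ahSy τ w h y n u) ∧
    ∀ x : ℝ,
      |ahSy τ w h y n u x| ≤ Kf * ahL1 u / (w * Real.sqrt n) ∧
      |deriv (ahSy τ w h y n u) x| ≤ Kf * ahL1 u / (w * Real.sqrt n) ^ 2 ∧
      |iteratedDeriv 2 (ahSy τ w h y n u) x| ≤ Kf * ahL1 u / (w * Real.sqrt n) ^ 3 ∧
      |Real.sin (π * (x + w * n - y)) * deriv (ahSy τ w h y n u) x| ≤ Kf * ahL1 u / (w * Real.sqrt n) ∧
      |Real.sin (π * (x + w * n - y)) ^ 2 * iteratedDeriv 2 (ahSy τ w h y n u) x| ≤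
        Kf * ahL1 u / (w * Real.sqrt n) := by
  -- `s`
  have hsn1 : 1 ≤ Real.sqrt n := by rw [← Real.sqrt_one]; exact Real.sqrt_le_sqrt hn1
  have hs0 : 0 < s := by rw [hs]; positivity
  have hs2 : s ^ 2 = (n : ℝ) * w ^ 2 := by rw [hs, mul_pow, Real.sq_sqrt (by positivity)]; ring
  have hs1 : s ≤ 1 := by nlinarith only [hs2, hn, hs0]
  have hws : w ≤ s := by rw [hs]; nlinarith only [hsn1, hw0]
  have hw2s : w ^ 2 ≤ s := by nlinarith only [hws, hs1, hw0, hs0]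
  have hw4s : w ^ 4 ≤ s ^ 2 := by nlinarith only [hw2s, hw0]
  have hw21 : w ^ 2 ≤ 1 := by nlinarith only [hw0, hw1]
  -- the data `v`, `V`, `U`
  obtain ⟨U, hU⟩ : ∃ U : ℝ, U = ahL1 u := ⟨_, rfl⟩
  obtain ⟨Mu, hMu⟩ := hu.exists_abs_le
  have hvm : Measurable fun t => u (t + y) := hu.measurable.comp (measurable_id.add_const y)
  have hvM : ∀ t, |u (t + y)| ≤ Mu := fun t => hMu _
  have hvs : ∀ t, u (t + y) ≠ 0 → ∃ k : ℤ, |t - k| < w ^ 2 := fun t ht => by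
    obtain ⟨k, hk⟩ := hu.support (t + y) ht
    exact ⟨k, by rwa [add_sub_cancel_right] at hk⟩
  have hUv : ∫ t in (0 : ℝ)..1, |u (t + y)| = U := by
    rw [intervalIntegral_abs_comp_add hu.periodic y, ← ahL1_eq_intervalIntegral, hU]
  have hU0 : 0 ≤ U := by
    rw [← hUv]; exact intervalIntegral.integral_nonneg zero_le_one fun t _ => abs_nonneg _
  have hV0 : ∀ ξ, ‖circleCoeff (fun t => u (t + y)) ξ‖ ≤ U := fun ξ =>
    (norm_circleCoeff_le _ ξ).trans (le_of_eq hUv)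
  have hV1 : ∀ ξ, ‖circleCoeff (fun t => u (t + y)) (ξ + 1) - circleCoeff (fun t => u (t + y)) ξ‖ ≤
      2 * π * w ^ 2 * U := fun ξ => by
    have := norm_circleCoeff_succ_sub_le hvm hvM hvs ξ
    rwa [hUv] at this
  have hV2 : ∀ ξ, ‖circleCoeff (fun t => u (t + y)) (ξ + 2) - 2 * circleCoeff (fun t => u (t + y)) (ξ + 1) +
      circleCoeff (fun t => u (t + y)) ξ‖ ≤ (2 * π * w ^ 2) ^ 2 * U := fun ξ => by
    have := norm_circleCoeff_second_diff_le hvm hvM hvs ξ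
    rwa [hUv] at this
  -- the coefficients `a = Λ_n v̂`
  obtain ⟨a, ha⟩ : ∃ a : ℤ → ℂ, a = fun ξ => (∏ j : Fin n, ahLam τ w h (ahPt y w j) ξ) *
    circleCoeff (fun t => u (t + y)) ξ := ⟨_, rfl⟩
  have hP' : ∀ ξ, ‖(fun ξ => ∏ j : Fin n, ahLam τ w h (ahPt y w j) ξ) ξ‖ ≤ B0f ξ ∧
      ‖(fun ξ => ∏ j : Fin n, ahLam τ w h (ahPt y w j) ξ) (ξ + 1)‖ ≤ B0f ξ ∧
      ‖(fun ξ => ∏ j : Fin n, ahLam τ w h (ahPt y w j) ξ) (ξ + 2)‖ ≤ B0f ξ ∧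
      ‖(fun ξ => ∏ j : Fin n, ahLam τ w h (ahPt y w j) ξ) (ξ + 1) -
        (fun ξ => ∏ j : Fin n, ahLam τ w h (ahPt y w j) ξ) ξ‖ ≤ B1f ξ ∧
      ‖(fun ξ => ∏ j : Fin n, ahLam τ w h (ahPt y w j) ξ) (ξ + 2) -
        (fun ξ => ∏ j : Fin n, ahLam τ w h (ahPt y w j) ξ) (ξ + 1)‖ ≤ B1f ξ ∧
      ‖(fun ξ => ∏ j : Fin n, ahLam τ w h (ahPt y w j) ξ) (ξ + 2) -
        2 * (fun ξ => ∏ j : Fin n, ahLam τ w h (ahPt y w j) ξ) (ξ + 1) +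
        (fun ξ => ∏ j : Fin n, ahLam τ w h (ahPt y w j) ξ) ξ‖ ≤ B2f ξ := fun ξ => by
    simpa only [seqProd_ahF] using hP ξ
  obtain ⟨⟨Sa, Ba⟩, ⟨Sd, Bd⟩, ⟨Sdd, Bdd⟩, ⟨Sf, Bf⟩, ⟨Sff, Bff⟩⟩ :=
    coeff_bounds (a := a) ha hV0 hV1 hV2 hP' h00.1 h01.1 h02.1 h10.1 h11.1 h12.1 h22.1
  -- representation
  have hsumP : Summable fun ξ : ℤ => ‖∏ j : Fin n, ahLam τ w h (ahPt y w j) ξ‖ :=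
    .of_nonneg_of_le (fun _ => norm_nonneg _) (fun ξ => (hP' ξ).1) h00.1
  have hfun : ahSy τ w h y n u = fun x => (trigSeries a (x + (n * w - y))).re := by
    funext x; rw [ha]; exact ahSy_eq_re_trigSeries hτ hw0 hH hsmall hu n hsumP x
  refine ⟨by rw [hfun]; exact contDiff_two_re_trigSeries Sa Sd Sdd _, fun x => ?_⟩
  obtain ⟨θ, hθ⟩ : ∃ θ : ℝ, θ = x + (n * w - y) := ⟨_, rfl⟩
  have e0 : ahSy τ w h y n u x = (trigSeries a θ).re := by rw [hfun, hθ]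
  have e1 : deriv (ahSy τ w h y n u) x = (trigSeries (derivCoeff a) θ).re := by
    rw [hfun, deriv_re_trigSeries Sa Sd, hθ]
  have e2 : iteratedDeriv 2 (ahSy τ w h y n u) x = (trigSeries (derivCoeff (derivCoeff a)) θ).re := by
    rw [hfun, iteratedDeriv_two_re_trigSeries Sa Sd Sdd, hθ]
  have hsin : Real.sin (π * (x + w * n - y)) = Real.sin (π * θ) := by rw [hθ]; ring_nf
  -- the five analytic bounds
  have b0 : |ahSy τ w h y n u x| ≤ ∑' ξ, ‖a ξ‖ := by
    rw [e0]; exact (Complex.abs_re_le_norm _).trans (norm_trigSeries_le Sa θ)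
  have b1 : |deriv (ahSy τ w h y n u) x| ≤ ∑' ξ, ‖derivCoeff a ξ‖ := by
    rw [e1]; exact (Complex.abs_re_le_norm _).trans (norm_trigSeries_le Sd θ)
  have b2 : |iteratedDeriv 2 (ahSy τ w h y n u) x| ≤ ∑' ξ, ‖derivCoeff (derivCoeff a) ξ‖ := by
    rw [e2]; exact (Complex.abs_re_le_norm _).trans (norm_trigSeries_le Sdd θ)
  have b3 : |Real.sin (π * (x + w * n - y)) * deriv (ahSy τ w h y n u) x| ≤
      1 / 2 * ∑' ξ, ‖fwdDiff (derivCoeff a) ξ‖ := by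
    rw [e1, hsin]; exact (abs_mul_re_le _ _).trans (norm_sin_mul_trigSeries_le Sd Sf θ)
  have b4 : |Real.sin (π * (x + w * n - y)) ^ 2 * iteratedDeriv 2 (ahSy τ w h y n u) x| ≤
      1 / 4 * ∑' ξ, ‖fwdDiff (fwdDiff (derivCoeff (derivCoeff a))) ξ‖ := by
    rw [e2, hsin]
    refine (abs_mul_re_le _ _).trans ?_
    rw [Complex.ofReal_pow]
    exact norm_sin_sq_mul_trigSeries_le Sdd (summable_norm_fwdDiff Sdd) Sff θ
  -- abbreviations for the seven sums and nonnegativity of the constants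
  have hB0 : ∀ ξ, 0 ≤ B0f ξ := fun ξ => (norm_nonneg _).trans (hP ξ).1
  have hB1 : ∀ ξ, 0 ≤ B1f ξ := fun ξ => (norm_nonneg _).trans (hP ξ).2.2.2.1
  have hB2 : ∀ ξ, 0 ≤ B2f ξ := fun ξ => (norm_nonneg _).trans (hP ξ).2.2.2.2.2
  obtain ⟨T00, hT00⟩ : ∃ T : ℝ, T = ∑' ξ : ℤ, B0f ξ := ⟨_, rfl⟩
  obtain ⟨T01, hT01⟩ : ∃ T : ℝ, T = ∑' ξ : ℤ, |(ξ : ℝ)| * B0f ξ := ⟨_, rfl⟩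
  obtain ⟨T02, hT02⟩ : ∃ T : ℝ, T = ∑' ξ : ℤ, |(ξ : ℝ)| ^ 2 * B0f ξ := ⟨_, rfl⟩
  obtain ⟨T10, hT10⟩ : ∃ T : ℝ, T = ∑' ξ : ℤ, B1f ξ := ⟨_, rfl⟩
  obtain ⟨T11, hT11⟩ : ∃ T : ℝ, T = ∑' ξ : ℤ, |(ξ : ℝ)| * B1f ξ := ⟨_, rfl⟩
  obtain ⟨T12, hT12⟩ : ∃ T : ℝ, T = ∑' ξ : ℤ, |(ξ : ℝ)| ^ 2 * B1f ξ := ⟨_, rfl⟩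
  obtain ⟨T22, hT22⟩ : ∃ T : ℝ, T = ∑' ξ : ℤ, |(ξ : ℝ)| ^ 2 * B2f ξ := ⟨_, rfl⟩
  have Ba' : ∑' ξ, ‖a ξ‖ ≤ U * T00 := by rw [hT00]; exact Ba
  have Bd' : ∑' ξ, ‖derivCoeff a ξ‖ ≤ 2 * π * U * T01 := by rw [hT01]; exact Bd
  have Bdd' : ∑' ξ, ‖derivCoeff (derivCoeff a) ξ‖ ≤ 4 * π ^ 2 * U * T02 := by rw [hT02]; exact Bdd
  have Bf' : ∑' ξ, ‖fwdDiff (derivCoeff a) ξ‖ ≤ 2 * π * U * (2 * π * w ^ 2 * T01 + T11 + T00) := by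
    rw [hT01, hT11, hT00]; exact Bf
  have Bff' : ∑' ξ, ‖fwdDiff (fwdDiff (derivCoeff (derivCoeff a))) ξ‖ ≤
      4 * π ^ 2 * U * ((2 * π * w ^ 2) ^ 2 * T02 + 2 * (2 * π * w ^ 2) * T12 + T22 + 4 * (2 * π * w ^ 2) * T01) +
      4 * π ^ 2 * U * (4 * (2 * π * w ^ 2) * T00 + 4 * T11 + 4 * T10 + 2 * T00) := by
    rw [hT02, hT12, hT22, hT01, hT00, hT11, hT10]; exact Bff
  have hT00p : 0 ≤ T00 := by rw [hT00]; exact tsum_nonneg hB0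
  have hT01p : 0 ≤ T01 := by rw [hT01]; exact tsum_nonneg fun ξ => mul_nonneg (abs_nonneg _) (hB0 ξ)
  have hT02p : 0 ≤ T02 := by rw [hT02]; exact tsum_nonneg fun ξ => mul_nonneg (sq_nonneg _) (hB0 ξ)
  have hT10p : 0 ≤ T10 := by rw [hT10]; exact tsum_nonneg hB1
  have hT11p : 0 ≤ T11 := by rw [hT11]; exact tsum_nonneg fun ξ => mul_nonneg (abs_nonneg _) (hB1 ξ)
  have hT12p : 0 ≤ T12 := by rw [hT12]; exact tsum_nonneg fun ξ => mul_nonneg (sq_nonneg _) (hB1 ξ)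
  have hT22p : 0 ≤ T22 := by rw [hT22]; exact tsum_nonneg fun ξ => mul_nonneg (sq_nonneg _) (hB2 ξ)
  have h00' : T00 ≤ K00 / s := by rw [hT00]; simpa using h00.2
  have h01' : T01 ≤ K01 / s ^ 2 := by rw [hT01]; exact h01.2
  have h02' : T02 ≤ K02 / s ^ 3 := by rw [hT02]; exact h02.2
  have h10' : T10 ≤ K10 / s := by rw [hT10]; simpa using h10.2
  have h11' : T11 ≤ K11 / s := by rw [hT11]; simpa using h11.2
  have h12' : w ^ 2 * T12 ≤ K12 / s := by rw [hT12]; simpa using h12.2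
  have h22' : T22 ≤ K22 / s := by rw [hT22]; simpa using h22.2
  have nonneg_of_le_div : ∀ {X K : ℝ} {j : ℕ}, 0 ≤ X → X ≤ K / s ^ j → 0 ≤ K := fun hX hle => by
    have := hX.trans hle
    rwa [le_div_iff₀ (by positivity), zero_mul] at this
  have hK00 : 0 ≤ K00 := nonneg_of_le_div (j := 1) hT00p (by rwa [pow_one])
  have hK01 : 0 ≤ K01 := nonneg_of_le_div hT01p h01'
  have hK02 : 0 ≤ K02 := nonneg_of_le_div hT02p h02'
  have hK10 : 0 ≤ K10 := nonneg_of_le_div (j := 1) hT10p (by rwa [pow_one])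
  have hK11 : 0 ≤ K11 := nonneg_of_le_div (j := 1) hT11p (by rwa [pow_one])
  have hK12 : 0 ≤ K12 := nonneg_of_le_div (j := 1) (mul_nonneg (sq_nonneg w) hT12p) (by rwa [pow_one])
  have hK22 : 0 ≤ K22 := nonneg_of_le_div (j := 1) hT22p (by rwa [pow_one])
  -- moving the `w`-powers onto `s`
  have i01 : w ^ 2 * T01 ≤ K01 / s :=
    (mul_le_mul_of_nonneg_left h01' (sq_nonneg w)).trans (wsq_mul_div_sq_le hs0 hw2s hK01)
  have i02 : w ^ 4 * T02 ≤ K02 / s :=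
    (mul_le_mul_of_nonneg_left h02' (by positivity)).trans (wfour_mul_div_cube_le hs0 hw4s hK02)
  have i00 : w ^ 2 * T00 ≤ K00 / s :=
    (mul_le_mul_of_nonneg_left h00' (sq_nonneg w)).trans (mul_le_of_le_one_left (div_nonneg hK00 hs0.le) hw21)
  -- target rewriting
  have hden : w * Real.sqrt n = s := hs.symm
  rw [hden, ← hU]
  have hQ0 : 0 ≤ U / s := div_nonneg hU0 hs0.le
  have hQ2 : 0 ≤ U / s ^ 2 := div_nonneg hU0 (by positivity)
  have hQ3 : 0 ≤ U / s ^ 3 := div_nonneg hU0 (by positivity)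
  -- nonnegativity of the pieces of `Kf`
  have q1 : 0 ≤ 2 * π * K01 := by positivity
  have q2 : 0 ≤ 4 * π ^ 2 * K02 := by positivity
  have q3 : 0 ≤ π * (2 * π * K01 + K11 + K00) := by positivity
  have q4 : 0 ≤ π ^ 2 * (4 * π ^ 2 * K02 + 4 * π * K12 + K22 + 8 * π * K01 + 8 * π * K00 + 4 * K11 + 4 * K10 + 2 * K00) := by
    positivity
  refine ⟨?_, ?_, ?_, ?_, ?_⟩
  · -- (5.9), l = 0
    calc |ahSy τ w h y n u x| ≤ ∑' ξ, ‖a ξ‖ := b0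
      _ ≤ U * T00 := Ba'
      _ ≤ U * (K00 / s) := mul_le_mul_of_nonneg_left h00' hU0
      _ = K00 * (U / s) := by ring
      _ ≤ Kf * (U / s) := mul_le_mul_of_nonneg_right (by rw [hKf]; linarith only [q1, q2, q3, q4]) hQ0
      _ = Kf * U / s := by ring
  · -- (5.9), l = 1
    calc |deriv (ahSy τ w h y n u) x| ≤ ∑' ξ, ‖derivCoeff a ξ‖ := b1
      _ ≤ 2 * π * U * T01 := Bd'
      _ ≤ 2 * π * U * (K01 / s ^ 2) := mul_le_mul_of_nonneg_left h01' (by positivity)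
      _ = (2 * π * K01) * (U / s ^ 2) := by ring
      _ ≤ Kf * (U / s ^ 2) := mul_le_mul_of_nonneg_right (by rw [hKf]; linarith only [hK00, q2, q3, q4]) hQ2
      _ = Kf * U / s ^ 2 := by ring
  · -- (5.9), l = 2
    calc |iteratedDeriv 2 (ahSy τ w h y n u) x| ≤ ∑' ξ, ‖derivCoeff (derivCoeff a) ξ‖ := b2
      _ ≤ 4 * π ^ 2 * U * T02 := Bdd'
      _ ≤ 4 * π ^ 2 * U * (K02 / s ^ 3) := mul_le_mul_of_nonneg_left h02' (by positivity)
      _ = (4 * π ^ 2 * K02) * (U / s ^ 3) := by ring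
      _ ≤ Kf * (U / s ^ 3) := mul_le_mul_of_nonneg_right (by rw [hKf]; linarith only [hK00, q1, q3, q4]) hQ3
      _ = Kf * U / s ^ 3 := by ring
  · -- (5.10), k = 1
    have i01' := mul_le_mul_of_nonneg_left i01 (by positivity : (0:ℝ) ≤ 2 * π)
    have br : 2 * π * w ^ 2 * T01 + T11 + T00 ≤ 2 * π * (K01 / s) + K11 / s + K00 / s := by
      linarith only [i01', h11', h00']
    calc |Real.sin (π * (x + w * n - y)) * deriv (ahSy τ w h y n u) x|
        ≤ 1 / 2 * ∑' ξ, ‖fwdDiff (derivCoeff a) ξ‖ := b3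
      _ ≤ 1 / 2 * (2 * π * U * (2 * π * w ^ 2 * T01 + T11 + T00)) := mul_le_mul_of_nonneg_left Bf' (by norm_num)
      _ ≤ 1 / 2 * (2 * π * U * (2 * π * (K01 / s) + K11 / s + K00 / s)) :=
          mul_le_mul_of_nonneg_left (mul_le_mul_of_nonneg_left br (by positivity)) (by norm_num)
      _ = (π * (2 * π * K01 + K11 + K00)) * (U / s) := by ring
      _ ≤ Kf * (U / s) := mul_le_mul_of_nonneg_right (by rw [hKf]; linarith only [hK00, q1, q2, q4]) hQ0
      _ = Kf * U / s := by ring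
  · -- (5.10), k = 2
    have j1 : (2 * π * w ^ 2) ^ 2 * T02 ≤ 4 * π ^ 2 * (K02 / s) := by
      have := mul_le_mul_of_nonneg_left i02 (by positivity : (0:ℝ) ≤ 4 * π ^ 2)
      linarith only [this]
    have j2 : 2 * (2 * π * w ^ 2) * T12 ≤ 4 * π * (K12 / s) := by
      have := mul_le_mul_of_nonneg_left h12' (by positivity : (0:ℝ) ≤ 4 * π)
      linarith only [this]
    have j3 : 4 * (2 * π * w ^ 2) * T01 ≤ 8 * π * (K01 / s) := by
      have := mul_le_mul_of_nonneg_left i01 (by positivity : (0:ℝ) ≤ 8 * π)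
      linarith only [this]
    have j4 : 4 * (2 * π * w ^ 2) * T00 ≤ 8 * π * (K00 / s) := by
      have := mul_le_mul_of_nonneg_left i00 (by positivity : (0:ℝ) ≤ 8 * π)
      linarith only [this]
    have br1 : (2 * π * w ^ 2) ^ 2 * T02 + 2 * (2 * π * w ^ 2) * T12 + T22 + 4 * (2 * π * w ^ 2) * T01 ≤
        4 * π ^ 2 * (K02 / s) + 4 * π * (K12 / s) + K22 / s + 8 * π * (K01 / s) := by
      linarith only [j1, j2, h22', j3]
    have br2 : 4 * (2 * π * w ^ 2) * T00 + 4 * T11 + 4 * T10 + 2 * T00 ≤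
        8 * π * (K00 / s) + 4 * (K11 / s) + 4 * (K10 / s) + 2 * (K00 / s) := by
      linarith only [j4, h11', h10', h00']
    have hc0 : (0:ℝ) ≤ 4 * π ^ 2 * U := by positivity
    calc |Real.sin (π * (x + w * n - y)) ^ 2 * iteratedDeriv 2 (ahSy τ w h y n u) x|
        ≤ 1 / 4 * ∑' ξ, ‖fwdDiff (fwdDiff (derivCoeff (derivCoeff a))) ξ‖ := b4
      _ ≤ 1 / 4 * (4 * π ^ 2 * U * ((2 * π * w ^ 2) ^ 2 * T02 + 2 * (2 * π * w ^ 2) * T12 + T22 +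
            4 * (2 * π * w ^ 2) * T01) +
          4 * π ^ 2 * U * (4 * (2 * π * w ^ 2) * T00 + 4 * T11 + 4 * T10 + 2 * T00)) :=
          mul_le_mul_of_nonneg_left Bff' (by norm_num)
      _ ≤ 1 / 4 * (4 * π ^ 2 * U * (4 * π ^ 2 * (K02 / s) + 4 * π * (K12 / s) + K22 / s + 8 * π * (K01 / s)) +
          4 * π ^ 2 * U * (8 * π * (K00 / s) + 4 * (K11 / s) + 4 * (K10 / s) + 2 * (K00 / s))) :=
          mul_le_mul_of_nonneg_left (add_le_add (mul_le_mul_of_nonneg_left br1 hc0)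
            (mul_le_mul_of_nonneg_left br2 hc0)) (by norm_num)
      _ = (π ^ 2 * (4 * π ^ 2 * K02 + 4 * π * K12 + K22 + 8 * π * K01 + 8 * π * K00 + 4 * K11 + 4 * K10 + 2 * K00)) *
          (U / s) := by ring
      _ ≤ Kf * (U / s) := mul_le_mul_of_nonneg_right (by rw [hKf]; linarith only [hK00, q1, q2, q3]) hQ0
      _ = Kf * U / s := by ring

end AssemblyF


section Final

/-- The uniform bound `A'^{g-8} n³ ≤ 32(C₀ + 512)` for `8 ≤ g`, `n ≤ 2g`, `A'^m m³ ≤ C₀`. [folklore] -/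
theorem theta_cube_le {A' C₀ : ℝ} (hA'0 : 0 ≤ A') (hA'1 : A' ≤ 1) (hC₀b : ∀ m : ℕ, A' ^ m * (m : ℝ) ^ 3 ≤ C₀)
    {g n : ℕ} (hg8 : 8 ≤ g) (hng : (n : ℝ) ≤ 2 * g) :
    A' ^ (g - 8) * (n : ℝ) ^ 3 ≤ 32 * (C₀ + 512) := by
  obtain ⟨m, hm⟩ : ∃ m : ℕ, m = g - 8 := ⟨_, rfl⟩
  have hgm : (g : ℝ) = m + 8 := by
    have : g = m + 8 := by omega
    rw [this]; push_cast; ring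
  rw [← hm]
  have hAm0 : 0 ≤ A' ^ m := by positivity
  have hAm1 : A' ^ m ≤ 1 := pow_le_one₀ hA'0 hA'1
  have h1 : (n : ℝ) ^ 3 ≤ 8 * (g : ℝ) ^ 3 := by
    have : (n : ℝ) ^ 3 ≤ (2 * g) ^ 3 := pow_le_pow_left₀ (by positivity) hng 3
    nlinarith only [this]
  have h2 : (g : ℝ) ^ 3 ≤ 4 * ((m : ℝ) ^ 3 + 512) := by
    rw [hgm]
    have hm0 : (0 : ℝ) ≤ m := Nat.cast_nonneg m
    -- `(a + b)³ ≤ 4(a³ + b³)` for `a, b ≥ 0`, here `b = 8`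
    nlinarith [mul_nonneg (mul_nonneg hm0 (by norm_num : (0:ℝ) ≤ 8)) (by positivity : (0:ℝ) ≤ m + 8),
      mul_nonneg (sq_nonneg ((m : ℝ) - 8)) (by positivity : (0:ℝ) ≤ m + 8)]
  have h3 := hC₀b m
  calc A' ^ m * (n : ℝ) ^ 3 ≤ A' ^ m * (8 * (4 * ((m : ℝ) ^ 3 + 512))) :=
        mul_le_mul_of_nonneg_left (h1.trans (by nlinarith only [h2])) hAm0
    _ = 32 * (A' ^ m * (m : ℝ) ^ 3) + 16384 * A' ^ m := by ring
    _ ≤ 32 * C₀ + 16384 * 1 := by gcongr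
    _ = 32 * (C₀ + 512) := by ring

variable {τ : ℝ → ℝ} {bm bp : ℝ} {w : ℝ} {h : ℝ → ℝ} {H : ℝ}

/-- **Lemma 5.2 of Ajanki–Huveneers (2011), eqs. (5.9)–(5.10) — proved.** For `dist(y, ℤ) ≥ ε`,
`n ≥ 8`, `nw² ≤ 1`, `w ≤ w₀(ε, h, τ)` and `u ∈ L¹_{B(y,w²)}(𝕋; ℝ₊)` (bounded Borel representative):
`S_{y,n}u ∈ C²` and `|∂ˡS_{y,n}u| ≤ K‖u‖₁/(w√n)^{l+1}` (`l ≤ 2`),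
`|sinᵏπ(x+wn-y) ∂ᵏS_{y,n}u| ≤ K‖u‖₁/(w√n)` (`k = 1, 2`). Proof: App. 7.3 of the paper — Fourier
diagonalisation of the frozen steps (`DisorderedHarmonicChainApproxKernelsLaw`), Gaussian / strict /
oscillatory bounds on the multipliers (`…Factors`, `…Decay`), first and second DIFFERENCES in `ξ` in
place of `ξ`-derivatives (product rule `seqProd_bounds`, `sin`-weights as half-shifts
`norm_sin_mul_trigSeries_le`), and lattice sums (`…Toolkit`).
[cite: AjankiHuveneers2011, Lemma 5.2 eqs. (5.9)-(5.10); App. 7.3] -/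
theorem _root_.Literature.Barriers.AtomisticToContinuum.AjankiHuveneers2011_approxKernels_holds :
    AjankiHuveneers2011_approxKernels := by
  intro τ bm bp hτ h hper hC1 ε hε
  -- `h` is bounded; the mass bound `M`
  obtain ⟨H, hH⟩ := exists_bound_of_periodic_continuous hper hC1.continuous
  have hH0 : 0 ≤ H := (abs_nonneg _).trans (hH 0)
  obtain ⟨M, hM⟩ : ∃ M : ℝ, M = max |bm| |bp| := ⟨_, rfl⟩
  have hM0 : 0 ≤ M := hM ▸ le_max_of_le_left (abs_nonneg _)
  -- constants of the factors
  obtain ⟨w₆, hw₆, α₀, hα₀, _hα₀1, hgoodF⟩ := card_good_frozen_ge hε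
  obtain ⟨wg, hwg, ε₁, hε₁, CE, hCE, hgaussF⟩ := norm_sq_ahLam_le hτ hH
  obtain ⟨ε₀, hε₀⟩ : ∃ ε₀ : ℝ, ε₀ = min ε₁ 1 := ⟨_, rfl⟩
  have hε₀0 : 0 < ε₀ := by rw [hε₀]; exact lt_min hε₁ one_pos
  have hε₀1 : ε₀ ≤ 1 := hε₀ ▸ min_le_right _ _
  have hε₀ε₁ : ε₀ ≤ ε₁ := hε₀ ▸ min_le_left _ _
  obtain ⟨σ2, hσ2⟩ : ∃ σ2 : ℝ, σ2 = ∫ b, b ^ 2 * τ b := ⟨_, rfl⟩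
  have hσ20 : 0 < σ2 := hσ2 ▸ hτ.variance_pos
  obtain ⟨w1, hw1, C₁, hC₁, hd1F⟩ := norm_ahLam_succ_sub_le hτ hH
  obtain ⟨w2, hw2, C₂, hC₂, hd2F⟩ := norm_ahLam_second_diff_le hτ hH
  obtain ⟨w3, hw3, C₃, hC₃, hdecF⟩ := norm_ahLam_le_div hτ hH hα₀
  obtain ⟨w4, hw4, A', hA'0, hA'1, hstrictF⟩ := norm_ahLam_le_strict hτ hH hα₀ (ε := ε₀ / 4) (by positivity)
  obtain ⟨C₀, hC₀, hC₀b⟩ := exists_bound_pow_mul_pow hA'0.le hA'1 3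
  obtain ⟨CA, hCA⟩ : ∃ CA : ℝ, CA = 32 * (C₀ + 512) := ⟨_, rfl⟩
  have hCA0 : 0 ≤ CA := by rw [hCA]; positivity
  -- constants of the sums
  obtain ⟨KR, hKR⟩ : ∃ KR : ℝ, KR = rexp (3 * π ^ 2 * σ2 + 4 * CE) := ⟨_, rfl⟩
  obtain ⟨c', hc'⟩ : ∃ c' : ℝ, c' = min 1 (3 / 32 * π ^ 2 * σ2 * α₀ ^ 2) := ⟨_, rfl⟩
  obtain ⟨KS, hKS⟩ : ∃ KS : ℝ, KS = rexp (3 / 8 * π ^ 2 * σ2) := ⟨_, rfl⟩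
  obtain ⟨σ', hσ'⟩ : ∃ σ' : ℝ, σ' = 5 * (1 / A' + 4 / C₃) / ε₀ := ⟨_, rfl⟩
  have hKR0 : 0 < KR := by rw [hKR]; exact Real.exp_pos _
  have hKS0 : 0 < KS := by rw [hKS]; exact Real.exp_pos _
  have hc'0 : 0 < c' := by rw [hc']; exact lt_min one_pos (by positivity)
  have hc'1 : c' ≤ 1 := hc' ▸ min_le_left _ _
  have hσ'0 : 0 ≤ σ' := by rw [hσ']; positivity
  have hgK := fun l : ℕ => gaussK_nonneg (c' := c') l
  have htK := fun q : ℕ => tailK_nonneg (C₃ := C₃) hε₀0 hCA0 q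
  obtain ⟨K00, hK00⟩ : ∃ K : ℝ, K = KR * gaussK c' 0 + tailK C₃ ε₀ CA 6 := ⟨_, rfl⟩
  obtain ⟨K01, hK01⟩ : ∃ K : ℝ, K = KR * gaussK c' 1 + tailK C₃ ε₀ CA 5 := ⟨_, rfl⟩
  obtain ⟨K02, hK02⟩ : ∃ K : ℝ, K = KR * gaussK c' 2 + tailK C₃ ε₀ CA 4 := ⟨_, rfl⟩
  obtain ⟨K10, hK10⟩ : ∃ K : ℝ, K = 3 * C₁ * KR * KS * gaussK c' 0 + C₁ * KR * KS * gaussK c' 1 +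
    2 * C₁ * σ' * tailK C₃ ε₀ CA 4 := ⟨_, rfl⟩
  obtain ⟨K11, hK11⟩ : ∃ K : ℝ, K = 3 * C₁ * KR * KS * gaussK c' 1 + C₁ * KR * KS * gaussK c' 2 +
    2 * C₁ * σ' * tailK C₃ ε₀ CA 3 := ⟨_, rfl⟩
  obtain ⟨K12, hK12⟩ : ∃ K : ℝ, K = 3 * C₁ * KR * KS * gaussK c' 2 + C₁ * KR * KS * gaussK c' 3 +
    2 * C₁ * σ' * tailK C₃ ε₀ CA 2 := ⟨_, rfl⟩
  obtain ⟨K22, hK22⟩ : ∃ K : ℝ, K = KR * C₂ * KS * gaussK c' 2 + 18 * KR * C₁ ^ 2 * KS ^ 2 * gaussK c' 2 +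
    2 * KR * C₁ ^ 2 * KS ^ 2 * gaussK c' 4 + C₂ * σ' * tailK C₃ ε₀ CA 3 + 4 * C₁ ^ 2 * σ' ^ 2 * tailK C₃ ε₀ CA 0 :=
    ⟨_, rfl⟩
  have hK000 : 0 ≤ K00 := by rw [hK00]; have := hgK 0; have := htK 6; positivity
  have hK010 : 0 ≤ K01 := by rw [hK01]; have := hgK 1; have := htK 5; positivity
  have hK020 : 0 ≤ K02 := by rw [hK02]; have := hgK 2; have := htK 4; positivity
  have hK100 : 0 ≤ K10 := by rw [hK10]; have := hgK 0; have := hgK 1; have := htK 4; positivity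
  have hK110 : 0 ≤ K11 := by rw [hK11]; have := hgK 1; have := hgK 2; have := htK 3; positivity
  have hK120 : 0 ≤ K12 := by rw [hK12]; have := hgK 2; have := hgK 3; have := htK 2; positivity
  have hK220 : 0 ≤ K22 := by rw [hK22]; have := hgK 2; have := hgK 4; have := htK 3; have := htK 0; positivity
  obtain ⟨Kf, hKf⟩ : ∃ K : ℝ, K = K00 + 2 * π * K01 + 4 * π ^ 2 * K02 + π * (2 * π * K01 + K11 + K00) +
      π ^ 2 * (4 * π ^ 2 * K02 + 4 * π * K12 + K22 + 8 * π * K01 + 8 * π * K00 + 4 * K11 + 4 * K10 + 2 * K00) :=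
    ⟨_, rfl⟩
  have hKf0 : 0 ≤ Kf := by rw [hKf]; positivity
  -- the smallness threshold
  obtain ⟨wc, hwc⟩ : ∃ wc : ℝ, wc = 3 / 16 * π ^ 2 * σ2 * α₀ ^ 2 / (2 * CE + 1) := ⟨_, rfl⟩
  have hwc0 : 0 < wc := by rw [hwc]; positivity
  obtain ⟨w₀, hw₀⟩ : ∃ w₀ : ℝ, w₀ = min (min (min (min w₆ wg) (min w1 w2))
      (min (min w3 w4) (min (1 / (2 * H * M + 1)) (ε₀ / 10)))) (min wc 1) := ⟨_, rfl⟩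
  have hw₀0 : 0 < w₀ := by rw [hw₀]; positivity
  refine ⟨w₀, hw₀0, Kf + 1, by linarith only [hKf0], ?_⟩
  intro w hw n hn8 hnw y hy u hu
  obtain ⟨hw0, hwle⟩ := hw
  have L : (((w ≤ w₆ ∧ w ≤ wg) ∧ (w ≤ w1 ∧ w ≤ w2)) ∧ ((w ≤ w3 ∧ w ≤ w4) ∧ (w ≤ 1 / (2 * H * M + 1) ∧ w ≤ ε₀ / 10))) ∧
      (w ≤ wc ∧ w ≤ 1) := by
    rw [hw₀] at hwle; simpa only [le_min_iff] using hwle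
  obtain ⟨⟨⟨⟨Lw₆, Lwg⟩, ⟨Lw1, Lw2⟩⟩, ⟨⟨Lw3, Lw4⟩, ⟨LwH, Lwε⟩⟩⟩, ⟨Lwc, Lw1'⟩⟩ := L
  have hn1N : 1 ≤ n := le_trans (by norm_num) hn8
  have hn1 : (1 : ℝ) ≤ n := by exact_mod_cast hn1N
  have hn : (n : ℝ) * w ^ 2 ≤ 1 := by rw [mul_comm]; exact hnw
  have hsmall : w * H * max |bm| |bp| ≤ 1 / 2 := by
    rw [← hM]
    have h1 : w * (H * M) ≤ 1 / (2 * H * M + 1) * (H * M) := mul_le_mul_of_nonneg_right LwH (by positivity)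
    have h2 : 1 / (2 * H * M + 1) * (H * M) ≤ 1 / 2 := by
      rw [div_mul_eq_mul_div, one_mul, div_le_iff₀ (by positivity)]; linarith only [mul_nonneg hH0 hM0]
    calc w * H * M = w * (H * M) := by ring
      _ ≤ 1 / 2 := h1.trans h2
  -- per-`w` hypotheses on the factors
  have hgauss : ∀ (y' : ℝ) (ξ : ℤ), |(ξ : ℝ)| * w ≤ ε₀ →
      ‖ahLam τ w h y' ξ‖ ^ 2 ≤ 1 - 3 / 2 * π ^ 2 * σ2 * (Real.sin (π * y') ^ 2) ^ 2 * ((ξ : ℝ) * w) ^ 2 +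
        CE * w * ((ξ : ℝ) * w) ^ 2 := fun y' ξ hξ => by
    rw [hσ2]; exact hgaussF w ⟨hw0, Lwg⟩ y' ξ (hξ.trans hε₀ε₁)
  have hd1 := hd1F w ⟨hw0, Lw1⟩
  have hd2 := hd2F w ⟨hw0, Lw2⟩
  have hunit : ∀ (y' : ℝ) (ξ : ℤ), ‖ahLam τ w h y' ξ‖ ≤ 1 := fun y' ξ =>
    norm_ahLam_le_one hτ hw0.le hH hsmall y' ξ
  have hdec := hdecF w ⟨hw0, Lw3⟩
  have hstrict := hstrictF w ⟨hw0, Lw4⟩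
  have hsmallCE : 2 * CE * w ≤ 3 / 16 * π ^ 2 * σ2 * α₀ ^ 2 := by
    have h1 : 2 * CE * w ≤ 2 * CE * wc := mul_le_mul_of_nonneg_left Lwc (by positivity)
    have h2 : 2 * CE * wc ≤ 3 / 16 * π ^ 2 * σ2 * α₀ ^ 2 := by
      rw [hwc, show 2 * CE * (3 / 16 * π ^ 2 * σ2 * α₀ ^ 2 / (2 * CE + 1)) =
        (3 / 16 * π ^ 2 * σ2 * α₀ ^ 2) * (2 * CE / (2 * CE + 1)) by ring]
      refine mul_le_of_le_one_right (by positivity) ?_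
      rw [div_le_one (by positivity)]; linarith only [hCE]
    exact h1.trans h2
  obtain ⟨hgood, hgood8⟩ := hgoodF w ⟨hw0, Lw₆⟩ n hn8 y hy
  -- threshold, `θ`, `Θ`, the majorants
  obtain ⟨N, hN⟩ : ∃ N : ℕ, N = ⌊ε₀ / (2 * w)⌋₊ := ⟨_, rfl⟩
  obtain ⟨hN4, _hNle, hNge⟩ := threshold_bounds hw0 hε₀0 Lwε hN
  have hN1 : 1 ≤ N := by
    have : (1 : ℝ) ≤ N := by linarith only [hN4]
    exact_mod_cast this
  obtain ⟨θ, hθ⟩ : ∃ θ : ℝ, θ = A' ^ (((Finset.range n).filter fun j : ℕ =>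
      α₀ ≤ Real.sin (π * (y - ((j : ℝ) + 1) * w)) ^ 2).card - 8) := ⟨_, rfl⟩
  have hθ0 : 0 ≤ θ := by rw [hθ]; positivity
  have hθCA : θ * (n : ℝ) ^ 3 ≤ CA := by
    rw [hθ, hCA]
    exact theta_cube_le hA'0.le hA'1.le hC₀b hgood8 (by linarith only [hgood])
  obtain ⟨Θ, hΘ⟩ : ∃ Θ : ℝ, Θ = (2 * C₃) ^ 8 * θ / w ^ 8 := ⟨_, rfl⟩
  have hΘ' : Θ = (2 * C₃) ^ 8 * A' ^ (((Finset.range n).filter fun j : ℕ =>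
      α₀ ≤ Real.sin (π * (y - ((j : ℝ) + 1) * w)) ^ 2).card - 8) / w ^ 8 := by rw [hΘ, hθ]
  obtain ⟨B0f, hB0f⟩ : ∃ B0f : ℤ → ℝ, B0f = fun ξ : ℤ =>
    KR * rexp (-(c' * n * w ^ 2 * (ξ : ℝ) ^ 2)) + Θ * tailWeight N 6 ξ := ⟨_, rfl⟩
  obtain ⟨B1f, hB1f⟩ : ∃ B1f : ℤ → ℝ, B1f = fun ξ : ℤ =>
    C₁ * w ^ 2 * (3 + |(ξ : ℝ)|) * (KR * rexp (-(c' * n * w ^ 2 * (ξ : ℝ) ^ 2))) * (KS * n) +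
      2 * C₁ * σ' * Θ * n * w ^ 3 * tailWeight N 4 ξ := ⟨_, rfl⟩
  obtain ⟨B2f, hB2f⟩ : ∃ B2f : ℤ → ℝ, B2f = fun ξ : ℤ => KR * rexp (-(c' * n * w ^ 2 * (ξ : ℝ) ^ 2)) *
        (C₂ * w ^ 2 * (KS * n) + (C₁ * w ^ 2 * (3 + |(ξ : ℝ)|)) ^ 2 * (KS * n) ^ 2) +
      Θ * (C₂ * σ' * n * w ^ 3 * tailWeight N 5 ξ + 4 * C₁ ^ 2 * σ' ^ 2 * n ^ 2 * w ^ 6 * tailWeight N 2 ξ) :=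
    ⟨_, rfl⟩
  have hPall := fun ξ : ℤ => majorant_bounds (τ := τ) (h := h) hw0 Lw1' hn1N hn hCE hC₁ hC₂ hC₃ hA'0 hA'1.le
    hε₀0 hε₀1 hσ20.le hα₀.le Lwε hgauss hd1 hd2 hunit hdec hstrict hsmallCE hgood hgood8 hN hKR hc' hKS hΘ'
    hσ' ξ (B0 := B0f ξ) (B1 := B1f ξ) (B2 := B2f ξ) (by rw [hB0f]) (by rw [hB1f]) (by rw [hB2f])
  -- the seven sums
  have h00 := sum_B0_le hw0 Lw1' hn1 hn rfl hKR0.le hc'0 hc'1 hθ0 hθCA hΘ hε₀0 hN1 hNge hB0f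
  have h01 := sum_abs_mul_B0_le hw0 Lw1' hn1 hn rfl hKR0.le hc'0 hc'1 hθ0 hθCA hΘ hε₀0 hN1 hNge hB0f
  have h02 := sum_sq_mul_B0_le hw0 Lw1' hn1 hn rfl hKR0.le hc'0 hc'1 hθ0 hθCA hΘ hε₀0 hN1 hNge hB0f
  have h10 := sum_B1_le hw0 Lw1' hn1 hn rfl hKR0.le hc'0 hc'1 hKS0.le hC₁ hσ'0 hθ0 hθCA hΘ hε₀0 hN1 hNge hB1f
  have h11 := sum_abs_mul_B1_le hw0 Lw1' hn1 hn rfl hKR0.le hc'0 hc'1 hKS0.le hC₁ hσ'0 hθ0 hθCA hΘ hε₀0 hN1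
    hNge hB1f
  have h12 := sum_sq_mul_B1_le hw0 Lw1' hn1 hn rfl hKR0.le hc'0 hc'1 hKS0.le hC₁ hσ'0 hθ0 hθCA hΘ hε₀0 hN1
    hNge hB1f
  have h22 := sum_sq_mul_B2_le hw0 Lw1' hn1 hn rfl hKR0.le hc'0 hc'1 hKS0.le hC₂ hσ'0 hθ0 hθCA hΘ hε₀0 hN1
    hNge hB2f
  rw [← hK00] at h00; rw [← hK01] at h01; rw [← hK02] at h02; rw [← hK10] at h10; rw [← hK11] at h11
  rw [← hK12] at h12; rw [← hK22] at h22
  -- the main lemma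
  obtain ⟨hcd, hb⟩ := approxKernels_main hτ hw0 Lw1' hH hsmall hn1 hn rfl hu hPall h00 h01 h02 h10 h11 h12 h22
    hKf
  refine ⟨hcd, fun x => ?_⟩
  obtain ⟨c0, c1, c2, c3, c4⟩ := hb x
  have hU0 : 0 ≤ ahL1 u := by
    unfold ahL1; exact setIntegral_nonneg measurableSet_Ico fun t _ => abs_nonneg _
  have hd0 : 0 < w * Real.sqrt n := by positivity
  have hnum : Kf * ahL1 u ≤ (Kf + 1) * ahL1 u := mul_le_mul_of_nonneg_right (by linarith only [hKf0]) hU0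
  exact ⟨c0.trans (div_le_div_of_nonneg_right hnum hd0.le),
    c1.trans (div_le_div_of_nonneg_right hnum (by positivity)),
    c2.trans (div_le_div_of_nonneg_right hnum (by positivity)),
    c3.trans (div_le_div_of_nonneg_right hnum hd0.le),
    c4.trans (div_le_div_of_nonneg_right hnum hd0.le)⟩

end Final

end Literature.Barriers.AtomisticToContinuum.HeatConduction
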